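import Mathlib
import Mathlib.AlgebraicGeometry.Noetherian
import Mathlib.RingTheory.Localization.AtPrime.Basic
import Literature.AlgebraicGeometry.Resolution.WeightedResolutionDatum
import Literature.AlgebraicGeometry.Resolution.SmoothStalksRegular
import Literature.AlgebraicGeometry.Resolution.HypersurfaceHeightTwoWeightedCentre
import Literature.AlgebraicGeometry.Resolution.OrderFlatLocalHom
import Literature.AlgebraicGeometry.Resolution.SemiStablePairFieldBaseChange
import Literature.AlgebraicGeometry.Resolution.FlatLocalRegularAscent
import Literature.AlgebraicGeometry.Resolution.StalkIdealLemmas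
import Literature.AlgebraicGeometry.Resolution.FormallySmoothFieldBaseChangeStalks
import Literature.AlgebraicGeometry.Resolution.WeightedCentreGermsHeightTwoProofs
import HarnessLib

/-!
# `AbramovichQuekSchober2025_separableBaseChange` HOLDS — the lex-maximal weighted centre germ of a hypersurface at a height-two point is stable under formally smooth base change of the ground field (re-homed proofs, file 2 of 2)

Family `resolution` material RE-HOMED into `Literature/` by the Hodge foundations lane (`lit-hodgefound`, seat p20, generation 35),
file 2 of 2: verbatim ports, in dependency order and each with its original module docstring (Parts 1–12), of the route
`ResolutionOfSingularities/WeightedInvariant` modules `Summits/ResolutionOfSingularities/ResolutionOfSingularities/Theorems/{WeightedInvariantHypersurfaceLocalGameEFTDimTwoNewton,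
AQSHeightTwoSlopeFiltration, WeightedInvariantAQSBaseChangeFace, WeightedInvariantAQSBaseChangeBinomial, WeightedInvariantWeightedConstructionWeightedChartBasicOpen,
WeightedInvariantAQSBaseChangeDescent, AQSHeightTwoSlopeCompare, WeightedInvariantAQSBaseChangeLexMaxPrelim, WeightedInvariantAQSBaseChangeLexMax,
WeightedInvariantAQSBaseChangeSquare, WeightedInvariantAQSBaseChangeTheorem, WeightedInvariantAQSBaseChangeHolds}.lean` (door crux
`HypersurfaceCentreConstruction`, stmt-ResolutionOfSingularities-19897; pieces (o25-δ…) of cell seats res-D-pv-025 / res-type-047), namespace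
`Summit.ResolutionOfSingularities.ResolutionOfSingularities.Theorems` (with sub-namespaces `LocalGameEFTNewton`, `AQSHeightTwo`, `AQSBaseChange`)
re-rooted as `Literature.AlgebraicGeometry.Resolution.WeightedInvariant`; the six lower modules of the cone are file 1 of 2
(`WeightedCentreGermsHeightTwoProofs`, imported); theorems only (no definition, no named fact), imports Literature/Mathlib only; all
`[folklore]` helpers privatised (Part 0 re-proves privately the three short `[folklore]` helpers of file 1 that Parts 1–9 use —
`prod_pow_mem_weightedMonomialIdeal`, `LocalGameEFTSteepening.span_pair_steepen_eq`, `AQSHeightTwo.pow_mem_weightedMonomialIdeal_mul` —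
private there); `open` commands made `_root_`-explicit.  CONTENT (Abramovich–Quek–Schober 2025, arXiv:2507.01232, §3; Włodarczyk 2022;
Matsumura §28): the dimension-two Newton-polygon game (Part 1), the height-two slope filtration and slope comparison (Parts 2, 7), faces,
binomial descent and descent of weighted centre germs along flat local maps (Parts 3–6, with weighted charts on basic opens), the
lex-maximal admissible weighted centre germ and its base change (Parts 8–10), the separable base-change THEOREM on the essentially-finite-type
locus (Part 11) and, with the Literature lemma `formallySmoothBaseChange_localData` (Matsumura Thm 28.7 in dimension 0, proved in the tree),
for EVERY formally smooth `k'/k` (Part 12, apex renamed `AQSBaseChange.separableBaseChange_allFormallySmooth`).  WHY: Part 12 is the only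
proof in the tree of the Literature named fact `AlgebraicGeometry.Resolution.AbramovichQuekSchober2025_separableBaseChange` (AQS 2025 Thm 1.3 (1) /
Thm 3.5, last clause: «`J` is stable under base change to separable field extensions of `k`», typed for formally smooth `k'/k` at the
points where the base-changed local ring is still 2-dimensional), which `Literature/` could not import; Part 13 restates that discharge
under its FULLY-QUALIFIED name of record.  Summits-side twin:
`Summit.ResolutionOfSingularities.ResolutionOfSingularities.Theorems.AQSBaseChange.AbramovichQuekSchober2025_separableBaseChange_holds`.
The Summits originals stay in place (transitional duplication; cited here).  Honest framing of the originals stands: a kernel theorem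
about weighted-centre germs of hypersurfaces at height-two points; nothing here is a claim about H. Hironaka's manuscript or about
resolution in positive characteristic; AI-written, weaker than expert review.
-/

noncomputable section

/-! ## Part 0 — three short `[folklore]` helpers of file 1 (`WeightedCentreGermsHeightTwoProofs`, private there) -/

section Part0

namespace Literature.AlgebraicGeometry.Resolution.WeightedInvariant

open _root_.IsLocalRing _root_.Literature.AlgebraicGeometry.Resolution

section Jets

variable {A : Type*} [CommRing A] {m : ℕ}

/-- A monomial `u^α` of weighted degree `Σ wᵢ αᵢ ≥ n` lies in the piece of degree `n`. [folklore] -/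
private theorem prod_pow_mem_weightedMonomialIdeal (u : Fin m → A) (w : Fin m → ℕ) {n : ℕ} (α : Fin m → ℕ)
    (hα : n ≤ ∑ i, w i * α i) : ∏ i, u i ^ α i ∈ weightedMonomialIdeal u w n :=
  Ideal.subset_span ⟨α, hα, rfl⟩

end Jets

namespace LocalGameEFTSteepening

universe u

variable {S : Type u} [CommRing S]

/-- Steepening does not change the ideal `(x, y)`: `(x, y - c x^b) = (x, y)` for `b ≥ 1`. [folklore] -/
private theorem span_pair_steepen_eq (x y c : S) {b : ℕ} (hb : 1 ≤ b) :
    Ideal.span {x, y - c * x ^ b} = Ideal.span {x, y} := by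
  obtain ⟨b', rfl⟩ := Nat.exists_eq_add_of_le hb
  apply le_antisymm
  · rw [Ideal.span_le, Set.insert_subset_iff, Set.singleton_subset_iff]
    exact ⟨Ideal.subset_span (by simp), Ideal.mem_span_pair.2 ⟨-(c * x ^ b'), 1, by ring⟩⟩
  · rw [Ideal.span_le, Set.insert_subset_iff, Set.singleton_subset_iff]
    exact ⟨Ideal.subset_span (by simp), Ideal.mem_span_pair.2 ⟨c * x ^ b', 1, by ring⟩⟩

end LocalGameEFTSteepening

namespace AQSHeightTwo

universe u

variable {S : Type u} [CommRing S]

/-- Powers: `y ∈ 𝒥_a ⇒ y^k ∈ 𝒥_{a k}` for the monomial ideals of a weighted chart (multiplicativity). [folklore] -/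
private theorem pow_mem_weightedMonomialIdeal_mul {m : ℕ} (u : Fin m → S) (w : Fin m → ℕ) {y : S} {a : ℕ}
    (hy : y ∈ weightedMonomialIdeal u w a) (k : ℕ) : y ^ k ∈ weightedMonomialIdeal u w (a * k) := by
  induction k with
  | zero => rw [pow_zero, mul_zero, weightedMonomialIdeal_zero]; exact Submodule.mem_top
  | succ k ih =>
    rw [pow_succ, Nat.mul_succ]
    exact weightedMonomialIdeal_mul_le u w _ _ (Ideal.mul_mem_mul ih hy)

end AQSHeightTwo

end Literature.AlgebraicGeometry.Resolution.WeightedInvariant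

end Part0

/-!
## Part 1 — port of `Summits/ResolutionOfSingularities/ResolutionOfSingularities/Theorems/WeightedInvariantHypersurfaceLocalGameEFTDimTwoNewton.lean`

# The e.f.t. local weighted game (door `HypersurfaceCentreConstruction`): Newton data — unit monomial expansions

Topic: `Summits/ResolutionOfSingularities/ResolutionOfSingularities/Theorems`. Helper for the door item
`HypersurfaceCentreConstruction` (statement `stmt-ResolutionOfSingularities-19897`, route `WeightedInvariant`),
line `local-engine` of `res-L1-w43-plan-1` (L W4.3), ORDER (o13) «the `dim S = 2` rung of H2a′» held by
res-type-098: kernel **K5 «Newton data»** of the design memo `L/res-type-098-w43/EFT-DIM2-DESIGN.md` v2 §B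
(dealt to res-type-092 by res-L1-w43-plan-1 RULINGS gen 8 #2/#3, 2026-08-27T07:02:44Z), PART 2; PART 1 is
`…EFTDimTwoSteepening` (the weighted-filtration side: faces, face uniqueness, steepening; res-type-078's text).

This part is the Δ-EXPANSION currency of K3a's `LocalGameEFTPointMove.transform`
(`…EFTPointMoveChart`, p507345): `f = Σ_{α ∈ Δ} a_α u^α + r` with UNIT coefficients `a_α ∈ Sˣ`, a finite set
of exponents `Δ : Finset (Fin d → ℕ)` and a remainder `r ∈ 𝔪^N`.

* §1 (any local ring `S`, `u : Fin d → S` generating `𝔪`): `weightedMonomialIdeal_const_one_eq_pow` (`𝒥ₙ(u; 1,…,1) = 𝔪ⁿ`)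
  and **`exists_unitExpansion`** — for every `N` such an expansion exists with `|α| < N` on `Δ` (peel `𝔪^N = (u^α : |α| = N)`
  degree by degree, keeping the unit coefficients and pushing the non-units into `𝔪^{N+1}`).
* §2 (`S` regular local of dimension `d`, positive weights `w`; weighted quasi-regularity of a regular system of parameters,
  tree `weightedQuasiRegular_of_linearIndependent_toCotangent`): `coeff_layer_sub_mem_maximalIdeal` (the weight-`k` layer
  of an expansion is determined modulo `𝔪` by `f` modulo `𝒥_{k+1}`); **`le_weight_of_mem_weightedMonomialIdeal`**
  (`f ∈ 𝒥ₘ` forces `w·α ≥ m` on `Δ`: unit monomials cannot hide in a higher piece), its easy converse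
  `mem_weightedMonomialIdeal_of_forall_le_weight`, the witness `exists_weight_lt_of_not_mem` (`f ∉ 𝒥ₘ ⇒` some `α ∈ Δ` with
  `w·α < m` — the «`β* < b + 1`» witness of case C), and `exists_degree_eq_of_not_mem_pow` (the tangent cone read on `Δ`:
  `f ∈ 𝔪^ν ∖ 𝔪^{ν+1}` ⇒ all `|α| ≥ ν`, some `|α| = ν`).
* the two-variable statements (prepared levels ⇒ face `{(0, ν)}`, the face read on an expansion, the (K5e) case-C
  export and the (K5d)→K6 chain) are in the sibling PART 3 `…EFTDimTwoNewtonFace` (split for the 400-line rule).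

Case E / Krull (`f ∈ ⋂_b ((y^ν) + 𝔪^b) ⇒ f ∈ (y^ν)`) is K6's `LocalGameEFTContact.mem_of_forall_mem_sup_pow` (p505670) and
is not restated. [OURS · L1 W4.3] Replaces the role of NO printed item; NOT a statement of the manuscript under review
(Hironaka 2017). AI work, weaker than expert review. Def-free; `--supports stmt-ResolutionOfSingularities-19897 --as helper`.

## References

* J. Włodarczyk, *Functorial resolution by torus actions*, arXiv:2203.03090, Lemma 2.1.12 (weighted monomial
  filtrations `(u^α | Σ αᵢwᵢ ≥ a)`), §3.3 (the form `f = t^{-m} G`). [Wlodarczyk2022]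
* H. Matsumura, *Commutative Ring Theory*, Thm. 16.2 (quasi-regular sequences), Thm. 14.2. [Matsumura1987]
-/

section Part1


open _root_.IsLocalRing _root_.Literature.AlgebraicGeometry.Resolution

namespace Literature.AlgebraicGeometry.Resolution.WeightedInvariant

namespace LocalGameEFTNewton

universe u

variable {S : Type u} [CommRing S]

/-! ### §1 Unit monomial expansions in a local ring -/

section Expansion

variable [IsLocalRing S] {d : ℕ} (u : Fin d → S) (hu : Ideal.span (Set.range u) = maximalIdeal S)

include hu in
/-- Each parameter lies in `𝔪`. [folklore] -/
private theorem mem_maximalIdeal_of_span_eq (i : Fin d) : u i ∈ maximalIdeal S :=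
  hu ▸ Ideal.subset_span ⟨i, rfl⟩

include hu in
/-- A monomial `u^α` lies in `𝔪^{|α|}`. [folklore] -/
private theorem prod_pow_mem_pow (α : Fin d → ℕ) : ∏ i, u i ^ α i ∈ maximalIdeal S ^ (∑ i, α i) := by
  rw [← Finset.prod_pow_eq_pow_sum]
  exact Ideal.prod_mem_prod fun i _ => Ideal.pow_mem_pow (mem_maximalIdeal_of_span_eq u hu i) (α i)

include hu in
/-- **`𝒥ₙ(u; 1, …, 1) = 𝔪ⁿ`**: with all weights one the weighted monomial filtration of a system of generators of
`𝔪` is the `𝔪`-adic one. [cite: Wlodarczyk2022, Lemma 2.1.12] -/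
theorem weightedMonomialIdeal_const_one_eq_pow (n : ℕ) :
    weightedMonomialIdeal u (fun _ => 1) n = maximalIdeal S ^ n := by
  refine le_antisymm ?_ (pow_le_weightedMonomialIdeal_of_span_eq u (fun _ => 1) (fun _ => one_pos) hu n)
  rw [weightedMonomialIdeal, Ideal.span_le]
  rintro _ ⟨α, hα, rfl⟩
  simp only [one_mul] at hα
  exact Ideal.pow_le_pow_right hα (prod_pow_mem_pow u hu α)

include hu in
/-- `𝔪^N` is spanned, as an `S`-module, by the monomials of total degree `≥ N`. [folklore] -/
private theorem pow_eq_span_image (N : ℕ) :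
    maximalIdeal S ^ N =
      Submodule.span S ((fun α : Fin d → ℕ => ∏ i, u i ^ α i) '' {α | N ≤ ∑ i, α i}) := by
  rw [← weightedMonomialIdeal_const_one_eq_pow u hu N, weightedMonomialIdeal, Ideal.span]
  congr 1
  ext z
  simp only [one_mul, Set.mem_setOf_eq, Set.mem_image]
  constructor
  · rintro ⟨α, hα, rfl⟩
    exact ⟨α, hα, rfl⟩
  · rintro ⟨α, hα, rfl⟩
    exact ⟨α, hα, rfl⟩

include hu in
/-- **Unit monomial expansions.** In a local ring `S` with `𝔪 = (u₁, …, u_d)`, every `f` is, for every `N`, a finite sum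
`Σ_{α ∈ Δ} a_α u^α` of monomials of total degree `< N` with UNIT coefficients, up to a remainder in `𝔪^N`.
(Peel degree by degree: a non-unit coefficient in degree `N` is absorbed into `𝔪^{N+1}`.) [folklore] -/
private theorem exists_unitExpansion (f : S) (N : ℕ) :
    ∃ (Δ : Finset (Fin d → ℕ)) (a : (Fin d → ℕ) → S),
      (∀ α ∈ Δ, IsUnit (a α)) ∧ (∀ α ∈ Δ, ∑ i, α i < N) ∧
        f - ∑ α ∈ Δ, a α * ∏ i, u i ^ α i ∈ maximalIdeal S ^ N := by
  classical
  induction N with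
  | zero => exact ⟨∅, 0, by simp, by simp, by simp⟩
  | succ N ih =>
    obtain ⟨Δ, a, hunit, hdeg, hrem⟩ := ih
    set v : (Fin d → ℕ) → S := fun α => ∏ i, u i ^ α i with hv
    -- expand the remainder on the monomials of degree `≥ N`
    have hrem' : f - ∑ α ∈ Δ, a α * v α ∈
        Submodule.span S (v '' {α : Fin d → ℕ | N ≤ ∑ i, α i}) := by
      rw [← pow_eq_span_image u hu N]
      exact hrem
    obtain ⟨l, hl, hsum⟩ := (Finsupp.mem_span_image_iff_linearCombination S).mp hrem'
    have hsupp : ∀ α ∈ l.support, N ≤ ∑ i, α i := fun α hα => hl hα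
    rw [Finsupp.linearCombination_apply, Finsupp.sum] at hsum
    simp only [smul_eq_mul] at hsum
    -- the new exponents: degree exactly `N` with a unit coefficient
    set Δ₁ : Finset (Fin d → ℕ) := l.support.filter (fun α => ∑ i, α i = N ∧ IsUnit (l α)) with hΔ₁
    have hdisj : Disjoint Δ Δ₁ := by
      rw [Finset.disjoint_left]
      intro α hα hα₁
      have h1 := hdeg α hα
      have h2 := (Finset.mem_filter.mp hα₁).2.1
      omega
    set a' : (Fin d → ℕ) → S := fun α => if α ∈ Δ then a α else l α with ha'
    have ha'Δ : ∀ α ∈ Δ, a' α = a α := fun α hα => by rw [ha']; exact if_pos hα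
    have ha'Δ₁ : ∀ α ∈ Δ₁, a' α = l α := fun α hα => by
      rw [ha']; exact if_neg (Finset.disjoint_right.mp hdisj hα)
    refine ⟨Δ ∪ Δ₁, a', ?_, ?_, ?_⟩
    · intro α hα
      rcases Finset.mem_union.mp hα with h | h
      · rw [ha'Δ α h]; exact hunit α h
      · rw [ha'Δ₁ α h]; exact (Finset.mem_filter.mp h).2.2
    · intro α hα
      rcases Finset.mem_union.mp hα with h | h
      · exact Nat.lt_succ_of_lt (hdeg α h)
      · exact (Finset.mem_filter.mp h).2.1 ▸ Nat.lt_succ_self N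
    · rw [Finset.sum_union hdisj]
      have hΔ : ∑ α ∈ Δ, a' α * v α = ∑ α ∈ Δ, a α * v α :=
        Finset.sum_congr rfl fun α hα => by rw [ha'Δ α hα]
      have hΔ₁' : ∑ α ∈ Δ₁, a' α * v α = ∑ α ∈ Δ₁, l α * v α :=
        Finset.sum_congr rfl fun α hα => by rw [ha'Δ₁ α hα]
      rw [hΔ, hΔ₁']
      -- the new remainder is the sum over the discarded exponents
      have hsplit : ∑ α ∈ l.support, l α * v α =
          ∑ α ∈ Δ₁, l α * v α + ∑ α ∈ l.support.filter (fun α => ¬ (∑ i, α i = N ∧ IsUnit (l α))),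
            l α * v α := by
        rw [hΔ₁, ← Finset.sum_filter_add_sum_filter_not l.support (fun α => ∑ i, α i = N ∧ IsUnit (l α))]
      have heq : f - (∑ α ∈ Δ, a α * v α + ∑ α ∈ Δ₁, l α * v α) =
          ∑ α ∈ l.support.filter (fun α => ¬ (∑ i, α i = N ∧ IsUnit (l α))), l α * v α := by
        have h1 : f - ∑ α ∈ Δ, a α * v α = ∑ α ∈ l.support, l α * v α := hsum.symm
        rw [← sub_sub, h1, hsplit, add_sub_cancel_left]
      rw [heq]
      refine Ideal.sum_mem _ fun α hα => ?_
      obtain ⟨hαs, hnot⟩ := Finset.mem_filter.mp hα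
      have hN := hsupp α hαs
      by_cases hdegN : ∑ i, α i = N
      · -- degree `N`, non-unit coefficient: `l α ∈ 𝔪`
        have hlα : l α ∈ maximalIdeal S := by
          rw [mem_maximalIdeal, mem_nonunits_iff]
          exact fun hu' => hnot ⟨hdegN, hu'⟩
        have := Ideal.mul_mem_mul hlα (prod_pow_mem_pow u hu α)
        rw [hdegN, ← pow_succ'] at this
        exact this
      · -- degree `> N`
        have hgt : N + 1 ≤ ∑ i, α i := by omega
        exact Ideal.mul_mem_left _ _ (Ideal.pow_le_pow_right hgt (prod_pow_mem_pow u hu α))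

include hu in
/-- Easy converse: if every exponent of `Δ` has weight `≥ m` and `m ≤ N` then `f ∈ 𝒥ₘ`. [folklore] -/
private theorem mem_weightedMonomialIdeal_of_forall_le_weight (w : Fin d → ℕ) (hw : ∀ i, 0 < w i) {f : S} {Δ : Finset (Fin d → ℕ)}
    {a : (Fin d → ℕ) → S} {N m : ℕ} (hr : f - ∑ α ∈ Δ, a α * ∏ i, u i ^ α i ∈ maximalIdeal S ^ N)
    (hge : ∀ α ∈ Δ, m ≤ ∑ i, w i * α i) (hmN : m ≤ N) : f ∈ weightedMonomialIdeal u w m := by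
  have hJ : maximalIdeal S ^ N ≤ weightedMonomialIdeal u w m :=
    (Ideal.pow_le_pow_right hmN).trans (pow_le_weightedMonomialIdeal_of_span_eq u w hw hu m)
  have hsum : ∑ α ∈ Δ, a α * ∏ i, u i ^ α i ∈ weightedMonomialIdeal u w m :=
    Ideal.sum_mem _ fun α hα => Ideal.mul_mem_left _ _ (prod_pow_mem_weightedMonomialIdeal u w α (hge α hα))
  have := Ideal.add_mem _ (hJ hr) hsum
  rwa [sub_add_cancel] at this

include hu in
/-- **The sub-slope witness** (case C of the memo, «`β* < b + 1`»): if `f ∉ 𝒥ₘ` and `m ≤ N`, some exponent of the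
expansion has weight `< m`. [folklore] -/
private theorem exists_weight_lt_of_not_mem (w : Fin d → ℕ) (hw : ∀ i, 0 < w i) {f : S} {Δ : Finset (Fin d → ℕ)} {a : (Fin d → ℕ) → S}
    {N m : ℕ} (hr : f - ∑ α ∈ Δ, a α * ∏ i, u i ^ α i ∈ maximalIdeal S ^ N) (hmN : m ≤ N)
    (hf : f ∉ weightedMonomialIdeal u w m) : ∃ α ∈ Δ, ∑ i, w i * α i < m := by
  by_contra h
  push Not at h
  exact hf (mem_weightedMonomialIdeal_of_forall_le_weight u hu w hw hr h hmN)

end Expansion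

/-! ### Helpers on exponents -/

section Helpers

/-- The weight of a finitely supported exponent is the weight of the underlying function. [folklore] -/
private theorem weight_equivFunOnFinite_symm {d : ℕ} (w : Fin d → ℕ) (α : Fin d → ℕ) :
    Finsupp.weight w (Finsupp.equivFunOnFinite.symm α) = ∑ i, w i * α i := by
  rw [Finsupp.weight_apply, Finsupp.sum_fintype _ _ (fun i => by simp)]
  simp [smul_eq_mul, mul_comm]

/-- Evaluating a monomial with function exponent. [folklore] -/
private theorem eval_monomial_equivFunOnFinite_symm {d : ℕ} (u : Fin d → S) (α : Fin d → ℕ) (c : S) :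
    MvPolynomial.eval u (MvPolynomial.monomial (Finsupp.equivFunOnFinite.symm α) c) = c * ∏ i, u i ^ α i := by
  rw [MvPolynomial.eval_monomial, Finsupp.prod_fintype _ _ (fun i => pow_zero _)]
  simp

/-- `(x, y)` as a `Fin 2`-family generates `𝔪` when `(x, y) = 𝔪`. [folklore] -/
private theorem span_range_vecCons_eq [IsLocalRing S] {x y : S} (hxy : Ideal.span {x, y} = maximalIdeal S) :
    Ideal.span (Set.range ![x, y]) = maximalIdeal S := by
  rw [Matrix.range_cons_cons_empty, hxy]

/-- The `(1, b)`-weight of a two-variable exponent. [folklore] -/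
private theorem weight_two (b : ℕ) (α : Fin 2 → ℕ) : ∑ i, ![1, b] i * α i = α 0 + b * α 1 := by
  simp [Fin.sum_univ_two]

/-- The two-variable monomial. [folklore] -/
private theorem prod_two (x y : S) (α : Fin 2 → ℕ) : ∏ i, ![x, y] i ^ α i = x ^ α 0 * y ^ α 1 := by
  simp [Fin.prod_univ_two]

/-- The top face coefficient read on an expansion is a unit exactly when the vertex `(0, ν)` is an exponent (with
`prepared_face` below: always, at a prepared level). [folklore] -/
private theorem isUnit_face_top_iff [Nontrivial S] {Δ : Finset (Fin 2 → ℕ)} {a : (Fin 2 → ℕ) → S}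
    (hunit : ∀ α ∈ Δ, IsUnit (a α)) (b ν : ℕ) :
    IsUnit (if (![b * (ν - ν), ν] : Fin 2 → ℕ) ∈ Δ then a ![b * (ν - ν), ν] else 0) ↔
      (![0, ν] : Fin 2 → ℕ) ∈ Δ := by
  rw [Nat.sub_self, Nat.mul_zero]
  constructor
  · intro h
    by_contra hnot
    rw [if_neg hnot] at h
    exact not_isUnit_zero h
  · intro h
    rw [if_pos h]
    exact hunit _ h

end Helpers

/-! ### §2 Weighted independence of unit expansions (regular local rings) -/

section Independence

variable [IsRegularLocalRing S] {d : ℕ} (u : Fin d → S) (hu : Ideal.span (Set.range u) = maximalIdeal S)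
  (hdim : ringKrullDim S = d) (w : Fin d → ℕ) (hw : ∀ i, 0 < w i)

include hu hdim hw in
/-- **The weight-`k` layer of an expansion is determined modulo `𝔪`.**  Let `f = Σ_{α ∈ Δ} a_α u^α + r` with
`r ∈ 𝔪^N` (ANY coefficients), all exponents of `Δ` of weight `≥ k`, `k < N`, and let `Q` be a `w`-form of weight `k`
with `f - Q(u) ∈ 𝒥_{k+1}`.  Then the `w`-form `Σ_{α ∈ Δ, w·α = k} a_α X^α - Q` has all its coefficients in `𝔪` (weighted
quasi-regularity of the regular system of parameters `u`, tree `weightedQuasiRegular_of_linearIndependent_toCotangent`).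
[cite: Matsumura1987, Thm. 16.2] -/
theorem coeff_layer_sub_mem_maximalIdeal {f : S} {Δ : Finset (Fin d → ℕ)} {a : (Fin d → ℕ) → S} {N k : ℕ}
    (hr : f - ∑ α ∈ Δ, a α * ∏ i, u i ^ α i ∈ maximalIdeal S ^ N) (hge : ∀ α ∈ Δ, k ≤ ∑ i, w i * α i)
    (hkN : k < N) (Q : MvPolynomial (Fin d) S) (hQ : Q.IsWeightedHomogeneous w k)
    (hfQ : f - MvPolynomial.eval u Q ∈ weightedMonomialIdeal u w (k + 1)) (β : Fin d →₀ ℕ) :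
    (∑ α ∈ Δ.filter (fun α => ∑ i, w i * α i = k),
        MvPolynomial.monomial (Finsupp.equivFunOnFinite.symm α) (a α) - Q).coeff β ∈ maximalIdeal S := by
  classical
  have hmem : ∀ i, u i ∈ maximalIdeal S := mem_maximalIdeal_of_span_eq u hu
  have hli := linearIndependent_toCotangent_of_span_eq_maximalIdeal hdim u hu
  set P : MvPolynomial (Fin d) S := ∑ α ∈ Δ.filter (fun α => ∑ i, w i * α i = k),
    MvPolynomial.monomial (Finsupp.equivFunOnFinite.symm α) (a α) with hPdef
  -- `P` is a `w`-form of weight `k`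
  have hP : P.IsWeightedHomogeneous w k := by
    rw [← MvPolynomial.mem_weightedHomogeneousSubmodule]
    refine Submodule.sum_mem _ fun α hα => ?_
    rw [MvPolynomial.mem_weightedHomogeneousSubmodule]
    exact MvPolynomial.isWeightedHomogeneous_monomial w _ (a α)
      (by rw [weight_equivFunOnFinite_symm w, (Finset.mem_filter.mp hα).2])
  have hPQ : (P - Q).IsWeightedHomogeneous w k := by
    rw [← MvPolynomial.mem_weightedHomogeneousSubmodule] at hP hQ ⊢
    exact Submodule.sub_mem _ hP hQ
  -- `(P - Q)(u) ∈ 𝒥_{k+1}`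
  have hJ : maximalIdeal S ^ N ≤ weightedMonomialIdeal u w (k + 1) :=
    (Ideal.pow_le_pow_right hkN).trans (pow_le_weightedMonomialIdeal_of_span_eq u w hw hu (k + 1))
  have hevalP : MvPolynomial.eval u P = ∑ α ∈ Δ.filter (fun α => ∑ i, w i * α i = k), a α * ∏ i, u i ^ α i := by
    simp only [hPdef, map_sum, eval_monomial_equivFunOnFinite_symm u]
  have hhigh : ∑ α ∈ Δ.filter (fun α => ¬ ∑ i, w i * α i = k), a α * ∏ i, u i ^ α i ∈
      weightedMonomialIdeal u w (k + 1) := by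
    refine Ideal.sum_mem _ fun α hα => Ideal.mul_mem_left _ _ ?_
    obtain ⟨hαΔ, hne⟩ := Finset.mem_filter.mp hα
    exact prod_pow_mem_weightedMonomialIdeal u w α (by have := hge α hαΔ; omega)
  have heval : MvPolynomial.eval u (P - Q) ∈ (weightedFiltration u w).ideal (k + 1) := by
    rw [← weightedMonomialIdeal_eq_weightedFiltration_ideal, map_sub, hevalP]
    have hsplit : ∑ α ∈ Δ, a α * ∏ i, u i ^ α i =
        ∑ α ∈ Δ.filter (fun α => ∑ i, w i * α i = k), a α * ∏ i, u i ^ α i +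
          ∑ α ∈ Δ.filter (fun α => ¬ ∑ i, w i * α i = k), a α * ∏ i, u i ^ α i :=
      (Finset.sum_filter_add_sum_filter_not Δ _ _).symm
    have hkey : ∑ α ∈ Δ.filter (fun α => ∑ i, w i * α i = k), a α * ∏ i, u i ^ α i - MvPolynomial.eval u Q =
        (f - MvPolynomial.eval u Q) - (f - ∑ α ∈ Δ, a α * ∏ i, u i ^ α i) -
          ∑ α ∈ Δ.filter (fun α => ¬ ∑ i, w i * α i = k), a α * ∏ i, u i ^ α i := by
      rw [hsplit]; ring
    rw [hkey]
    exact Ideal.sub_mem _ (Ideal.sub_mem _ hfQ (hJ hr)) hhigh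
  have key := weightedQuasiRegular_of_linearIndependent_toCotangent u w hw hmem hli k (P - Q) hPQ heval β
  rwa [hu] at key

include hu hdim hw in
/-- **Unit monomials cannot hide in a higher piece.**  If `f = Σ_{α ∈ Δ} a_α u^α + r`, `a_α` units, `r ∈ 𝔪^N`, and
`f ∈ 𝒥ₘ(u; w)` with `m ≤ N`, then every exponent of `Δ` has weight `w·α ≥ m`.  [cite: Matsumura1987, Thm. 16.2] -/
theorem le_weight_of_mem_weightedMonomialIdeal {f : S} {Δ : Finset (Fin d → ℕ)} {a : (Fin d → ℕ) → S} {N m : ℕ}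
    (hunit : ∀ α ∈ Δ, IsUnit (a α)) (hr : f - ∑ α ∈ Δ, a α * ∏ i, u i ^ α i ∈ maximalIdeal S ^ N)
    (hf : f ∈ weightedMonomialIdeal u w m) (hmN : m ≤ N) : ∀ α ∈ Δ, m ≤ ∑ i, w i * α i := by
  classical
  -- induction on the level `k ≤ m`
  suffices H : ∀ k, k ≤ m → ∀ α ∈ Δ, k ≤ ∑ i, w i * α i from H m le_rfl
  intro k
  induction k with
  | zero => intro _ α _; exact Nat.zero_le _
  | succ k ih =>
    intro hkm α hα
    have hge := ih (Nat.le_of_succ_le hkm)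
    by_contra hlt
    have heq : ∑ i, w i * α i = k := by have := hge α hα; omega
    -- the weight-`k` layer against `Q = 0`: `f ∈ 𝒥ₘ ⊆ 𝒥_{k+1}`
    have hfQ : f - MvPolynomial.eval u (0 : MvPolynomial (Fin d) S) ∈ weightedMonomialIdeal u w (k + 1) := by
      rw [map_zero, sub_zero]
      exact weightedMonomialIdeal_antitone u w hkm hf
    have hcoeff := coeff_layer_sub_mem_maximalIdeal u hu hdim w hw hr hge (by omega) 0
      (MvPolynomial.isWeightedHomogeneous_zero S w k) hfQ (Finsupp.equivFunOnFinite.symm α)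
    rw [sub_zero, MvPolynomial.coeff_sum, Finset.sum_eq_single α
        (fun α' hα' hne => by
          rw [MvPolynomial.coeff_monomial, if_neg]
          exact fun h => hne (Finsupp.equivFunOnFinite.symm.injective h))
        (fun h => absurd (Finset.mem_filter.mpr ⟨hα, heq⟩) h),
      MvPolynomial.coeff_monomial, if_pos rfl] at hcoeff
    exact (mem_maximalIdeal _).mp hcoeff (hunit α hα)

include hu hdim in
/-- **The tangent cone read on `Δ`**: if `f ∈ 𝔪^ν ∖ 𝔪^{ν+1}` and `ν < N` then every exponent of a unit expansion has total
degree `≥ ν` and at least one has degree exactly `ν` (those are the monomials of the initial form of `f`).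
[cite: Matsumura1987, Thm. 16.2] -/
theorem exists_degree_eq_of_not_mem_pow {f : S} {Δ : Finset (Fin d → ℕ)} {a : (Fin d → ℕ) → S} {N ν : ℕ}
    (hunit : ∀ α ∈ Δ, IsUnit (a α)) (hr : f - ∑ α ∈ Δ, a α * ∏ i, u i ^ α i ∈ maximalIdeal S ^ N)
    (hν : f ∈ maximalIdeal S ^ ν) (hν' : f ∉ maximalIdeal S ^ (ν + 1)) (hνN : ν < N) :
    (∀ α ∈ Δ, ν ≤ ∑ i, α i) ∧ ∃ α ∈ Δ, ∑ i, α i = ν := by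
  have hone : ∀ i : Fin d, 0 < (fun _ : Fin d => 1) i := fun _ => one_pos
  have hge : ∀ α ∈ Δ, ν ≤ ∑ i, α i := by
    have h := le_weight_of_mem_weightedMonomialIdeal u hu hdim (fun _ => 1) hone hunit hr
      (by rw [weightedMonomialIdeal_const_one_eq_pow u hu]; exact hν) hνN.le
    simpa only [one_mul] using h
  refine ⟨hge, ?_⟩
  by_contra hnone
  push Not at hnone
  apply hν'
  rw [← weightedMonomialIdeal_const_one_eq_pow u hu]
  refine mem_weightedMonomialIdeal_of_forall_le_weight u hu (fun _ => 1) hone hr (fun α hα => ?_) (by omega)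
  have h1 := hge α hα
  have h2 := hnone α hα
  simp only [one_mul]
  omega

end Independence

end LocalGameEFTNewton

end Literature.AlgebraicGeometry.Resolution.WeightedInvariant

end Part1

/-!
## Part 2 — port of `Summits/ResolutionOfSingularities/ResolutionOfSingularities/Theorems/AQSHeightTwoSlopeFiltration.lean`

# Abramovich–Quek–Schober at a height-two point, I: the rational-slope weighted filtration `𝒥ₙ((x, y); (q, r))`

Topic: `Summits/ResolutionOfSingularities/ResolutionOfSingularities/Theorems`. Helper for the door item
`HypersurfaceCentreConstruction` (statement `stmt-ResolutionOfSingularities-19897`, route `WeightedInvariant`), line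
`local-engine`, ORDER (o25) «F-AQS-T in the kernel» of `res-L1-w43-plan-1` (2026-08-27T09:19:49Z): discharge of the named
fact `AbramovichQuekSchober2025_heightTwoCentre` (`Literature/…/HypersurfaceHeightTwoWeightedCentre.lean`), piece (α1) of
the design memo `plan/tools/res-type-092/o25/O25-DESIGN.md` (res-type-092).

[OURS · L1 W4.3] Folklore bookkeeping for Abramovich–Quek–Schober, arXiv:2507.01232, Def. 3.2–3.3 / Thm 3.5: the admissible
centres `J = (y^{a₁}, x^{a₂})` with RATIONAL slope `a₂/a₁ = r/q` are recorded, in the tree's currency, by the weighted monomial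
ideals `𝒥ₙ := weightedMonomialIdeal ![x, y] ![q, r] n` (`x ↦ q`, `y ↦ r`; «`δ_y ≥ r/q` iff `f ∈ 𝒥_{rν}`»).  NOT a statement of
the manuscript under review (Hironaka 2017); nothing here is a claim about resolution of singularities.  AI work, weaker than
expert review.  Def-free.

## Content (`S` a commutative ring, mostly local with `(x, y) = 𝔪`)

* `weight_two`, `monomial_mem` — two-variable bookkeeping (`prod_two` is `LocalGameEFTNewton.prod_two`);
* `maximalIdeal_le`, `maximalIdeal_pow_le` — `𝔪 ⊆ 𝒥_q`, `𝔪^t ⊆ 𝒥_{qt}` when `q ≤ r`;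
* `le_of_fst_mem` / `eq_of_fst` — the filtration does not see the transversal parameter `x` (`q ≤ r`);
* `eq_of_snd_unit_mul` — nor a unit factor on `y`;
* `eq_of_snd_eq_unit_mul_add` — SUBSTITUTION: `y' = a·y + h`, `a` a unit, `h ∈ 𝔪^t`, `r ≤ q t` ⇒ same filtration;
* `slope_antitone` — at the `y^ν` corner the level-`rν` piece grows as the slope `r/q` decreases;
* `le_pow_of_weights_le` — `𝒥_{νW+1} ⊆ 𝔪^{ν+1}` when all weights are `≤ W`;
* `le_span_pow_sup_of_lt` — `𝒥_{r'ν}((x,y');(q',r')) ⊆ (y'^ν) + 𝒥_{bν+1}((x,y');(1,b))` when `r'/q' > b`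
  (with `b = 1`: `⊆ (y'^ν) + 𝔪^{ν+1}`, the tangent line);
* `le_span_sup_pow_cdiv`, `le_span_pow_sup_iSup` — the pieces read modulo `(y)` (inputs of the `S/(y)` comparison, file II;
  `⌈a/q⌉` is spelled `(a + q - 1) / q`, cf. `Literature.Analysis.Convolution.le_mul_ceilDiv`).

## References

* D. Abramovich, M. H. Quek, B. Schober, arXiv:2507.01232v3, Def. 3.2–3.3, Rem. 3.4, Thm 3.5. [AbramovichQuekSchober2025]
* J. Włodarczyk, *Functorial resolution by torus actions*, arXiv:2203.03090, Lemma 2.1.12. [Wlodarczyk2022]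
-/

section Part2


open _root_.IsLocalRing _root_.Literature.AlgebraicGeometry.Resolution

namespace Literature.AlgebraicGeometry.Resolution.WeightedInvariant

namespace AQSHeightTwo

universe u

variable {S : Type u} [CommRing S]

/-! ### Two-variable bookkeeping -/

/-- `Σᵢ ![q, r]ᵢ αᵢ = q α₀ + r α₁`. [folklore] -/
private theorem weight_two (q r : ℕ) (α : Fin 2 → ℕ) : ∑ i, ![q, r] i * α i = q * α 0 + r * α 1 := by
  rw [Fin.sum_univ_two]; rfl

/-- The monomial `x^i y^j` of weight `q i + r j ≥ n` lies in `𝒥ₙ`. [cite: Wlodarczyk2022, Lemma 2.1.12] -/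
theorem monomial_mem (x y : S) (q r : ℕ) {i j n : ℕ} (h : n ≤ q * i + r * j) :
    x ^ i * y ^ j ∈ weightedMonomialIdeal ![x, y] ![q, r] n := by
  have := prod_pow_mem_weightedMonomialIdeal ![x, y] ![q, r] (n := n) ![i, j]
    (by rw [weight_two]; exact h)
  rwa [LocalGameEFTNewton.prod_two] at this

/-- Membership of a generator, unfolded: `z ∈ 𝒥ₙ` is generated by the `x^{α₀} y^{α₁}` with `q α₀ + r α₁ ≥ n`. [folklore] -/
private theorem weightedMonomialIdeal_two_eq (x y : S) (q r n : ℕ) :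
    weightedMonomialIdeal ![x, y] ![q, r] n =
      Ideal.span {z | ∃ α : Fin 2 → ℕ, n ≤ q * α 0 + r * α 1 ∧ z = x ^ α 0 * y ^ α 1} := by
  rw [weightedMonomialIdeal]
  congr 1
  ext z
  simp only [Set.mem_setOf_eq, weight_two, LocalGameEFTNewton.prod_two]

/-- Induction principle on generators: to bound `𝒥ₙ` by an ideal it suffices to bound the monomials. [folklore] -/
private theorem weightedMonomialIdeal_two_le {x y : S} {q r n : ℕ} {I : Ideal S}
    (h : ∀ i j : ℕ, n ≤ q * i + r * j → x ^ i * y ^ j ∈ I) :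
    weightedMonomialIdeal ![x, y] ![q, r] n ≤ I := by
  rw [weightedMonomialIdeal_two_eq, Ideal.span_le]
  rintro _ ⟨α, hα, rfl⟩
  exact h (α 0) (α 1) hα

/-! ### `𝔪 ⊆ 𝒥_q` and `𝔪^t ⊆ 𝒥_{qt}` -/

section Local

variable [IsLocalRing S]

/-- With `(x, y) = 𝔪` and `q ≤ r`: `𝔪 ⊆ 𝒥_q` (both generators have weight `≥ q`). [cite: Wlodarczyk2022, Lemma 2.1.12] -/
theorem maximalIdeal_le {x y : S} (hxy : Ideal.span {x, y} = maximalIdeal S) {q r : ℕ} (hqr : q ≤ r) :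
    maximalIdeal S ≤ weightedMonomialIdeal ![x, y] ![q, r] q := by
  rw [← hxy, Ideal.span_le, Set.insert_subset_iff, Set.singleton_subset_iff]
  refine ⟨?_, ?_⟩
  · simpa using monomial_mem x y q r (i := 1) (j := 0) (n := q) (by simp)
  · simpa using monomial_mem x y q r (i := 0) (j := 1) (n := q) (by simpa using hqr)

/-- With `(x, y) = 𝔪` and `q ≤ r`: `𝔪^t ⊆ 𝒥_{qt}`. [cite: Wlodarczyk2022, Lemma 2.1.12] -/
theorem maximalIdeal_pow_le {x y : S} (hxy : Ideal.span {x, y} = maximalIdeal S) {q r : ℕ} (hqr : q ≤ r) (t : ℕ) :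
    maximalIdeal S ^ t ≤ weightedMonomialIdeal ![x, y] ![q, r] (q * t) := by
  induction t with
  | zero => rw [pow_zero, Nat.mul_zero, weightedMonomialIdeal_zero, Ideal.one_eq_top]
  | succ t ih =>
    rw [pow_succ, Nat.mul_succ]
    exact (Ideal.mul_mono ih (maximalIdeal_le hxy hqr)).trans (weightedMonomialIdeal_mul_le ![x, y] ![q, r] _ _)

/-- A multiple of `𝔪^t` lies in `𝒥ₙ` as soon as `n ≤ q t` (`q ≤ r`). [folklore] -/
private theorem mem_of_mem_maximalIdeal_pow {x y : S} (hxy : Ideal.span {x, y} = maximalIdeal S) {q r : ℕ} (hqr : q ≤ r)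
    {t n : ℕ} (hn : n ≤ q * t) {h : S} (hh : h ∈ maximalIdeal S ^ t) :
    h ∈ weightedMonomialIdeal ![x, y] ![q, r] n :=
  weightedMonomialIdeal_antitone _ _ hn (maximalIdeal_pow_le hxy hqr t hh)

/-! ### Independence of the transversal parameter and of unit factors; substitution -/

/-- **The filtration does not see `x`** (one inclusion): if `(x, y) = 𝔪`, `q ≤ r` and `x' ∈ 𝔪`, then
`𝒥ₙ((x', y); (q, r)) ⊆ 𝒥ₙ((x, y); (q, r))`. [cite: AbramovichQuekSchober2025, Rem. 3.4] -/
theorem le_of_fst_mem {x y x' : S} (hxy : Ideal.span {x, y} = maximalIdeal S) {q r : ℕ} (hqr : q ≤ r)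
    (hx' : x' ∈ maximalIdeal S) (n : ℕ) :
    weightedMonomialIdeal ![x', y] ![q, r] n ≤ weightedMonomialIdeal ![x, y] ![q, r] n := by
  refine weightedMonomialIdeal_le_of_forall_mem ![x, y] ![x', y] ![q, r] (Fin.forall_fin_two.2 ⟨?_, ?_⟩) n
  · simpa using maximalIdeal_le hxy hqr hx'
  · simpa using self_mem_weightedMonomialIdeal ![x, y] ![q, r] 1

/-- **The filtration does not see `x`**: two regular systems `(x, y)`, `(x', y)` with the same `y` give the same
`(q, r)`-filtration (`q ≤ r`). [cite: AbramovichQuekSchober2025, Rem. 3.4] -/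
theorem eq_of_fst {x y x' : S} (hxy : Ideal.span {x, y} = maximalIdeal S) (hx'y : Ideal.span {x', y} = maximalIdeal S)
    {q r : ℕ} (hqr : q ≤ r) (n : ℕ) :
    weightedMonomialIdeal ![x', y] ![q, r] n = weightedMonomialIdeal ![x, y] ![q, r] n :=
  le_antisymm (le_of_fst_mem hxy hqr (hx'y ▸ Ideal.subset_span (by simp)) n)
    (le_of_fst_mem hx'y hqr (hxy ▸ Ideal.subset_span (by simp)) n)

omit [IsLocalRing S] in
/-- A unit factor on `y` does not change the filtration. [folklore] -/
private theorem eq_of_snd_unit_mul (x y : S) {v : S} (hv : IsUnit v) (q r n : ℕ) :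
    weightedMonomialIdeal ![x, v * y] ![q, r] n = weightedMonomialIdeal ![x, y] ![q, r] n := by
  obtain ⟨v, rfl⟩ := hv
  have h1 : ((v : S) * y - y) ∈ weightedMonomialIdeal ![x, y] ![q, r] r := by
    have e : ((v : S) * y - y) = ((v : S) - 1) * y := by ring
    rw [e]
    refine Ideal.mul_mem_left _ _ ?_
    have := self_mem_weightedMonomialIdeal ![x, y] ![q, r] 1
    simpa using this
  have h2 : (y - (v : S) * y) ∈ weightedMonomialIdeal ![x, (v : S) * y] ![q, r] r := by
    have e : (y - (v : S) * y) = ((v⁻¹ : Sˣ) - 1 : S) * ((v : S) * y) := by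
      rw [sub_mul, one_mul, ← mul_assoc, Units.inv_mul, one_mul]
    rw [e]
    refine Ideal.mul_mem_left _ _ ?_
    have := self_mem_weightedMonomialIdeal ![x, (v : S) * y] ![q, r] 1
    simpa using this
  refine weightedMonomialIdeal_eq_of_forall_sub_mem ![x, y] ![x, (v : S) * y] ![q, r] ?_ ?_ n
  · intro i
    fin_cases i
    · simp
    · simpa using h1
  · intro i
    fin_cases i
    · simp
    · simpa using h2

/-- If `(x, y) = 𝔪`, `a` is a unit and `h ∈ 𝔪²`, then `(x, a y + h) = 𝔪`. [folklore] -/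
private theorem span_pair_eq_of_unit_mul_add {x y a h : S} (hxy : Ideal.span {x, y} = maximalIdeal S) (ha : IsUnit a)
    (hh : h ∈ maximalIdeal S ^ 2) : Ideal.span {x, a * y + h} = maximalIdeal S := by
  have hx : x ∈ maximalIdeal S := hxy ▸ Ideal.subset_span (by simp)
  have hy : y ∈ maximalIdeal S := hxy ▸ Ideal.subset_span (by simp)
  -- `h = x m₁ + y m₂` with `m₁, m₂ ∈ 𝔪`
  have hh' : h ∈ Ideal.span {x} * maximalIdeal S ⊔ Ideal.span {y} * maximalIdeal S := by
    have e : maximalIdeal S ^ 2 = Ideal.span {x} * maximalIdeal S ⊔ Ideal.span {y} * maximalIdeal S := by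
      rw [pow_two, ← Ideal.sup_mul, ← Ideal.span_insert, hxy]
    rwa [e] at hh
  obtain ⟨h₁, hh₁, h₂, hh₂, rfl⟩ := Submodule.mem_sup.mp hh'
  obtain ⟨m₁, hm₁, rfl⟩ := Ideal.mem_span_singleton_mul.mp hh₁
  obtain ⟨m₂, hm₂, rfl⟩ := Ideal.mem_span_singleton_mul.mp hh₂
  have hunit : IsUnit (a + m₂) := by
    by_contra hnu
    have hmem : a + m₂ ∈ maximalIdeal S := (IsLocalRing.mem_maximalIdeal _).mpr hnu
    have : a ∈ maximalIdeal S := by simpa using Ideal.sub_mem _ hmem hm₂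
    exact (IsLocalRing.mem_maximalIdeal _).mp this ha
  obtain ⟨w, hw⟩ := hunit
  have hy' : a * y + (x * m₁ + y * m₂) = ↑w * y + m₁ * x := by rw [hw]; ring
  set y' : S := a * y + (x * m₁ + y * m₂) with hy'def
  apply le_antisymm
  · rw [Ideal.span_le, Set.insert_subset_iff, Set.singleton_subset_iff]
    exact ⟨hx, Ideal.add_mem _ (Ideal.mul_mem_left _ _ hy)
      (Ideal.add_mem _ (Ideal.mul_mem_right _ _ hx) (Ideal.mul_mem_right _ _ hy))⟩
  · rw [← hxy, Ideal.span_le, Set.insert_subset_iff, Set.singleton_subset_iff]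
    refine ⟨Ideal.subset_span (by simp), ?_⟩
    have hmem : ↑w⁻¹ * (y' - m₁ * x) ∈ Ideal.span {x, y'} :=
      Ideal.mul_mem_left _ _ (Ideal.sub_mem _ (Ideal.subset_span (by simp))
        (Ideal.mul_mem_left _ _ (Ideal.subset_span (by simp))))
    have heq : ↑w⁻¹ * (y' - m₁ * x) = y := by
      rw [hy', add_sub_cancel_right, Units.inv_mul_cancel_left]
    rw [heq] at hmem
    exact hmem

/-- **Substitution**: if `(x, y) = 𝔪`, `q ≤ r`, `a` is a unit, `h ∈ 𝔪^t` with `2 ≤ t` and `r ≤ q t`, then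
`y' = a y + h` defines the same `(q, r)`-filtration as `y` (the perturbation `h` has weight `≥ q t ≥ r`).
[cite: AbramovichQuekSchober2025, Thm 3.5 proof (c)] -/
theorem eq_of_snd_eq_unit_mul_add {x y a h : S} (hxy : Ideal.span {x, y} = maximalIdeal S) (ha : IsUnit a)
    {t : ℕ} (ht : 2 ≤ t) (hh : h ∈ maximalIdeal S ^ t) {q r : ℕ} (hqr : q ≤ r) (hrt : r ≤ q * t) (n : ℕ) :
    weightedMonomialIdeal ![x, a * y + h] ![q, r] n = weightedMonomialIdeal ![x, y] ![q, r] n := by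
  have hh2 : h ∈ maximalIdeal S ^ 2 := Ideal.pow_le_pow_right ht hh
  have hxy' : Ideal.span {x, a * y + h} = maximalIdeal S := span_pair_eq_of_unit_mul_add hxy ha hh2
  obtain ⟨a, rfl⟩ := ha
  -- `y' - y = (a - 1) y + h` and `y - y' = (a⁻¹ - 1) y' - a⁻¹ h`
  have h1 : ((a : S) * y + h - y) ∈ weightedMonomialIdeal ![x, y] ![q, r] r := by
    have e : ((a : S) * y + h - y) = ((a : S) - 1) * y + h := by ring
    rw [e]
    refine Ideal.add_mem _ (Ideal.mul_mem_left _ _ ?_) (mem_of_mem_maximalIdeal_pow hxy hqr hrt hh)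
    simpa using self_mem_weightedMonomialIdeal ![x, y] ![q, r] 1
  have h2 : (y - ((a : S) * y + h)) ∈ weightedMonomialIdeal ![x, (a : S) * y + h] ![q, r] r := by
    have e : (y - ((a : S) * y + h)) = ((a⁻¹ : Sˣ) - 1 : S) * ((a : S) * y + h) - ((a⁻¹ : Sˣ) : S) * h := by
      rw [sub_mul, one_mul, mul_add, ← mul_assoc, Units.inv_mul, one_mul]; ring
    rw [e]
    refine Ideal.sub_mem _ (Ideal.mul_mem_left _ _ ?_)
      (Ideal.mul_mem_left _ _ (mem_of_mem_maximalIdeal_pow hxy' hqr hrt hh))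
    simpa using self_mem_weightedMonomialIdeal ![x, (a : S) * y + h] ![q, r] 1
  refine weightedMonomialIdeal_eq_of_forall_sub_mem ![x, y] ![x, (a : S) * y + h] ![q, r] ?_ ?_ n
  · intro i
    fin_cases i
    · simp
    · simpa using h1
  · intro i
    fin_cases i
    · simp
    · simpa using h2

/-- **All weights `≤ W`**: `𝒥_{νW+1}(u; w) ⊆ 𝔪^{ν+1}` (a monomial of weight `> νW` has total degree `> ν`). Used for the
first clause of lex-maximality: an admissible `(y'; w'; ℓ')` has `ℓ' ≤ ν w'₀`. [cite: AbramovichQuekSchober2025, Def. 3.2] -/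
theorem le_pow_of_weights_le {x y : S} (hx : x ∈ maximalIdeal S) (hy : y ∈ maximalIdeal S) {q r W : ℕ}
    (hq : q ≤ W) (hr : r ≤ W) (ν : ℕ) :
    weightedMonomialIdeal ![x, y] ![q, r] (ν * W + 1) ≤ maximalIdeal S ^ (ν + 1) := by
  refine weightedMonomialIdeal_two_le fun i j hij => ?_
  have hdeg : ν + 1 ≤ i + j := by
    by_contra hlt
    push Not at hlt
    have : q * i + r * j ≤ W * (i + j) := by nlinarith
    have : W * (i + j) ≤ W * ν := Nat.mul_le_mul_left _ (by omega)
    nlinarith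
  have hmem : x ^ i * y ^ j ∈ maximalIdeal S ^ (i + j) := by
    rw [pow_add]; exact Ideal.mul_mem_mul (Ideal.pow_mem_pow hx i) (Ideal.pow_mem_pow hy j)
  exact Ideal.pow_le_pow_right hdeg hmem

omit [IsLocalRing S] in
/-- **Above an integer level**: if `b q' < r'` (slope `r'/q' > b`) then
`𝒥_{r'ν}((x, y'); (q', r')) ⊆ (y'^ν) + 𝒥_{bν+1}((x, y'); (1, b))` — every monomial not divisible by `y'^ν` is strictly above the
`(1, b)`-face. With `b = 1` the right-hand side is `(y'^ν) + 𝔪^{ν+1}` (`le_span_pow_sup_pow`).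
[cite: AbramovichQuekSchober2025, Def. 3.2–3.3] -/
theorem le_span_pow_sup_of_lt (x y' : S) {q' r' b : ℕ} (hb : b * q' < r') (ν : ℕ) :
    weightedMonomialIdeal ![x, y'] ![q', r'] (r' * ν) ≤
      Ideal.span {y' ^ ν} ⊔ weightedMonomialIdeal ![x, y'] ![1, b] (b * ν + 1) := by
  refine weightedMonomialIdeal_two_le fun i j hij => ?_
  by_cases hj : ν ≤ j
  · obtain ⟨d, rfl⟩ := Nat.exists_eq_add_of_le hj
    refine Ideal.mem_sup_left ?_
    rw [pow_add, mul_comm (y' ^ ν), ← mul_assoc]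
    exact Ideal.mul_mem_left _ _ (Ideal.mem_span_singleton_self _)
  · push Not at hj
    refine Ideal.mem_sup_right (monomial_mem x y' 1 b ?_)
    -- `q' i ≥ r'(ν - j) > b q' (ν - j)` forces `i ≥ b(ν - j) + 1`
    obtain ⟨d, rfl⟩ := Nat.exists_eq_add_of_lt hj
    have h1 : q' * i ≥ r' * (d + 1) := by nlinarith
    have h2 : r' * (d + 1) ≥ (b * q' + 1) * (d + 1) := Nat.mul_le_mul_right _ hb
    have h3 : q' * i > q' * (b * (d + 1)) := by nlinarith
    have h4 : b * (d + 1) < i := Nat.lt_of_mul_lt_mul_left h3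
    nlinarith

/-- The case `b = 1`: slope `> 1` puts everything but `y'^ν` into `𝔪^{ν+1}` — the tangent cone of `f ∈ 𝒥_{r'ν}` is the
`ν`-fold line `ȳ' = 0`. [cite: AbramovichQuekSchober2025, §2 (δ > 1)] -/
theorem le_span_pow_sup_pow {x y' : S} (hxy' : Ideal.span {x, y'} = maximalIdeal S) {q' r' : ℕ}
    (hlt : q' < r') (ν : ℕ) :
    weightedMonomialIdeal ![x, y'] ![q', r'] (r' * ν) ≤ Ideal.span {y' ^ ν} ⊔ maximalIdeal S ^ (ν + 1) := by
  have h := le_span_pow_sup_of_lt x y' (b := 1) (by simpa using hlt) ν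
  rwa [LocalGameEFTSteepening.weightedMonomialIdeal_one_eq_pow, hxy', one_mul] at h

/-- From `f ∈ (y'^ν) + 𝔪^{ν+1}` and `f ∉ 𝔪^{ν+1}`: `f = c y'^ν + m` with `c` a UNIT and `m ∈ 𝔪^{ν+1}`. [folklore] -/
private theorem exists_unit_mul_pow_add {y' f : S} (hy' : y' ∈ maximalIdeal S) {ν : ℕ}
    (hf : f ∈ Ideal.span {y' ^ ν} ⊔ maximalIdeal S ^ (ν + 1)) (hford : f ∉ maximalIdeal S ^ (ν + 1)) :
    ∃ c m : S, IsUnit c ∧ m ∈ maximalIdeal S ^ (ν + 1) ∧ f = c * y' ^ ν + m := by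
  obtain ⟨a, ha, m, hm, rfl⟩ := Submodule.mem_sup.mp hf
  obtain ⟨c, rfl⟩ := Ideal.mem_span_singleton'.mp ha
  refine ⟨c, m, ?_, hm, rfl⟩
  by_contra hc
  apply hford
  refine Ideal.add_mem _ ?_ hm
  rw [pow_succ']
  exact Ideal.mul_mem_mul ((IsLocalRing.mem_maximalIdeal _).mpr hc) (Ideal.pow_mem_pow hy' ν)

/-! ### Reading modulo `(y)`: ceiling bookkeeping -/

omit [IsLocalRing S] in
/-- `a ≤ q i ⇒ ⌈a/q⌉ ≤ i`. [folklore] -/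
private theorem cdiv_le_of_le_mul {a q i : ℕ} (hq : 0 < q) (h : a ≤ q * i) : (a + q - 1) / q ≤ i := by
  rw [Nat.div_le_iff_le_mul_add_pred hq]
  omega

/-- **Modulo `(y)` only the `x`-axis survives**: `𝒥ₙ((x, y); (q, r)) ⊆ (y) + 𝔪^⌈n/q⌉` (`q ≥ 1`, `x ∈ 𝔪`).
[cite: AbramovichQuekSchober2025, Def. 3.2] -/
theorem le_span_sup_pow_cdiv {x : S} (hx : x ∈ maximalIdeal S) (y : S) {q : ℕ} (hq : 0 < q) (r n : ℕ) :
    weightedMonomialIdeal ![x, y] ![q, r] n ≤ Ideal.span {y} ⊔ maximalIdeal S ^ ((n + q - 1) / q) := by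
  refine weightedMonomialIdeal_two_le fun i j hij => ?_
  rcases Nat.eq_zero_or_pos j with rfl | hj
  · refine Ideal.mem_sup_right ?_
    rw [pow_zero, mul_one]
    exact Ideal.pow_le_pow_right (cdiv_le_of_le_mul hq (by simpa using hij)) (Ideal.pow_mem_pow hx i)
  · refine Ideal.mem_sup_left (Ideal.mul_mem_left _ _ ?_)
    obtain ⟨d, rfl⟩ := Nat.exists_eq_add_of_le hj
    rw [pow_add, pow_one]
    exact Ideal.mul_mem_right _ _ (Ideal.mem_span_singleton_self y)

/-- **The lower pieces**: `𝒥_{r'ν}((x, y'); (q', r')) ⊆ (y'^ν) + ⨆_{j<ν} (y'^j) 𝔪^⌈r'(ν-j)/q'⌉` (`q' ≥ 1`, `x ∈ 𝔪`).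
[cite: AbramovichQuekSchober2025, Def. 3.2] -/
theorem le_span_pow_sup_iSup {x : S} (hx : x ∈ maximalIdeal S) (y' : S) {q' : ℕ} (hq' : 0 < q') (r' ν : ℕ) :
    weightedMonomialIdeal ![x, y'] ![q', r'] (r' * ν) ≤
      Ideal.span {y' ^ ν} ⊔ ⨆ j, ⨆ (_ : j < ν), Ideal.span {y' ^ j} * maximalIdeal S ^ ((r' * (ν - j) + q' - 1) / q') := by
  refine weightedMonomialIdeal_two_le fun i j hij => ?_
  by_cases hj : ν ≤ j
  · obtain ⟨d, rfl⟩ := Nat.exists_eq_add_of_le hj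
    refine Ideal.mem_sup_left ?_
    rw [pow_add, mul_comm (y' ^ ν), ← mul_assoc]
    exact Ideal.mul_mem_left _ _ (Ideal.mem_span_singleton_self _)
  · push Not at hj
    refine Ideal.mem_sup_right ?_
    refine (le_iSup (fun j => ⨆ (_ : j < ν), Ideal.span {y' ^ j} * maximalIdeal S ^ ((r' * (ν - j) + q' - 1) / q')) j)
      ((le_iSup (fun _ : j < ν => Ideal.span {y' ^ j} * maximalIdeal S ^ ((r' * (ν - j) + q' - 1) / q')) hj) ?_)
    rw [mul_comm (x ^ i)]
    refine Ideal.mul_mem_mul (Ideal.mem_span_singleton_self _) (Ideal.pow_le_pow_right ?_ (Ideal.pow_mem_pow hx i))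
    refine cdiv_le_of_le_mul hq' ?_
    have : r' * (ν - j) + r' * j = r' * ν := by rw [← Nat.mul_add, Nat.sub_add_cancel hj.le]
    omega

end Local

/-! ### Slope monotonicity and the swap of the two variables -/

/-- **Slope monotonicity at the `y^ν` corner**: if `r'/q' ≤ r/q` (`q, q' ≥ 1`) then
`𝒥_{rν}((x,y);(q,r)) ⊆ 𝒥_{r'ν}((x,y);(q',r'))`. [cite: AbramovichQuekSchober2025, Rem. 3.4] -/
theorem slope_antitone (x y : S) {q r q' r' : ℕ} (hq : 0 < q) (h : r' * q ≤ r * q') (ν : ℕ) :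
    weightedMonomialIdeal ![x, y] ![q, r] (r * ν) ≤ weightedMonomialIdeal ![x, y] ![q', r'] (r' * ν) := by
  refine weightedMonomialIdeal_two_le fun i j hij => monomial_mem x y q' r' ?_
  by_cases hj : ν ≤ j
  · nlinarith
  · push Not at hj
    -- `q i ≥ r (ν - j)` ⇒ `q q' i ≥ r q' (ν - j) ≥ r' q (ν - j)` ⇒ `q' i ≥ r' (ν - j)`
    obtain ⟨d, rfl⟩ := Nat.exists_eq_add_of_lt hj
    have h1 : q * i ≥ r * (d + 1) := by nlinarith
    have h2 : q * (q' * i) ≥ q * (r' * (d + 1)) := by nlinarith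
    have h3 : q' * i ≥ r' * (d + 1) := le_of_mul_le_mul_left h2 hq
    nlinarith

/-- **Swap**: `𝒥ₙ(![a, b]; ![wa, wb]) = 𝒥ₙ(![b, a]; ![wb, wa])` (the predicate `IsLexMaxWeightedCentreGerm` lists the
ORDER variable first). [folklore] -/
private theorem weightedMonomialIdeal_swap (a b : S) (wa wb n : ℕ) :
    weightedMonomialIdeal ![a, b] ![wa, wb] n = weightedMonomialIdeal ![b, a] ![wb, wa] n := by
  apply le_antisymm
  · refine weightedMonomialIdeal_two_le fun i j hij => ?_
    rw [mul_comm]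
    exact monomial_mem b a wb wa (by omega)
  · refine weightedMonomialIdeal_two_le fun i j hij => ?_
    rw [mul_comm]
    exact monomial_mem a b wa wb (by omega)

end AQSHeightTwo

end Literature.AlgebraicGeometry.Resolution.WeightedInvariant

end Part2

/-!
## Part 3 — port of `Summits/ResolutionOfSingularities/ResolutionOfSingularities/Theorems/WeightedInvariantAQSBaseChangeFace.lean`

# The binomial face of `f` along a weighted filtration: reading it modulo `𝔪` and lifting it

Route `ResolutionOfSingularities/WeightedInvariant`, door crux `HypersurfaceCentreConstruction`
(stmt-ResolutionOfSingularities-19897) — OURS, helper; e-ladder `e = 1`, piece **(o25-δ)** «separable base change of the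
Abramovich–Quek–Schober centre in the kernel» (res-D-pv-025 AS stub-10; CHAIN w43 v4.18 (3)), brick **(δ1a)**.

In a two-dimensional regular local ring `T` with regular system of parameters `(x, y)` and weights `(1, b)`, the
`(1,b)`-FACE of `f ∈ 𝒥_{bν}((x,y);(1,b))` is the layer of weight `bν` of any unit expansion of `f`
(`LocalGameEFTNewton.exists_unitExpansion`): exponents `(bk, ν-k)`, `k ≤ ν`.  The BINOMIAL FACE FORMS are the sums
`Σ_{k ≤ ν} q_k x^{bk} y^{ν-k}` — e.g. `c·(y - λ x^b)^ν` (`q_k = c·C(ν,k)·(-λ)^k`, `mul_sub_pow_eq_sum`) and, for `b = 1`,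
`c·(s x + t y)^ν` (`q_k = c·C(ν,k)·s^k t^{ν-k}`, `mul_linear_pow_eq_sum`).

* `residue_faceCoeff_sub_mem` — if `f ≡ Σ_k q_k x^{bk} y^{ν-k}` modulo `𝒥_{bν+1}`, then the face coefficients of ANY unit
  expansion of `f` agree with the `q_k` MODULO `𝔪` (weighted quasi-regularity:
  `LocalGameEFTNewton.coeff_layer_sub_mem_maximalIdeal`);
* `sub_sum_mem_of_faceCoeff_sub_mem` — conversely, coefficients `q_k` agreeing modulo `𝔪` with the face coefficients give
  `f ≡ Σ_k q_k x^{bk} y^{ν-k}` modulo `𝒥_{bν+1}` (`eval_mem_weightedMonomialIdeal_succ_of_coeff_mem`: a weight-`bν` form with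
  coefficients in `𝔪` evaluates into `𝒥_{bν+1}`).

Read in `𝒪_{Y′,η′}` and lifted in `𝒪_{Y,η}` (file `…AQSBaseChangeDescent`), this is how a steepening / a tangent `ν`-fold line
found over `κ(η′)` descends to `κ(η)` through `…AQSBaseChangeBinomial`.  Def-free; no named facts; nothing here is a claim about
Hironaka's problem.  AI-written; weaker than expert review.
-/

section Part3


namespace Literature.AlgebraicGeometry.Resolution.WeightedInvariant.AQSBaseChange

open _root_.IsLocalRing _root_.Literature.AlgebraicGeometry.Resolution
open _root_.Literature.AlgebraicGeometry.Resolution.WeightedInvariant.LocalGameEFTNewton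
  (eval_monomial_equivFunOnFinite_symm weight_equivFunOnFinite_symm prod_two span_range_vecCons_eq
    coeff_layer_sub_mem_maximalIdeal le_weight_of_mem_weightedMonomialIdeal)

universe u

variable {T : Type u} [CommRing T]

/-! ## Binomial face forms -/

/-- The exponent `(bk, ν - k)` has `(1,b)`-weight `bν` for `k ≤ ν`. [folklore] -/
private theorem weight_faceExp (b ν : ℕ) {k : ℕ} (hk : k ≤ ν) :
    ∑ i, (![1, b] : Fin 2 → ℕ) i * (![b * k, ν - k] : Fin 2 → ℕ) i = b * ν := by
  rw [LocalGameEFTNewton.weight_two]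
  simp only [Matrix.cons_val_zero, Matrix.cons_val_one]
  rw [Nat.mul_sub, ← Nat.add_sub_assoc (Nat.mul_le_mul_left b hk), Nat.add_sub_cancel_left]

/-- Face exponents are determined by `k`. [folklore] -/
private theorem faceExp_injective (b ν : ℕ) {k k' : ℕ} (hk : k ≤ ν) (hk' : k' ≤ ν)
    (h : (![b * k, ν - k] : Fin 2 → ℕ) = ![b * k', ν - k']) : k = k' := by
  have h1 : ν - k = ν - k' := congrFun h 1
  omega

/-- An exponent of `(1,b)`-weight `bν` (`b ≥ 1`) is a face exponent `(bk, ν - k)`, `k ≤ ν`. [folklore] -/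
private theorem exists_eq_faceExp {b : ℕ} (hb : 0 < b) {ν : ℕ} {α : Fin 2 → ℕ}
    (hα : ∑ i, (![1, b] : Fin 2 → ℕ) i * α i = b * ν) : ∃ k ≤ ν, α = ![b * k, ν - k] := by
  rw [LocalGameEFTNewton.weight_two] at hα
  have h1 : α 1 ≤ ν := by nlinarith
  have h0 : α 0 = b * (ν - α 1) := by rw [Nat.mul_sub]; omega
  have h1' : α 1 = ν - (ν - α 1) := by omega
  refine ⟨ν - α 1, Nat.sub_le _ _, ?_⟩
  funext i
  fin_cases i
  · simpa using h0
  · simpa using h1'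

/-- Evaluating the binomial face form. [folklore] -/
private theorem eval_faceForm (x y : T) (b ν : ℕ) (q : ℕ → T) :
    MvPolynomial.eval ![x, y]
        (∑ k ∈ Finset.range (ν + 1),
          MvPolynomial.monomial (Finsupp.equivFunOnFinite.symm ![b * k, ν - k]) (q k)) =
      ∑ k ∈ Finset.range (ν + 1), q k * (x ^ (b * k) * y ^ (ν - k)) := by
  rw [map_sum]
  refine Finset.sum_congr rfl fun k _ => ?_
  rw [eval_monomial_equivFunOnFinite_symm, prod_two]
  simp

/-- The binomial face form is a `(1,b)`-form of weight `bν`. [folklore] -/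
private theorem isWeightedHomogeneous_faceForm (b ν : ℕ) (q : ℕ → T) :
    MvPolynomial.IsWeightedHomogeneous (![1, b] : Fin 2 → ℕ)
      (∑ k ∈ Finset.range (ν + 1),
        MvPolynomial.monomial (Finsupp.equivFunOnFinite.symm ![b * k, ν - k]) (q k)) (b * ν) := by
  rw [← MvPolynomial.mem_weightedHomogeneousSubmodule]
  refine Submodule.sum_mem _ fun k hk => ?_
  rw [MvPolynomial.mem_weightedHomogeneousSubmodule]
  exact MvPolynomial.isWeightedHomogeneous_monomial _ _ _
    (by rw [weight_equivFunOnFinite_symm]; exact weight_faceExp b ν (Nat.lt_succ_iff.mp (Finset.mem_range.mp hk)))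

/-- The coefficient of the binomial face form at the face exponent `(bk, ν - k)`. [folklore] -/
private theorem coeff_faceForm (b ν : ℕ) (q : ℕ → T) {k : ℕ} (hk : k ≤ ν) :
    MvPolynomial.coeff (Finsupp.equivFunOnFinite.symm ![b * k, ν - k])
        (∑ j ∈ Finset.range (ν + 1),
          MvPolynomial.monomial (Finsupp.equivFunOnFinite.symm ![b * j, ν - j]) (q j)) = q k := by
  classical
  rw [MvPolynomial.coeff_sum]
  rw [Finset.sum_eq_single k]
  · rw [MvPolynomial.coeff_monomial, if_pos rfl]
  · intro j hj hjk
    rw [MvPolynomial.coeff_monomial, if_neg]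
    intro h
    exact hjk (faceExp_injective b ν (Nat.lt_succ_iff.mp (Finset.mem_range.mp hj)) hk
      (Finsupp.equivFunOnFinite.symm.injective h))
  · intro h
    exact absurd (Finset.mem_range.mpr (Nat.lt_succ_of_le hk)) h

/-- Off the face exponents the binomial face form has no coefficients. [folklore] -/
private theorem coeff_faceForm_eq_zero (b ν : ℕ) (q : ℕ → T) {β : Fin 2 → ℕ} (hβ : ∀ k ≤ ν, β ≠ ![b * k, ν - k]) :
    MvPolynomial.coeff (Finsupp.equivFunOnFinite.symm β)
        (∑ j ∈ Finset.range (ν + 1),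
          MvPolynomial.monomial (Finsupp.equivFunOnFinite.symm ![b * j, ν - j]) (q j)) = 0 := by
  classical
  rw [MvPolynomial.coeff_sum]
  refine Finset.sum_eq_zero fun j hj => ?_
  rw [MvPolynomial.coeff_monomial, if_neg]
  intro h
  exact hβ j (Nat.lt_succ_iff.mp (Finset.mem_range.mp hj)) (Finsupp.equivFunOnFinite.symm.injective h).symm

/-- `c·(y - λ x^b)^ν` as a binomial face form. [folklore] -/
private theorem mul_sub_pow_eq_sum (x y c lam : T) (b ν : ℕ) :
    c * (y - lam * x ^ b) ^ ν =
      ∑ k ∈ Finset.range (ν + 1), (c * (ν.choose k : T) * (-lam) ^ k) * (x ^ (b * k) * y ^ (ν - k)) := by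
  rw [sub_eq_neg_add, ← neg_mul, add_pow, Finset.mul_sum]
  refine Finset.sum_congr rfl fun k _ => ?_
  rw [mul_pow, ← pow_mul, mul_comm b k]
  ring

/-- `c·(s x + t y)^ν` as a binomial face form (`b = 1`). [folklore] -/
private theorem mul_linear_pow_eq_sum (x y c s t : T) (ν : ℕ) :
    c * (s * x + t * y) ^ ν =
      ∑ k ∈ Finset.range (ν + 1), (c * (ν.choose k : T) * s ^ k * t ^ (ν - k)) * (x ^ (1 * k) * y ^ (ν - k)) := by
  rw [add_pow, Finset.mul_sum]
  refine Finset.sum_congr rfl fun k _ => ?_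
  rw [mul_pow, mul_pow, one_mul]
  ring

/-! ## A form with coefficients in `𝔪` evaluates one step deeper -/

/-- **A `(1,b)`-form of weight `m` with all coefficients in `𝔪 = (x, y)` evaluates into `𝒥_{m+1}((x,y);(1,b))`**
(`b ≥ 1`: `𝔪 ⊆ 𝒥₁` and `𝒥₁ · 𝒥ₘ ⊆ 𝒥ₘ₊₁`). [folklore] -/
private theorem eval_mem_weightedMonomialIdeal_succ_of_coeff_mem [IsLocalRing T] {x y : T}
    (hxy : Ideal.span {x, y} = maximalIdeal T) {b : ℕ} (hb : 0 < b) {m : ℕ} (R : MvPolynomial (Fin 2) T)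
    (hR : R.IsWeightedHomogeneous (![1, b] : Fin 2 → ℕ) m) (hcoeff : ∀ β, R.coeff β ∈ maximalIdeal T) :
    MvPolynomial.eval ![x, y] R ∈ weightedMonomialIdeal ![x, y] ![1, b] (m + 1) := by
  classical
  have hw : ∀ i, 0 < (![1, b] : Fin 2 → ℕ) i := by
    intro i; fin_cases i <;> simp [hb]
  have h𝔪 : maximalIdeal T ≤ weightedMonomialIdeal ![x, y] ![1, b] 1 := by
    have := pow_le_weightedMonomialIdeal_of_span_eq ![x, y] ![1, b] hw (span_range_vecCons_eq hxy) 1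
    rwa [pow_one] at this
  rw [MvPolynomial.as_sum R, map_sum]
  refine Ideal.sum_mem _ fun β hβ => ?_
  rw [MvPolynomial.eval_monomial]
  have hwβ : Finsupp.weight (![1, b] : Fin 2 → ℕ) β = m := hR (MvPolynomial.mem_support_iff.mp hβ)
  have hmono : (β.prod fun n e => (![x, y] : Fin 2 → T) n ^ e) ∈ weightedMonomialIdeal ![x, y] ![1, b] m := by
    have hβ' : β = Finsupp.equivFunOnFinite.symm (fun i => β i) := by
      ext i; simp
    have := prod_pow_mem_weightedMonomialIdeal ![x, y] ![1, b] (n := m) (fun i => β i) (by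
      rw [← weight_equivFunOnFinite_symm, ← hβ', hwβ])
    rw [Finsupp.prod_fintype _ _ (fun i => by simp)]
    exact this
  rw [add_comm]
  exact weightedMonomialIdeal_mul_le ![x, y] ![1, b] 1 m (Ideal.mul_mem_mul (h𝔪 (hcoeff β)) hmono)

/-! ## Reading the face of `f` modulo `𝔪`, and lifting it -/

section Face

variable [IsRegularLocalRing T] (hdim : ringKrullDim T = (2 : ℕ)) {x y : T}
  (hxy : Ideal.span {x, y} = maximalIdeal T)

include hdim hxy

/-- **The face coefficients modulo `𝔪` are determined by `f` modulo `𝒥_{bν+1}`.**  Let `f = Σ_{α ∈ Δ} a_α x^{α₀} y^{α₁} + r`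
be a unit expansion (`a_α` units, `r ∈ 𝔪^N`, `bν < N`) of `f ∈ 𝒥_{bν}((x,y);(1,b))`, and suppose
`f ≡ Σ_{k ≤ ν} q_k x^{bk} y^{ν-k}` modulo `𝒥_{bν+1}`.  Then for every `k ≤ ν` the face coefficient (`a_{(bk,ν-k)}`, or `0`
if `(bk, ν-k) ∉ Δ`) is congruent to `q_k` modulo `𝔪`. [cite: Matsumura1987, Thm. 16.2] -/
theorem residue_faceCoeff_sub_mem {f : T} {Δ : Finset (Fin 2 → ℕ)} {a : (Fin 2 → ℕ) → T} {N : ℕ}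
    (hunit : ∀ α ∈ Δ, IsUnit (a α)) (hr : f - ∑ α ∈ Δ, a α * ∏ i, (![x, y] : Fin 2 → T) i ^ α i ∈ maximalIdeal T ^ N)
    {b : ℕ} (hb : 0 < b) {ν : ℕ} (hN : b * ν < N) (hf : f ∈ weightedMonomialIdeal ![x, y] ![1, b] (b * ν))
    (q : ℕ → T)
    (hq : f - ∑ k ∈ Finset.range (ν + 1), q k * (x ^ (b * k) * y ^ (ν - k)) ∈
      weightedMonomialIdeal ![x, y] ![1, b] (b * ν + 1))
    {k : ℕ} (hk : k ≤ ν) :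
    (if (![b * k, ν - k] : Fin 2 → ℕ) ∈ Δ then a ![b * k, ν - k] else 0) - q k ∈ maximalIdeal T := by
  classical
  have hw : ∀ i, 0 < (![1, b] : Fin 2 → ℕ) i := by
    intro i; fin_cases i <;> simp [hb]
  have hu := span_range_vecCons_eq hxy
  have hge : ∀ α ∈ Δ, b * ν ≤ ∑ i, (![1, b] : Fin 2 → ℕ) i * α i :=
    le_weight_of_mem_weightedMonomialIdeal ![x, y] hu hdim ![1, b] hw hunit hr hf hN.le
  have hQ := isWeightedHomogeneous_faceForm (T := T) b ν q
  have hfQ : f - MvPolynomial.eval ![x, y] (∑ k ∈ Finset.range (ν + 1),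
      MvPolynomial.monomial (Finsupp.equivFunOnFinite.symm ![b * k, ν - k]) (q k)) ∈
        weightedMonomialIdeal ![x, y] ![1, b] (b * ν + 1) := by
    rw [eval_faceForm]; exact hq
  have key := coeff_layer_sub_mem_maximalIdeal ![x, y] hu hdim ![1, b] hw hr hge hN _ hQ hfQ
    (Finsupp.equivFunOnFinite.symm ![b * k, ν - k])
  rw [MvPolynomial.coeff_sub, coeff_faceForm b ν q hk, MvPolynomial.coeff_sum] at key
  have hP : ∑ α ∈ Δ.filter (fun α => ∑ i, (![1, b] : Fin 2 → ℕ) i * α i = b * ν),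
      MvPolynomial.coeff (Finsupp.equivFunOnFinite.symm ![b * k, ν - k])
        (MvPolynomial.monomial (Finsupp.equivFunOnFinite.symm α) (a α)) =
      if (![b * k, ν - k] : Fin 2 → ℕ) ∈ Δ then a ![b * k, ν - k] else 0 := by
    simp_rw [MvPolynomial.coeff_monomial, (Finsupp.equivFunOnFinite.symm.injective).eq_iff]
    rw [Finset.sum_ite_eq' (Δ.filter _) (![b * k, ν - k] : Fin 2 → ℕ) a]
    simp only [Finset.mem_filter, weight_faceExp b ν hk, and_true]
  rwa [hP] at key

/-- **Lifting congruent coefficients.**  Conversely, if `f = Σ_{α ∈ Δ} a_α x^{α₀} y^{α₁} + r` is a unit expansion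
(`r ∈ 𝔪^N`, `bν + 1 ≤ N`) of `f ∈ 𝒥_{bν}((x,y);(1,b))` and `q_k` agrees modulo `𝔪` with the face coefficient at `(bk, ν-k)`
for every `k ≤ ν`, then `f ≡ Σ_{k ≤ ν} q_k x^{bk} y^{ν-k}` modulo `𝒥_{bν+1}`. [cite: Matsumura1987, Thm. 16.2] -/
theorem sub_sum_mem_of_faceCoeff_sub_mem {f : T} {Δ : Finset (Fin 2 → ℕ)} {a : (Fin 2 → ℕ) → T} {N : ℕ}
    (hunit : ∀ α ∈ Δ, IsUnit (a α)) (hr : f - ∑ α ∈ Δ, a α * ∏ i, (![x, y] : Fin 2 → T) i ^ α i ∈ maximalIdeal T ^ N)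
    {b : ℕ} (hb : 0 < b) {ν : ℕ} (hN : b * ν + 1 ≤ N) (hf : f ∈ weightedMonomialIdeal ![x, y] ![1, b] (b * ν))
    (q : ℕ → T)
    (hq : ∀ k ≤ ν, (if (![b * k, ν - k] : Fin 2 → ℕ) ∈ Δ then a ![b * k, ν - k] else 0) - q k ∈ maximalIdeal T) :
    f - ∑ k ∈ Finset.range (ν + 1), q k * (x ^ (b * k) * y ^ (ν - k)) ∈
      weightedMonomialIdeal ![x, y] ![1, b] (b * ν + 1) := by
  classical
  have hw : ∀ i, 0 < (![1, b] : Fin 2 → ℕ) i := by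
    intro i; fin_cases i <;> simp [hb]
  have hu := span_range_vecCons_eq hxy
  have hge : ∀ α ∈ Δ, b * ν ≤ ∑ i, (![1, b] : Fin 2 → ℕ) i * α i :=
    le_weight_of_mem_weightedMonomialIdeal ![x, y] hu hdim ![1, b] hw hunit hr hf (by omega)
  -- split the expansion into the face layer and the higher terms
  set P : MvPolynomial (Fin 2) T := ∑ α ∈ Δ.filter (fun α => ∑ i, (![1, b] : Fin 2 → ℕ) i * α i = b * ν),
    MvPolynomial.monomial (Finsupp.equivFunOnFinite.symm α) (a α) with hPdef
  set Q : MvPolynomial (Fin 2) T := ∑ k ∈ Finset.range (ν + 1),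
    MvPolynomial.monomial (Finsupp.equivFunOnFinite.symm ![b * k, ν - k]) (q k) with hQdef
  have hP : P.IsWeightedHomogeneous (![1, b] : Fin 2 → ℕ) (b * ν) := by
    rw [← MvPolynomial.mem_weightedHomogeneousSubmodule]
    refine Submodule.sum_mem _ fun α hα => ?_
    rw [MvPolynomial.mem_weightedHomogeneousSubmodule]
    exact MvPolynomial.isWeightedHomogeneous_monomial _ _ (a α)
      (by rw [weight_equivFunOnFinite_symm, (Finset.mem_filter.mp hα).2])
  have hevalP : MvPolynomial.eval ![x, y] P =
      ∑ α ∈ Δ.filter (fun α => ∑ i, (![1, b] : Fin 2 → ℕ) i * α i = b * ν),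
        a α * ∏ i, (![x, y] : Fin 2 → T) i ^ α i := by
    simp only [hPdef, map_sum, eval_monomial_equivFunOnFinite_symm]
  have hevalQ : MvPolynomial.eval ![x, y] Q = ∑ k ∈ Finset.range (ν + 1), q k * (x ^ (b * k) * y ^ (ν - k)) := by
    rw [hQdef, eval_faceForm]
  have hhigh : ∑ α ∈ Δ.filter (fun α => ¬ ∑ i, (![1, b] : Fin 2 → ℕ) i * α i = b * ν),
      a α * ∏ i, (![x, y] : Fin 2 → T) i ^ α i ∈ weightedMonomialIdeal ![x, y] ![1, b] (b * ν + 1) := by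
    refine Ideal.sum_mem _ fun α hα => Ideal.mul_mem_left _ _ ?_
    obtain ⟨hαΔ, hne⟩ := Finset.mem_filter.mp hα
    exact prod_pow_mem_weightedMonomialIdeal ![x, y] ![1, b] α
      (Nat.succ_le_of_lt (lt_of_le_of_ne (hge α hαΔ) (Ne.symm hne)))
  have hrem : f - ∑ α ∈ Δ, a α * ∏ i, (![x, y] : Fin 2 → T) i ^ α i ∈
      weightedMonomialIdeal ![x, y] ![1, b] (b * ν + 1) :=
    ((Ideal.pow_le_pow_right hN).trans (pow_le_weightedMonomialIdeal_of_span_eq ![x, y] ![1, b] hw hu _)) hr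
  -- all coefficients of `P - Q` lie in `𝔪`
  have hcoeff : ∀ β, (P - Q).coeff β ∈ maximalIdeal T := by
    intro β
    obtain ⟨β', rfl⟩ : ∃ β' : Fin 2 → ℕ, β = Finsupp.equivFunOnFinite.symm β' :=
      ⟨β, (Finsupp.equivFunOnFinite.symm_apply_apply β).symm⟩
    rw [MvPolynomial.coeff_sub]
    have hPβ : P.coeff (Finsupp.equivFunOnFinite.symm β') =
        if β' ∈ Δ.filter (fun α => ∑ i, (![1, b] : Fin 2 → ℕ) i * α i = b * ν) then a β' else 0 := by
      rw [hPdef, MvPolynomial.coeff_sum]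
      simp_rw [MvPolynomial.coeff_monomial, (Finsupp.equivFunOnFinite.symm.injective).eq_iff]
      exact Finset.sum_ite_eq' _ β' a
    by_cases hface : ∃ k ≤ ν, β' = ![b * k, ν - k]
    · obtain ⟨k, hk, rfl⟩ := hface
      rw [hPβ, hQdef, coeff_faceForm b ν q hk]
      simp only [Finset.mem_filter, weight_faceExp b ν hk, and_true]
      exact hq k hk
    · push Not at hface
      rw [hPβ, hQdef, coeff_faceForm_eq_zero b ν q hface, sub_zero]
      rw [if_neg]
      · exact Ideal.zero_mem _
      · intro hmem
        obtain ⟨k, hk, hk'⟩ := exists_eq_faceExp hb (Finset.mem_filter.mp hmem).2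
        exact hface k hk hk'
  have hPQ : (P - Q).IsWeightedHomogeneous (![1, b] : Fin 2 → ℕ) (b * ν) := by
    have hQ := isWeightedHomogeneous_faceForm (T := T) b ν q
    rw [← MvPolynomial.mem_weightedHomogeneousSubmodule] at hP hQ ⊢
    exact Submodule.sub_mem _ hP hQ
  have hevalPQ := eval_mem_weightedMonomialIdeal_succ_of_coeff_mem hxy hb (P - Q) hPQ hcoeff
  rw [map_sub, hevalP, hevalQ] at hevalPQ
  -- assemble
  have hsplit : ∑ α ∈ Δ, a α * ∏ i, (![x, y] : Fin 2 → T) i ^ α i =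
      ∑ α ∈ Δ.filter (fun α => ∑ i, (![1, b] : Fin 2 → ℕ) i * α i = b * ν),
          a α * ∏ i, (![x, y] : Fin 2 → T) i ^ α i +
        ∑ α ∈ Δ.filter (fun α => ¬ ∑ i, (![1, b] : Fin 2 → ℕ) i * α i = b * ν),
          a α * ∏ i, (![x, y] : Fin 2 → T) i ^ α i :=
    (Finset.sum_filter_add_sum_filter_not Δ _ _).symm
  have hkey : f - ∑ k ∈ Finset.range (ν + 1), q k * (x ^ (b * k) * y ^ (ν - k)) =
      (f - ∑ α ∈ Δ, a α * ∏ i, (![x, y] : Fin 2 → T) i ^ α i) +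
        ∑ α ∈ Δ.filter (fun α => ¬ ∑ i, (![1, b] : Fin 2 → ℕ) i * α i = b * ν),
          a α * ∏ i, (![x, y] : Fin 2 → T) i ^ α i +
        (∑ α ∈ Δ.filter (fun α => ∑ i, (![1, b] : Fin 2 → ℕ) i * α i = b * ν),
          a α * ∏ i, (![x, y] : Fin 2 → T) i ^ α i -
          ∑ k ∈ Finset.range (ν + 1), q k * (x ^ (b * k) * y ^ (ν - k))) := by
    rw [hsplit]; ring
  rw [hkey]
  exact Ideal.add_mem _ (Ideal.add_mem _ hrem hhigh) hevalPQ

end Face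

end Literature.AlgebraicGeometry.Resolution.WeightedInvariant.AQSBaseChange

end Part3

/-!
## Part 4 — port of `Summits/ResolutionOfSingularities/ResolutionOfSingularities/Theorems/WeightedInvariantAQSBaseChangeBinomial.lean`

# `ν`-th powers of linear forms descend along relatively `p`-radically closed field extensions

Route `ResolutionOfSingularities/WeightedInvariant`, door crux `HypersurfaceCentreConstruction`
(stmt-ResolutionOfSingularities-19897) — OURS, helper; e-ladder `e = 1`, piece **(o25-δ)** «separable base change of
the Abramovich–Quek–Schober centre in the kernel» (res-D-pv-025 AS stub-10; CHAIN w43 v4.18 (3)), brick **(δ0)**: the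
elementary algebra by which a tangent ν-fold line (case (B) of the lex-max certificate) or a preparing steepening
`y ↦ y - λ x^b` (case (D)) found over the BIGGER residue field `κ′ = κ(η′)` is already defined over `κ = κ(η)`, as soon
as `κ` is relatively `p`-radically closed in `κ′` (`y ∈ κ′`, `y^p ∈ κ ⇒ y ∈ κ`; for `κ′/κ` formally smooth this is
`AQSBaseChange.mem_range_algebraMap_of_pow_mem`, file `…AQSBaseChangeResidueField`).  Pure field arithmetic, no
geometry:

* `natCast_choose_pow_ne_zero` — for `1 ≤ ν` there is a prime power `p^m ≤ ν` (`ν = p^m · s`, `p ∤ s`) with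
  `(ν.choose (p^m) : K) ≠ 0` in exponential characteristic `p` (Lucas: `choose (p^m s) (p^m) ≡ s (mod p)`);
* `mem_range_of_forall_choose_mul_pow_mem` — if `c ≠ 0` and every `c · C(ν,k) · μ^k` (`k ≤ ν`) lies in `κ`, then `μ`
  and `c` lie in `κ` (the coefficient `k = p^m` gives `μ^{p^m} ∈ κ`);
* `exists_descent_of_forall_choose_mul_pow_mul_pow_mem` — if every coefficient `c · C(ν,k) · α^k β^{ν-k}` of the
  binary form `c (αX + βY)^ν` over `κ′` lies in `κ` (and `c ≠ 0`, `(α, β) ≠ 0`), the same coefficients are those of a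
  form `c₀ (α₀X + β₀Y)^ν` with `c₀, α₀, β₀ ∈ κ`, `c₀ ≠ 0`.

Def-free; no named facts; nothing here is a claim about Hironaka's problem. AI-written; weaker than expert review.
-/

section Part4


namespace Literature.AlgebraicGeometry.Resolution.WeightedInvariant.AQSBaseChange

universe u v

variable {κ : Type u} {K : Type v} [Field κ] [Field K] [Algebra κ K]

/-! ## A binomial coefficient that survives in characteristic `p` -/

/-- For `1 ≤ ν` there is a prime power `p ^ m ≤ ν` of the exponential characteristic with `C(ν, p^m) ≠ 0` in `K`
(write `ν = p^m · s` with `p ∤ s`; Lucas' congruence `C(p^m s, p^m) ≡ s (mod p)`; for `p = 1` take `m = 0`).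
[folklore] -/
private theorem natCast_choose_pow_ne_zero (p : ℕ) [ExpChar K p] {ν : ℕ} (hν : 1 ≤ ν) :
    ∃ m : ℕ, p ^ m ≤ ν ∧ ((ν.choose (p ^ m) : ℕ) : K) ≠ 0 := by
  rcases ‹ExpChar K p› with _ | ⟨hprime⟩
  · haveI := charZero_of_expChar_one' (R := K)
    refine ⟨0, by simpa using hν, ?_⟩
    rw [pow_zero, Nat.choose_one_right, Nat.cast_ne_zero]
    omega
  · haveI : Fact p.Prime := ⟨hprime⟩
    obtain ⟨m, s, hs, hνs⟩ := Nat.exists_eq_pow_mul_and_not_dvd (by omega : ν ≠ 0) p hprime.one_lt.ne'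
    have hs0 : s ≠ 0 := by rintro rfl; exact hs (dvd_zero p)
    refine ⟨m, ?_, ?_⟩
    · rw [hνs]
      exact Nat.le_mul_of_pos_right _ (Nat.pos_of_ne_zero hs0)
    · intro h0
      rw [CharP.cast_eq_zero_iff K p] at h0
      have hmod : (p ^ m * s).choose (p ^ m * 1) ≡ s.choose 1 [MOD p] :=
        Choose.choose_pow_mul_pow_mul_modEq_choose_nat
      rw [mul_one, Nat.choose_one_right, ← hνs] at hmod
      exact hs ((hmod.dvd_iff dvd_rfl).mp h0)

/-! ## Descent of `c · (μ X + Y)^ν` and of `c · (α X + β Y)^ν` -/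

/-- Iterating relative `p`-radical closedness: `y ^ (p ^ n) ∈ κ ⇒ y ∈ κ`. [folklore] -/
private theorem mem_range_of_pow_pow_mem (p : ℕ)
    (hcl : ∀ y : K, y ^ p ∈ (algebraMap κ K).range → y ∈ (algebraMap κ K).range) (n : ℕ) {y : K}
    (hy : y ^ (p ^ n) ∈ (algebraMap κ K).range) : y ∈ (algebraMap κ K).range := by
  induction n generalizing y with
  | zero => simpa using hy
  | succ n ih =>
    apply ih
    apply hcl
    rwa [← pow_mul, ← pow_succ]

/-- **Descent of a `ν`-fold linear factor.**  Let `κ ⊆ K` be relatively `p`-radically closed (`p` the exponential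
characteristic), `1 ≤ ν`, `c ≠ 0` and `μ` in `K`.  If all the coefficients `c · C(ν,k) · μ^k` (`k ≤ ν`) of
`c · (μ X + Y)^ν` lie in `κ`, then `μ ∈ κ` and `c ∈ κ`: the coefficient `k = 0` is `c`, and the coefficient
`k = p^m` (`C(ν, p^m) ≠ 0`) gives `μ^{p^m} ∈ κ`. [folklore] -/
private theorem mem_range_of_forall_choose_mul_pow_mem (p : ℕ) [ExpChar K p]
    (hcl : ∀ y : K, y ^ p ∈ (algebraMap κ K).range → y ∈ (algebraMap κ K).range)
    {ν : ℕ} (hν : 1 ≤ ν) {c μ : K} (hc : c ≠ 0)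
    (h : ∀ k ≤ ν, c * (ν.choose k : K) * μ ^ k ∈ (algebraMap κ K).range) :
    μ ∈ (algebraMap κ K).range ∧ c ∈ (algebraMap κ K).range := by
  have hc' : c ∈ (algebraMap κ K).range := by simpa using h 0 (Nat.zero_le ν)
  refine ⟨?_, hc'⟩
  obtain ⟨m, hmν, hC⟩ := natCast_choose_pow_ne_zero (K := K) p hν
  obtain ⟨a, ha⟩ := h (p ^ m) hmν
  obtain ⟨c₀, hc₀⟩ := hc'
  -- `μ ^ (p ^ m) = a / (c₀ · C(ν, p^m))` lies in `κ`
  have hμ : μ ^ (p ^ m) ∈ (algebraMap κ K).range := by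
    refine ⟨a / (c₀ * (ν.choose (p ^ m) : κ)), ?_⟩
    rw [map_div₀, map_mul, map_natCast, hc₀, ha]
    field_simp
  exact mem_range_of_pow_pow_mem p hcl m hμ

/-- **Descent of a `ν`-th power of a linear form.**  With `κ ⊆ K` relatively `p`-radically closed, `1 ≤ ν`,
`c ≠ 0` and `(α, β) ≠ (0, 0)` in `K`: if every coefficient `c · C(ν,k) · α^k · β^{ν-k}` (`k ≤ ν`) of the binary
form `c · (α X + β Y)^ν` lies in `κ`, then these coefficients are those of a form `c₀ · (α₀ X + β₀ Y)^ν` with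
`c₀ ≠ 0`, `α₀`, `β₀` in `κ` (normalise by `β` — or by `α` if `β = 0` — and apply
`mem_range_of_forall_choose_mul_pow_mem`). [folklore] -/
private theorem exists_descent_of_forall_choose_mul_pow_mul_pow_mem (p : ℕ) [ExpChar K p]
    (hcl : ∀ y : K, y ^ p ∈ (algebraMap κ K).range → y ∈ (algebraMap κ K).range)
    {ν : ℕ} (hν : 1 ≤ ν) {c α β : K} (hc : c ≠ 0) (hαβ : α ≠ 0 ∨ β ≠ 0)
    (h : ∀ k ≤ ν, c * (ν.choose k : K) * α ^ k * β ^ (ν - k) ∈ (algebraMap κ K).range) :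
    ∃ c₀ α₀ β₀ : κ, c₀ ≠ 0 ∧ ∀ k ≤ ν,
      algebraMap κ K (c₀ * (ν.choose k : κ) * α₀ ^ k * β₀ ^ (ν - k)) =
        c * (ν.choose k : K) * α ^ k * β ^ (ν - k) := by
  by_cases hβ : β = 0
  · -- only the coefficient of `X^ν` survives
    subst hβ
    have hα : α ≠ 0 := hαβ.resolve_right (fun h => h rfl)
    obtain ⟨c₀, hc₀⟩ : c * α ^ ν ∈ (algebraMap κ K).range := by
      simpa using h ν le_rfl
    refine ⟨c₀, 1, 0, ?_, fun k hk => ?_⟩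
    · rintro rfl
      rw [map_zero] at hc₀
      exact (mul_ne_zero hc (pow_ne_zero ν hα)) hc₀.symm
    · rcases hk.lt_or_eq with hlt | rfl
      · rw [zero_pow (Nat.sub_ne_zero_of_lt hlt), zero_pow (Nat.sub_ne_zero_of_lt hlt), mul_zero, mul_zero,
          map_zero]
      · simp [hc₀]
  · -- normalise by `β`: `c (αX + βY)^ν = (c β^ν) ((α/β) X + Y)^ν`
    have hcβ : c * β ^ ν ≠ 0 := mul_ne_zero hc (pow_ne_zero ν hβ)
    have h' : ∀ k ≤ ν, c * β ^ ν * (ν.choose k : K) * (α / β) ^ k ∈ (algebraMap κ K).range := by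
      intro k hk
      have hk' : c * β ^ ν * (ν.choose k : K) * (α / β) ^ k = c * (ν.choose k : K) * α ^ k * β ^ (ν - k) := by
        rw [div_pow]
        have hβk : β ^ k ≠ 0 := pow_ne_zero k hβ
        field_simp
        rw [show β ^ ν = β ^ k * β ^ (ν - k) from by rw [← pow_add, Nat.add_sub_cancel' hk]]
        ring
      rw [hk']
      exact h k hk
    obtain ⟨⟨μ₀, hμ₀⟩, ⟨c₁, hc₁⟩⟩ := mem_range_of_forall_choose_mul_pow_mem p hcl hν hcβ h'
    refine ⟨c₁, μ₀, 1, ?_, fun k hk => ?_⟩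
    · rintro rfl
      rw [map_zero] at hc₁
      exact hcβ hc₁.symm
    · rw [map_mul, map_mul, map_mul, map_pow, map_pow, map_one, one_pow, mul_one, map_natCast, hc₁, hμ₀,
        div_pow]
      have hβk : β ^ k ≠ 0 := pow_ne_zero k hβ
      field_simp
      rw [show β ^ ν = β ^ k * β ^ (ν - k) from by rw [← pow_add, Nat.add_sub_cancel' hk]]
      ring

end Literature.AlgebraicGeometry.Resolution.WeightedInvariant.AQSBaseChange

end Part4

/-!
## Part 5 — port of `Summits/ResolutionOfSingularities/ResolutionOfSingularities/Theorems/WeightedInvariantWeightedConstructionWeightedChartBasicOpen.lean`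

# A weighted chart restricted to an affine sub-open, in ring language

Route `ResolutionOfSingularities/WeightedInvariant`, crux `WeightedConstruction`
(stmt-ResolutionOfSingularities-0571), line `support-first-weights-second`, stub
`stub_weightedChart_basicOpen` (stub 1c of the lead skeleton).

Let `f : Y → Spec k` be smooth (`k` a field), `R` a Rees algebra on `Y`
(`ReesAlgebraData`, `WeightedResolutionDatum.lean`) and `(U, u, w)` a weighted chart of `R`
(`ReesAlgebraData.IsWeightedChart`: positive weights, the pieces `Rₙ(U)` are the weighted monomial
ideals `(u^α : Σ wᵢ αᵢ ≥ n)`, and at every point `y ∈ U` where all `uᵢ` vanish their classes in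
`𝔪_y / 𝔪_y²` are linearly independent). For an affine sub-open `V ≤ U` (in the skeleton `V = D(h)`,
a hypothesis that is not used) we transport the chart to `V` and rephrase it in the language of the
ring `Γ(Y, V)`, its primes `P` and localisations at `P` — the hypothesis shape of the tree theorem
`cobordantAlgebra.isRegularRing_of_linearIndependent_toCotangent`:

1. `Γ(Y, V)` is a regular ring: `Y` is locally Noetherian (smooth ⇒ locally of finite type over the
   Noetherian scheme `Spec k`, `LocallyOfFiniteType.isLocallyNoetherian`), so `Γ(Y, V)` is
   Noetherian; its localisation at a prime `P` is the stalk `𝒪_{Y,y}` at the point `y` of `V`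
   corresponding to `P` (`IsAffineOpen.isLocalization_stalk'`), which is a regular local ring
   because `Y` is smooth over a field (`isRegularLocalRing_stalk_of_smooth_of_field`, Stacks 056S).
2. the weights are positive (a field of the chart).
3. `Rₙ(V) = Rₙ(U) · Γ(Y, V)` (`Scheme.IdealSheafData.map_ideal'`) is the weighted monomial ideal of
   the restrictions `uᵢ|_V` (`weightedMonomialIdeal_map`: the image of a monomial is a monomial).
4. for a prime `P ⊇ (uᵢ|_V)`, the stalk `𝒪_{Y,y}` at the corresponding point `y ∈ V` is a
   localisation of `Γ(Y, V)` at `P`, is regular local, the `uᵢ|_V` map into its maximal ideal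
   (`IsLocalization.AtPrime.to_map_mem_maximal_iff`), and their images are the germs of the `uᵢ`
   (`TopCat.Presheaf.germ_res_apply`), whose cotangent classes are linearly independent by the chart
   hypothesis at `y`.
-/

section Part5


namespace Literature.AlgebraicGeometry.Resolution.WeightedInvariant

open _root_.CategoryTheory _root_.AlgebraicGeometry _root_.TopologicalSpace _root_.Literature.AlgebraicGeometry.Resolution
open scoped _root_.LaurentPolynomial

section Helpers

universe u

/-- The image of a weighted monomial ideal `(u^α : Σ wᵢ αᵢ ≥ n)` under a ring map `φ` is the
weighted monomial ideal of the images `φ (uᵢ)` (same weights, same degree). [folklore] -/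
private theorem weightedMonomialIdeal_map {A B : Type*} [CommRing A] [CommRing B] (φ : A →+* B) {m : ℕ}
    (u : Fin m → A) (w : Fin m → ℕ) (n : ℕ) :
    (weightedMonomialIdeal u w n).map φ = weightedMonomialIdeal (fun i => φ (u i)) w n := by
  rw [weightedMonomialIdeal, weightedMonomialIdeal, Ideal.map_span]
  congr 1
  ext x
  constructor
  · rintro ⟨y, ⟨α, hα, rfl⟩, rfl⟩
    exact ⟨α, hα, by simp [map_prod, map_pow]⟩
  · rintro ⟨α, hα, rfl⟩
    exact ⟨_, ⟨α, hα, rfl⟩, by simp [map_prod, map_pow]⟩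

/-- **The coordinate ring of an affine open of a scheme smooth over a field is a regular ring**:
it is Noetherian (`Y` is locally Noetherian, being locally of finite type over `Spec k`), and its
localisation at a prime is the stalk of `Y` at the corresponding point, a regular local ring by
Stacks 056S (`isRegularLocalRing_stalk_of_smooth_of_field`). [folklore] -/
private theorem isRegularRing_sections_of_smooth_of_field {k : Type u} [Field k] {Y : Scheme.{u}}
    (f : Y ⟶ Spec (.of k)) [Smooth f] (V : Y.affineOpens) : IsRegularRing Γ(Y, V) := by
  haveI : IsLocallyNoetherian Y := LocallyOfFiniteType.isLocallyNoetherian f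
  haveI : IsNoetherianRing Γ(Y, V) := IsLocallyNoetherian.component_noetherian V
  refine isRegularRing_iff.mpr fun p hp => ?_
  have hy : V.2.fromSpec ⟨p, hp⟩ ∈ (V : Y.Opens) := V.2.range_fromSpec.le ⟨_, rfl⟩
  letI : Algebra Γ(Y, V) (Y.presheaf.stalk (V.2.fromSpec ⟨p, hp⟩)) :=
    TopCat.Presheaf.algebra_section_stalk Y.presheaf ⟨V.2.fromSpec ⟨p, hp⟩, hy⟩
  have hloc : IsLocalization.AtPrime (Y.presheaf.stalk (V.2.fromSpec ⟨p, hp⟩)) p :=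
    V.2.isLocalization_stalk' ⟨p, hp⟩ hy
  haveI := isRegularLocalRing_stalk_of_smooth_of_field f (V.2.fromSpec ⟨p, hp⟩)
  exact IsRegularLocalRing.of_ringEquiv
    (IsLocalization.algEquiv p.primeCompl (Y.presheaf.stalk (V.2.fromSpec ⟨p, hp⟩))
      (Localization.AtPrime p)).toRingEquiv

end Helpers

/-- **Stub 1c (a weighted chart on an affine sub-open, in ring language).** Let `f : Y → Spec k`
be smooth, `R` a Rees algebra on `Y` with weighted chart `(U, u, w)`, and `V ≤ U` an affine
sub-open (a basic open `D(h)` in the skeleton; that hypothesis is not used). Then: `Γ(Y, V)` is a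
regular ring; the weights are positive; the pieces `Rₙ(V)` are the weighted monomial ideals of the
restrictions `uᵢ|_V`; and for every prime `P` of `Γ(Y, V)` containing the `uᵢ|_V` there is a
localisation `Rg` of `Γ(Y, V)` at `P` (namely the stalk `𝒪_{Y,y}` at the point `y ∈ V`
corresponding to `P`) which is a regular local ring, in whose maximal ideal the `uᵢ|_V` land with
linearly independent classes in the cotangent space `𝔪 / 𝔪²` (the chart hypothesis at `y`,
transported along `germ_V ∘ res = germ_U`). [folklore] -/
private theorem stub_weightedChart_basicOpen :
    ∀ ⦃k : Type⦄ [Field k] ⦃Y : Scheme.{0}⦄ (f : Y ⟶ Spec (.of k)) [Smooth f]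
      (R : ReesAlgebraData Y) (U : Y.affineOpens) {m : ℕ} (u : Fin m → Γ(Y, U)) (w : Fin m → ℕ),
      R.IsWeightedChart U u w →
      ∀ (h : Γ(Y, U)) (V : Y.affineOpens) (hVU : (V : Y.Opens) ≤ U),
        (V : Y.Opens) = Y.basicOpen h →
        IsRegularRing Γ(Y, V) ∧ (∀ i, 0 < w i) ∧
        (∀ n, R.chartIdeals V n =
          weightedMonomialIdeal (fun i => (Y.presheaf.map (homOfLE hVU).op).hom (u i)) w n) ∧
        (∀ (P : Ideal Γ(Y, V)) [P.IsPrime],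
          Ideal.span (Set.range fun i => (Y.presheaf.map (homOfLE hVU).op).hom (u i)) ≤ P →
          ∃ (Rg : Type) (_ : CommRing Rg) (_ : Algebra Γ(Y, V) Rg) (_ : IsLocalization.AtPrime Rg P)
            (_ : IsRegularLocalRing Rg)
            (hmem : ∀ i, algebraMap Γ(Y, V) Rg ((Y.presheaf.map (homOfLE hVU).op).hom (u i)) ∈
              IsLocalRing.maximalIdeal Rg),
            LinearIndependent (IsLocalRing.ResidueField Rg) fun i =>
              (IsLocalRing.maximalIdeal Rg).toCotangent
                ⟨algebraMap Γ(Y, V) Rg ((Y.presheaf.map (homOfLE hVU).op).hom (u i)), hmem i⟩) := by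
  intro k _ Y f _ R U m u w hchart _ V hVU _
  refine ⟨isRegularRing_sections_of_smooth_of_field f V, hchart.w_pos, fun n => ?_, ?_⟩
  · -- (3) the pieces over `V` are the restricted pieces over `U`
    rw [ReesAlgebraData.chartIdeals_apply, ← (R.piece n).map_ideal' (U := V) (V := U)
      (homOfLE hVU).op, hchart.ideal_eq n, weightedMonomialIdeal_map]
  · -- (4) localisation at a prime containing the restricted parameters
    intro P hPp hP
    -- the point of `V ⊆ Y` corresponding to the prime `P`
    have hyV : V.2.fromSpec ⟨P, hPp⟩ ∈ (V : Y.Opens) := V.2.range_fromSpec.le ⟨_, rfl⟩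
    letI : Algebra Γ(Y, V) (Y.presheaf.stalk (V.2.fromSpec ⟨P, hPp⟩)) :=
      TopCat.Presheaf.algebra_section_stalk Y.presheaf ⟨V.2.fromSpec ⟨P, hPp⟩, hyV⟩
    have hloc : IsLocalization.AtPrime (Y.presheaf.stalk (V.2.fromSpec ⟨P, hPp⟩)) P :=
      V.2.isLocalization_stalk' ⟨P, hPp⟩ hyV
    have hreg : IsRegularLocalRing (Y.presheaf.stalk (V.2.fromSpec ⟨P, hPp⟩)) :=
      isRegularLocalRing_stalk_of_smooth_of_field f _
    -- `germ_V (uᵢ|_V) = germ_U uᵢ`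
    have hgermres : ∀ i, algebraMap Γ(Y, V) (Y.presheaf.stalk (V.2.fromSpec ⟨P, hPp⟩))
        ((Y.presheaf.map (homOfLE hVU).op).hom (u i)) =
        (Y.presheaf.germ U (V.2.fromSpec ⟨P, hPp⟩) (hVU hyV)).hom (u i) := by
      intro i
      exact TopCat.Presheaf.germ_res_apply Y.presheaf (homOfLE hVU) _ hyV (u i)
    have hmemP : ∀ i, (Y.presheaf.map (homOfLE hVU).op).hom (u i) ∈ P := fun i =>
      hP (Ideal.subset_span ⟨i, rfl⟩)
    have hmem : ∀ i, algebraMap Γ(Y, V) (Y.presheaf.stalk (V.2.fromSpec ⟨P, hPp⟩))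
        ((Y.presheaf.map (homOfLE hVU).op).hom (u i)) ∈
        IsLocalRing.maximalIdeal (Y.presheaf.stalk (V.2.fromSpec ⟨P, hPp⟩)) := fun i =>
      (IsLocalization.AtPrime.to_map_mem_maximal_iff _ P _).mpr (hmemP i)
    have hgerm : ∀ i, (Y.presheaf.germ U (V.2.fromSpec ⟨P, hPp⟩) (hVU hyV)).hom (u i) ∈
        IsLocalRing.maximalIdeal (Y.presheaf.stalk (V.2.fromSpec ⟨P, hPp⟩)) := fun i =>
      hgermres i ▸ hmem i
    refine ⟨Y.presheaf.stalk (V.2.fromSpec ⟨P, hPp⟩), inferInstance, inferInstance, hloc, hreg,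
      hmem, ?_⟩
    have hli := hchart.linearIndependent (V.2.fromSpec ⟨P, hPp⟩) (hVU hyV) hgerm
    have hfun : (fun i => (IsLocalRing.maximalIdeal (Y.presheaf.stalk (V.2.fromSpec ⟨P, hPp⟩))).toCotangent
        ⟨algebraMap Γ(Y, V) (Y.presheaf.stalk (V.2.fromSpec ⟨P, hPp⟩))
          ((Y.presheaf.map (homOfLE hVU).op).hom (u i)), hmem i⟩) =
        (fun i => (IsLocalRing.maximalIdeal (Y.presheaf.stalk (V.2.fromSpec ⟨P, hPp⟩))).toCotangent
          ⟨(Y.presheaf.germ U (V.2.fromSpec ⟨P, hPp⟩) (hVU hyV)).hom (u i), hgerm i⟩) := by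
      funext i
      congr 1
      exact Subtype.ext (hgermres i)
    rw [hfun]
    exact hli

end Literature.AlgebraicGeometry.Resolution.WeightedInvariant

end Part5

/-!
## Part 6 — port of `Summits/ResolutionOfSingularities/ResolutionOfSingularities/Theorems/WeightedInvariantAQSBaseChangeDescent.lean`

# Descent of steepenings and of tangent `ν`-fold lines along an unramified extension of regular local rings

Route `ResolutionOfSingularities/WeightedInvariant`, door crux `HypersurfaceCentreConstruction`
(stmt-ResolutionOfSingularities-19897) — OURS, helper; e-ladder `e = 1`, piece **(o25-δ)** «separable base change of the
Abramovich–Quek–Schober centre in the kernel» (res-D-pv-025 AS stub-10; CHAIN w43 v4.18 (3)), brick **(δ1b)**.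

Setting: `φ : S → S′` a local homomorphism of two-dimensional regular local rings with `𝔪_S · S′ = 𝔪_{S′}` (so a regular
system of parameters `(x, y)` of `S` maps to one of `S′`), whose residue field extension `κ → κ′` is relatively
`p`-radically closed (`z ∈ κ′`, `z^p ∈ κ ⇒ z ∈ κ`; e.g. `κ′/κ` formally smooth, file `…AQSBaseChangeResidueField`).  No flatness
is used in this file.

* `exists_steepening_of_map` — **steepenings descend**: if over `S′` some `y ↦ y - λ′ x^b` (`λ′ ∈ S′`, `b ≥ 1`) prepares `f`
  at level `b`, i.e. `φ f ≡ c′·(φ y - λ′ φ x^b)^ν` modulo `𝒥_{bν+1}((φx, φy); (1,b))` with `c′` a unit, then some `λ ∈ S` does: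
  `f ≡ c·(y - λ x^b)^ν` modulo `𝒥_{bν+1}((x,y);(1,b))`, `c` a unit (face read over `κ′` by `residue_faceCoeff_sub_mem`, `λ̄′ ∈ κ`
  by `mem_range_of_forall_choose_mul_pow_mem`, lifted by `sub_sum_mem_of_faceCoeff_sub_mem`);
* `exists_tangent_line_of_map` — **tangent `ν`-fold lines descend**: if `φ f ≡ c′·y′^ν` modulo `𝔪′^{ν+1}` for a regular
  parameter `y′` of `S′` and a unit `c′`, then `f ≡ c·y₀^ν` modulo `𝔪^{ν+1}` for a regular parameter `y₀` of `S` and a unit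
  `c` (`exists_descent_of_forall_choose_mul_pow_mul_pow_mem`).

These are the two places where separability of the base change enters the stability of the lex-maximal centre
(Abramovich–Quek–Schober, Thm 3.5: «the characteristic polyhedron does not change under the base change `k′/k`»).
Def-free; no named facts; nothing here is a claim about Hironaka's problem.  AI-written; weaker than expert review.
-/

section Part6


namespace Literature.AlgebraicGeometry.Resolution.WeightedInvariant.AQSBaseChange

open _root_.IsLocalRing _root_.Literature.AlgebraicGeometry.Resolution
open _root_.Literature.AlgebraicGeometry.Resolution.WeightedInvariant.LocalGameEFTNewton
  (span_range_vecCons_eq exists_unitExpansion)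

universe u v

/-! ## Small tools -/

section Tools

variable {S : Type u} {S' : Type v} [CommRing S] [CommRing S']

/-- `φ ∘ (x, y) = (φ x, φ y)` as `Fin 2`-families. [folklore] -/
private theorem comp_vecCons_two (φ : S →+* S') (x y : S) : (fun i => φ ((![x, y] : Fin 2 → S) i)) = ![φ x, φ y] := by
  funext i
  fin_cases i <;> rfl

/-- Weighted monomial ideals of `(x, y)` extend to those of `(φ x, φ y)`. [folklore] -/
private theorem map_weightedMonomialIdeal_two (φ : S →+* S') (x y : S) (w : Fin 2 → ℕ) (n : ℕ) :
    (weightedMonomialIdeal ![x, y] w n).map φ = weightedMonomialIdeal ![φ x, φ y] w n := by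
  rw [weightedMonomialIdeal_map, comp_vecCons_two]

/-- A regular system of parameters maps to one when `𝔪_S · S′ = 𝔪_{S′}`. [folklore] -/
private theorem span_pair_map_eq [IsLocalRing S] [IsLocalRing S'] (φ : S →+* S')
    (h𝔪 : (maximalIdeal S).map φ = maximalIdeal S') {x y : S} (hxy : Ideal.span {x, y} = maximalIdeal S) :
    Ideal.span {φ x, φ y} = maximalIdeal S' := by
  rw [← h𝔪, ← hxy, Ideal.map_span, Set.image_pair]

/-- If `a x + u y` with `u` a unit: `(x, a x + u y) = (x, y)`. [folklore] -/
private theorem span_pair_add_mul_eq (x y a : S) {u : S} (hu : IsUnit u) :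
    Ideal.span {x, a * x + u * y} = Ideal.span {x, y} := by
  rw [Ideal.span_pair_mul_left_add, Ideal.span_insert, Ideal.span_singleton_mul_left_unit hu,
    ← Ideal.span_insert]

end Tools

/-! ## The descent setting -/

section Descent

variable {S : Type u} {S' : Type v} [CommRing S] [CommRing S'] [IsRegularLocalRing S] [IsRegularLocalRing S']
  [Algebra S S'] [IsLocalHom (algebraMap S S')]
  (hdim : ringKrullDim S = (2 : ℕ)) (hdim' : ringKrullDim S' = (2 : ℕ))
  (h𝔪 : (maximalIdeal S).map (algebraMap S S') = maximalIdeal S')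
  (p : ℕ) [ExpChar (ResidueField S') p]
  (hcl : ∀ z : ResidueField S', z ^ p ∈ (ResidueField.map (algebraMap S S')).range →
    z ∈ (ResidueField.map (algebraMap S S')).range)
  {x y : S} (hxy : Ideal.span {x, y} = maximalIdeal S)

/-- Residues along `(algebraMap S S')`: `ι (res a) = res ((algebraMap S S') a)` where `ι` is the residue field map. [folklore] -/
private theorem map_residue_algebraMap (a : S) :
    ResidueField.map (algebraMap S S') (residue S a) = residue S' (algebraMap S S' a) := rfl

/-- An element of `κ′` in the image of `κ` is the residue of an element coming from `S`. [folklore] -/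
private theorem exists_algebraMap_sub_mem_of_mem_range {z : ResidueField S'}
    (hz : z ∈ (ResidueField.map (algebraMap S S')).range) :
    ∃ a : S, residue S' (algebraMap S S' a) = z := by
  obtain ⟨w, hw⟩ := hz
  obtain ⟨a, rfl⟩ := residue_surjective w
  exact ⟨a, hw⟩

include hdim hdim' h𝔪 hcl hxy in
/-- **Steepenings descend.**  See the module docstring. [cite: AbramovichQuekSchober2025, Thm 3.5 proof (b), p. 8] -/
theorem exists_steepening_of_map {f : S} {b : ℕ} (hb : 0 < b) {ν : ℕ} (hν : 1 ≤ ν)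
    (hf : f ∈ weightedMonomialIdeal ![x, y] ![1, b] (b * ν)) {c' lam' : S'} (hc' : IsUnit c')
    (h : algebraMap S S' f - c' * (algebraMap S S' y - lam' * algebraMap S S' x ^ b) ^ ν ∈
      weightedMonomialIdeal ![algebraMap S S' x, algebraMap S S' y] ![1, b] (b * ν + 1)) :
    ∃ c lam : S, IsUnit c ∧ f - c * (y - lam * x ^ b) ^ ν ∈ weightedMonomialIdeal ![x, y] ![1, b] (b * ν + 1) := by
  classical
  have hu := span_range_vecCons_eq hxy
  have hxy' : Ideal.span {(algebraMap S S') x, (algebraMap S S') y} = maximalIdeal S' := span_pair_map_eq (algebraMap S S') h𝔪 hxy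
  -- a unit expansion of `f` in `S`, pushed to `S′`
  obtain ⟨Δ, a, hunit, -, hr⟩ := exists_unitExpansion ![x, y] hu f (b * ν + 2)
  have hr' : (algebraMap S S') f - ∑ α ∈ Δ, (algebraMap S S') (a α) * ∏ i, (![(algebraMap S S') x, (algebraMap S S') y] : Fin 2 → S') i ^ α i ∈
      maximalIdeal S' ^ (b * ν + 2) := by
    have h1 : (algebraMap S S') (f - ∑ α ∈ Δ, a α * ∏ i, (![x, y] : Fin 2 → S) i ^ α i) ∈ maximalIdeal S' ^ (b * ν + 2) := by
      rw [← h𝔪, ← Ideal.map_pow]; exact Ideal.mem_map_of_mem _ hr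
    have h2 : (algebraMap S S') (f - ∑ α ∈ Δ, a α * ∏ i, (![x, y] : Fin 2 → S) i ^ α i) =
        (algebraMap S S') f - ∑ α ∈ Δ, (algebraMap S S') (a α) * ∏ i, (![(algebraMap S S') x, (algebraMap S S') y] : Fin 2 → S') i ^ α i := by
      rw [map_sub, map_sum]
      congr 1
      refine Finset.sum_congr rfl fun α _ => ?_
      rw [map_mul, map_prod]
      congr 1
      refine Finset.prod_congr rfl fun i _ => ?_
      rw [map_pow, ← comp_vecCons_two (algebraMap S S') x y]
    rw [h2] at h1; exact h1
  have hunit' : ∀ α ∈ Δ, IsUnit ((algebraMap S S') (a α)) := fun α hα => (hunit α hα).map (algebraMap S S')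
  have hf' : (algebraMap S S') f ∈ weightedMonomialIdeal ![(algebraMap S S') x, (algebraMap S S') y] ![1, b] (b * ν) := by
    rw [← map_weightedMonomialIdeal_two]; exact Ideal.mem_map_of_mem _ hf
  -- read the face over `κ′`
  have hq' : (algebraMap S S') f - ∑ k ∈ Finset.range (ν + 1), (c' * (ν.choose k : S') * (-lam') ^ k) *
      ((algebraMap S S') x ^ (b * k) * (algebraMap S S') y ^ (ν - k)) ∈ weightedMonomialIdeal ![(algebraMap S S') x, (algebraMap S S') y] ![1, b] (b * ν + 1) := by
    rw [← mul_sub_pow_eq_sum]; exact h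
  have hface' := fun k (hk : k ≤ ν) =>
    residue_faceCoeff_sub_mem hdim' hxy' hunit' hr' hb (by omega) hf' _ hq' hk
  -- the face coefficients come from `S`: apply the binomial descent over the residue fields
  letI : Algebra (ResidueField S) (ResidueField S') := (ResidueField.map (algebraMap S S')).toAlgebra
  have hιdef : algebraMap (ResidueField S) (ResidueField S') = ResidueField.map (algebraMap S S') := rfl
  have hc'0 : residue S' c' ≠ 0 := (residue_ne_zero_iff_isUnit c').mpr hc'
  have hcoef : ∀ k ≤ ν, residue S' c' * (ν.choose k : ResidueField S') * residue S' (-lam') ^ k ∈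
      (algebraMap (ResidueField S) (ResidueField S')).range := by
    intro k hk
    refine ⟨residue S (if (![b * k, ν - k] : Fin 2 → ℕ) ∈ Δ then a ![b * k, ν - k] else 0), ?_⟩
    rw [hιdef, map_residue_algebraMap]
    have e := (Ideal.Quotient.eq (I := maximalIdeal S')).mpr (hface' k hk)
    change residue S' _ = residue S' _ at e
    rw [apply_ite (algebraMap S S'), map_zero, e]
    simp only [map_mul, map_natCast, map_pow]
  obtain ⟨⟨m₀, hm₀⟩, ⟨γ₀, hγ₀⟩⟩ :=
    mem_range_of_forall_choose_mul_pow_mem p (by rw [hιdef]; exact hcl) hν hc'0 hcoef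
  obtain ⟨m, hm⟩ := exists_algebraMap_sub_mem_of_mem_range (S := S) ⟨m₀, hm₀⟩
  obtain ⟨c, hc⟩ := exists_algebraMap_sub_mem_of_mem_range (S := S) ⟨γ₀, hγ₀⟩
  -- `c` is a unit, `lam := -m`
  have hcunit : IsUnit c := by
    have : IsUnit ((algebraMap S S') c) := (residue_ne_zero_iff_isUnit ((algebraMap S S') c)).mp (by rw [hc]; exact hc'0)
    exact (isUnit_map_iff (algebraMap S S') c).mp this
  refine ⟨c, -m, hcunit, ?_⟩
  rw [mul_sub_pow_eq_sum]
  refine sub_sum_mem_of_faceCoeff_sub_mem hdim hxy hunit hr hb (by omega) hf _ fun k hk => ?_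
  -- residues agree with those of the face coefficients, since they do after `ι` (injective)
  rw [← Ideal.Quotient.eq]
  change residue S _ = residue S _
  apply (ResidueField.map (algebraMap S S')).injective
  rw [map_residue_algebraMap, map_residue_algebraMap]
  have e := (Ideal.Quotient.eq (I := maximalIdeal S')).mpr (hface' k hk)
  change residue S' _ = residue S' _ at e
  rw [apply_ite (algebraMap S S'), map_zero, e]
  simp only [map_mul, map_natCast, map_pow, map_neg, hc, hm, neg_neg]

include hdim hdim' h𝔪 hcl hxy in
/-- **Tangent `ν`-fold lines descend.**  See the module docstring. [cite: AbramovichQuekSchober2025, Thm 3.5 proof (a), p. 8] -/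
theorem exists_tangent_line_of_map {f : S} {ν : ℕ} (hν : 1 ≤ ν) (hf : f ∈ maximalIdeal S ^ ν)
    {x' y' c' : S'} (hxy'' : Ideal.span {x', y'} = maximalIdeal S') (hc' : IsUnit c')
    (h : algebraMap S S' f - c' * y' ^ ν ∈ maximalIdeal S' ^ (ν + 1)) :
    ∃ x₀ y₀ c : S, Ideal.span {x₀, y₀} = maximalIdeal S ∧ IsUnit c ∧ f - c * y₀ ^ ν ∈ maximalIdeal S ^ (ν + 1) := by
  classical
  have hu := span_range_vecCons_eq hxy
  have hxy' : Ideal.span {(algebraMap S S') x, (algebraMap S S') y} = maximalIdeal S' := span_pair_map_eq (algebraMap S S') h𝔪 hxy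
  -- `y' = s φx + t φy`, not both coefficients in `𝔪′`
  obtain ⟨s, t, hst⟩ : ∃ s t : S', s * (algebraMap S S') x + t * (algebraMap S S') y = y' :=
    Ideal.mem_span_pair.mp (by rw [hxy']; exact hxy'' ▸ Ideal.subset_span (by simp))
  have hst𝔪 : ¬ (s ∈ maximalIdeal S' ∧ t ∈ maximalIdeal S') := by
    rintro ⟨hs, ht⟩
    apply (LocalGameEFTSteepening.not_mem_sq_of_span_pair_eq hdim' hxy'').2
    rw [← hst, pow_two]
    exact Ideal.add_mem _ (Ideal.mul_mem_mul hs (hxy' ▸ Ideal.subset_span (by simp)))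
      (Ideal.mul_mem_mul ht (hxy' ▸ Ideal.subset_span (by simp)))
  -- unit expansion of `f` in `S`, pushed to `S′`; filtrations `(1,1)` are the `𝔪`-adic ones
  obtain ⟨Δ, a, hunit, -, hr⟩ := exists_unitExpansion ![x, y] hu f (1 * ν + 2)
  have hr' : (algebraMap S S') f - ∑ α ∈ Δ, (algebraMap S S') (a α) * ∏ i, (![(algebraMap S S') x, (algebraMap S S') y] : Fin 2 → S') i ^ α i ∈
      maximalIdeal S' ^ (1 * ν + 2) := by
    have h1 : (algebraMap S S') (f - ∑ α ∈ Δ, a α * ∏ i, (![x, y] : Fin 2 → S) i ^ α i) ∈ maximalIdeal S' ^ (1 * ν + 2) := by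
      rw [← h𝔪, ← Ideal.map_pow]; exact Ideal.mem_map_of_mem _ hr
    have h2 : (algebraMap S S') (f - ∑ α ∈ Δ, a α * ∏ i, (![x, y] : Fin 2 → S) i ^ α i) =
        (algebraMap S S') f - ∑ α ∈ Δ, (algebraMap S S') (a α) * ∏ i, (![(algebraMap S S') x, (algebraMap S S') y] : Fin 2 → S') i ^ α i := by
      rw [map_sub, map_sum]
      congr 1
      refine Finset.sum_congr rfl fun α _ => ?_
      rw [map_mul, map_prod]
      congr 1
      refine Finset.prod_congr rfl fun i _ => ?_
      rw [map_pow, ← comp_vecCons_two (algebraMap S S') x y]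
    rw [h2] at h1; exact h1
  have hunit' : ∀ α ∈ Δ, IsUnit ((algebraMap S S') (a α)) := fun α hα => (hunit α hα).map (algebraMap S S')
  have hJ : ∀ n, weightedMonomialIdeal ![x, y] ![1, 1] n = maximalIdeal S ^ n := fun n => by
    rw [LocalGameEFTSteepening.weightedMonomialIdeal_one_eq_pow, hxy]
  have hJ' : ∀ n, weightedMonomialIdeal ![(algebraMap S S') x, (algebraMap S S') y] ![1, 1] n = maximalIdeal S' ^ n := fun n => by
    rw [LocalGameEFTSteepening.weightedMonomialIdeal_one_eq_pow, hxy']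
  have hfJ : f ∈ weightedMonomialIdeal ![x, y] ![1, 1] (1 * ν) := by rw [hJ, one_mul]; exact hf
  have hf' : (algebraMap S S') f ∈ weightedMonomialIdeal ![(algebraMap S S') x, (algebraMap S S') y] ![1, 1] (1 * ν) := by
    rw [← map_weightedMonomialIdeal_two]; exact Ideal.mem_map_of_mem _ hfJ
  have hq' : (algebraMap S S') f - ∑ k ∈ Finset.range (ν + 1), (c' * (ν.choose k : S') * s ^ k * t ^ (ν - k)) *
      ((algebraMap S S') x ^ (1 * k) * (algebraMap S S') y ^ (ν - k)) ∈ weightedMonomialIdeal ![(algebraMap S S') x, (algebraMap S S') y] ![1, 1] (1 * ν + 1) := by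
    rw [← mul_linear_pow_eq_sum, hst, hJ', one_mul]; exact h
  have hface' := fun k (hk : k ≤ ν) =>
    residue_faceCoeff_sub_mem hdim' hxy' hunit' hr' Nat.one_pos (by omega) hf' _ hq' hk
  -- binomial descent over the residue fields
  letI : Algebra (ResidueField S) (ResidueField S') := (ResidueField.map (algebraMap S S')).toAlgebra
  have hιdef : algebraMap (ResidueField S) (ResidueField S') = ResidueField.map (algebraMap S S') := rfl
  have hc'0 : residue S' c' ≠ 0 := (residue_ne_zero_iff_isUnit c').mpr hc'
  have hst0 : residue S' s ≠ 0 ∨ residue S' t ≠ 0 := by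
    by_contra hcon
    push Not at hcon
    exact hst𝔪 ⟨(residue_eq_zero_iff s).mp hcon.1, (residue_eq_zero_iff t).mp hcon.2⟩
  have hcoef : ∀ k ≤ ν, residue S' c' * (ν.choose k : ResidueField S') * residue S' s ^ k * residue S' t ^ (ν - k) ∈
      (algebraMap (ResidueField S) (ResidueField S')).range := by
    intro k hk
    refine ⟨residue S (if (![1 * k, ν - k] : Fin 2 → ℕ) ∈ Δ then a ![1 * k, ν - k] else 0), ?_⟩
    rw [hιdef, map_residue_algebraMap]
    have e := (Ideal.Quotient.eq (I := maximalIdeal S')).mpr (hface' k hk)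
    change residue S' _ = residue S' _ at e
    rw [apply_ite (algebraMap S S'), map_zero, e]
    simp only [map_mul, map_natCast, map_pow]
  obtain ⟨c₀, α₀, β₀, hc₀, hcoef₀⟩ :=
    exists_descent_of_forall_choose_mul_pow_mul_pow_mem p (by rw [hιdef]; exact hcl) hν hc'0 hst0 hcoef
  obtain ⟨a₀, rfl⟩ := residue_surjective α₀
  obtain ⟨b₀, rfl⟩ := residue_surjective β₀
  obtain ⟨c, rfl⟩ := residue_surjective c₀
  have hcunit : IsUnit c := (residue_ne_zero_iff_isUnit c).mp hc₀
  -- lift: `f ≡ c (a₀ x + b₀ y)^ν` modulo `𝔪^{ν+1}`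
  have hlift : f - c * (a₀ * x + b₀ * y) ^ ν ∈ maximalIdeal S ^ (ν + 1) := by
    rw [mul_linear_pow_eq_sum, ← hJ]
    have H := sub_sum_mem_of_faceCoeff_sub_mem hdim hxy hunit hr Nat.one_pos (by omega) hfJ
      (fun k => c * (ν.choose k : S) * a₀ ^ k * b₀ ^ (ν - k)) fun k hk => ?_
    · simp only [one_mul] at H ⊢
      exact H
    rw [← Ideal.Quotient.eq]
    change residue S _ = residue S _
    apply (ResidueField.map (algebraMap S S')).injective
    rw [map_residue_algebraMap]
    have e := (Ideal.Quotient.eq (I := maximalIdeal S')).mpr (hface' k hk)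
    change residue S' _ = residue S' _ at e
    rw [apply_ite (algebraMap S S'), map_zero, e]
    have H' := hcoef₀ k hk
    rw [hιdef] at H'
    simp only [map_mul, map_natCast, map_pow] at H' ⊢
    exact H'.symm
  -- a regular system of parameters through `a₀ x + b₀ y`
  by_cases hb₀ : IsUnit b₀
  · exact ⟨x, a₀ * x + b₀ * y, c, by rw [span_pair_add_mul_eq x y a₀ hb₀, hxy], hcunit, hlift⟩
  · have ha₀ : IsUnit a₀ := by
      by_contra ha₀
      have hα : residue S a₀ = 0 := (residue_eq_zero_iff a₀).mpr ((mem_maximalIdeal _).mpr (mem_nonunits_iff.mpr ha₀))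
      have hβ : residue S b₀ = 0 := (residue_eq_zero_iff b₀).mpr ((mem_maximalIdeal _).mpr (mem_nonunits_iff.mpr hb₀))
      have hν0 : ν ≠ 0 := by omega
      have eν := hcoef₀ ν le_rfl
      have e0 := hcoef₀ 0 (Nat.zero_le ν)
      simp only [hα, hβ, zero_pow hν0, mul_zero, map_zero, Nat.sub_self, Nat.sub_zero, pow_zero, mul_one,
        Nat.choose_self, Nat.choose_zero_right, Nat.cast_one] at eν e0
      rcases hst0 with h0 | h0
      · exact h0 ((pow_eq_zero_iff hν0).mp ((mul_eq_zero.mp eν.symm).resolve_left hc'0))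
      · exact h0 ((pow_eq_zero_iff hν0).mp ((mul_eq_zero.mp e0.symm).resolve_left hc'0))
    refine ⟨y, a₀ * x + b₀ * y, c, ?_, hcunit, hlift⟩
    rw [show a₀ * x + b₀ * y = b₀ * y + a₀ * x by ring, span_pair_add_mul_eq y x b₀ ha₀, Ideal.span_pair_comm, hxy]

end Descent

end Literature.AlgebraicGeometry.Resolution.WeightedInvariant.AQSBaseChange

end Part6

/-!
## Part 7 — port of `Summits/ResolutionOfSingularities/ResolutionOfSingularities/Theorems/AQSHeightTwoSlopeCompare.lean`

# Abramovich–Quek–Schober at a height-two point, II: comparing two contact parameters through the DVR `S/(y)`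

Topic: `Summits/ResolutionOfSingularities/ResolutionOfSingularities/Theorems`. Helper for the door item
`HypersurfaceCentreConstruction` (statement `stmt-ResolutionOfSingularities-19897`, route `WeightedInvariant`), line
`local-engine`, ORDER (o25) «F-AQS-T in the kernel» of `res-L1-w43-plan-1` (2026-08-27T09:19:49Z), piece (α2) of
`plan/tools/res-type-092/o25/O25-DESIGN.md` (res-type-092).  The one NEW lemma behind Abramovich–Quek–Schober's Thm 3.5
(maximality AND uniqueness of the lex-maximal centre) in the tree's currency; it generalises the key step C2
`ContactFiltration.mem_span_sup_pow_of_mem_contactFiltration` (res-type-078, p511384: integer slopes, any dimension) to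
RATIONAL slopes in dimension two, with the same proof.

[OURS · L1 W4.3] Folklore (Hironaka 1967 / Cossart–Piltant / AQS Thm 3.5 proof (a)–(c)).  NOT a statement of the manuscript
under review (Hironaka 2017); nothing here is a claim about resolution of singularities.  AI work, weaker than expert review.
Def-free.

## Content (`S` regular local of dimension `2`, `(x, y) = (x', y') = 𝔪`, `1 ≤ ν`, `f ∉ 𝔪^{ν+1}`,
`𝒥ₙ((x,y);(q,r)) := weightedMonomialIdeal ![x, y] ![q, r] n`)

* **`exists_order_ge`** (core): if `f ∈ 𝒥_{rν}((x,y);(q,r))` and `f ∈ 𝒥_{r'ν}((x',y');(q',r'))` with `1 < r'/q'` and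
  `r/q ≤ r'/q'`, then `y' ∈ (y) + 𝔪^t` for some `t` with `q t ≥ r`.  Proof in `D = S/(y)` (regular local of dimension one):
  `f̄ ∈ 𝔪_D^⌈rν/q⌉`; `f = c y'^ν + f'`, `c` a unit, `f'` in the lower pieces; if `t = ord_D ȳ'` had `q t < r` (hence `q' t < r'`)
  then `f̄'` and `f̄` would both lie in `𝔪_D^{νt+1}`, forcing `ȳ'^ν ∈ 𝔪_D^{νt+1}` — impossible.
* `exists_eq_unit_mul_add` — then `y' = a·y + h`, `a` a unit, `h ∈ 𝔪^t`.
* **`filtration_eq_of_mem_of_mem`** (AQS Thm 3.5 UNIQUENESS): two regular systems carrying `f` at the SAME slope `r/q > 1`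
  define the same filtration `𝒥∙((·,·);(q,r))`.
* **`exists_steeper_of_not_dvd`** (AQS Thm 3.5 MAXIMALITY, non-integer slope): if `q ∤ r` and `y'` carries `f` at a STRICTLY
  larger slope `r'/q'`, then `y` itself carries `f` at some slope in `(r/q, r'/q']`.
* `exists_steepen_form_of_le` — integer slope `b`: `y' ∈ (y) + 𝔪^t`, `t ≥ b ≥ 2` ⇒ `y' = a·(y - λ x^b)` with `a` a unit.

## References

* D. Abramovich, M. H. Quek, B. Schober, arXiv:2507.01232v3, Thm 3.5 and its proof (a)–(c), p. 7–9. [AbramovichQuekSchober2025]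
* H. Hironaka, *Characteristic polyhedra of singularities*, J. Math. Kyoto Univ. 7 (1967). [Hironaka1967]
-/

section Part7


open _root_.IsLocalRing _root_.Literature.AlgebraicGeometry.Resolution

namespace Literature.AlgebraicGeometry.Resolution.WeightedInvariant

namespace AQSHeightTwo

universe u

variable {S : Type u} [CommRing S]

/-! ### Arithmetic of `⌈a/q⌉ = (a + q - 1)/q` -/

/-- `q k < a ⇒ k + 1 ≤ ⌈a/q⌉`. [folklore] -/
private theorem succ_le_cdiv_of_mul_lt {a q k : ℕ} (hq : 0 < q) (h : q * k < a) : k + 1 ≤ (a + q - 1) / q := by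
  rw [Nat.le_div_iff_mul_le hq]
  have : (k + 1) * q = q * k + q := by ring
  omega

/-! ### The core comparison -/

section Core

variable [IsRegularLocalRing S]

/-- **Core comparison through `D = S/(y)`.**  `S` regular local of dimension two, `(x, y) = (x', y') = 𝔪`, `1 ≤ ν`,
`f ∉ 𝔪^{ν+1}`; `f ∈ 𝒥_{rν}((x,y);(q,r))` (slope `r/q`, `q ≥ 1`) and `f ∈ 𝒥_{r'ν}((x',y');(q',r'))` (slope `r'/q' > 1`,
`q' ≥ 1`) with `r/q ≤ r'/q'`.  Then `y' ∈ (y) + 𝔪^t` for some `t` with `r ≤ q t`.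
[cite: AbramovichQuekSchober2025, Thm 3.5 proof (a)–(c)] -/
theorem exists_order_ge (hdim : ringKrullDim S = (2 : ℕ)) {x y x' y' f : S}
    (hxy : Ideal.span {x, y} = maximalIdeal S) (hxy' : Ideal.span {x', y'} = maximalIdeal S)
    {ν : ℕ} (hν : 1 ≤ ν) (hford : f ∉ maximalIdeal S ^ (ν + 1))
    {q r q' r' : ℕ} (hq : 0 < q) (hq' : 0 < q') (hlt' : q' < r') (hle : r * q' ≤ r' * q)
    (hf : f ∈ weightedMonomialIdeal ![x, y] ![q, r] (r * ν))
    (hf' : f ∈ weightedMonomialIdeal ![x', y'] ![q', r'] (r' * ν)) :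
    ∃ t : ℕ, r ≤ q * t ∧ y' ∈ Ideal.span {y} ⊔ maximalIdeal S ^ t := by
  classical
  have hx : x ∈ maximalIdeal S := hxy ▸ Ideal.subset_span (by simp)
  have hy : y ∈ maximalIdeal S := hxy ▸ Ideal.subset_span (by simp)
  have hx' : x' ∈ maximalIdeal S := hxy' ▸ Ideal.subset_span (by simp)
  have hy' : y' ∈ maximalIdeal S := hxy' ▸ Ideal.subset_span (by simp)
  have hy2 : y ∉ maximalIdeal S ^ 2 := (LocalGameEFTSteepening.not_mem_sq_of_span_pair_eq hdim hxy).2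
  -- the quotient `D = S/(y)`, a regular local ring
  haveI hD : IsRegularLocalRing (S ⧸ Ideal.span {y}) := (IsRegularLocalRing.quotient_span_singleton hy hy2).1
  set mk : S →+* S ⧸ Ideal.span {y} := Ideal.Quotient.mk (Ideal.span {y}) with hmk
  have hmkmax : (maximalIdeal S).map mk = maximalIdeal (S ⧸ Ideal.span {y}) :=
    IsLocalRing.map_maximalIdeal_of_surjective mk Ideal.Quotient.mk_surjective
  have hcomap : ∀ k : ℕ, (maximalIdeal (S ⧸ Ideal.span {y}) ^ k).comap mk = Ideal.span {y} ⊔ maximalIdeal S ^ k :=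
    fun k => by
      rw [← hmkmax, ← Ideal.map_pow, Ideal.comap_map_of_surjective mk Ideal.Quotient.mk_surjective,
        ← RingHom.ker_eq_comap_bot, hmk, Ideal.mk_ker, sup_comm]
  -- if `y' ∈ (y)` any large `t` will do
  by_cases hzero : mk y' = 0
  · rw [Ideal.Quotient.eq_zero_iff_mem] at hzero
    exact ⟨r, Nat.le_mul_of_pos_left r hq, Ideal.mem_sup_left hzero⟩
  -- the order `t` of `ȳ'`
  obtain ⟨t, ht⟩ := ENat.ne_top_iff_exists.mp (adicOrder_ne_top hzero)
  have htmem : mk y' ∈ maximalIdeal (S ⧸ Ideal.span {y}) ^ t := (le_adicOrder_iff _ _).mp ht.le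
  have htnot : mk y' ∉ maximalIdeal (S ⧸ Ideal.span {y}) ^ (t + 1) := (adicOrder_le_iff _ _).mp ht.ge
  refine ⟨t, ?_, by rw [← hcomap t, Ideal.mem_comap]; exact htmem⟩
  by_contra hqt
  push Not at hqt
  -- then also `q' t < r'`
  have hqt' : q' * t < r' := by
    have h1 : q' * (q * t) < q' * r := Nat.mul_lt_mul_of_pos_left hqt hq'
    have h2 : q' * r ≤ r' * q := by rw [Nat.mul_comm]; exact hle
    have h3 : q * (q' * t) < q * r' := by nlinarith
    exact Nat.lt_of_mul_lt_mul_left h3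
  -- the lower pieces `I'` of the `y'`-filtration, and `f = c y'^ν + f'`
  set I' : Ideal S := ⨆ j, ⨆ (_ : j < ν), Ideal.span {y' ^ j} * maximalIdeal S ^ ((r' * (ν - j) + q' - 1) / q')
    with hI'
  have hsplit : f ∈ Ideal.span {y' ^ ν} ⊔ I' := le_span_pow_sup_iSup hx' y' hq' r' ν hf'
  have hI'le : I' ≤ maximalIdeal S ^ (ν + 1) := by
    rw [hI']
    refine iSup_le fun j => iSup_le fun hj => ?_
    have h1 : Ideal.span {y' ^ j} ≤ maximalIdeal S ^ j := by
      rw [Ideal.span_singleton_le_iff_mem]; exact Ideal.pow_mem_pow hy' j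
    refine le_trans (Ideal.mul_mono_left h1) ?_
    rw [← pow_add]
    refine Ideal.pow_le_pow_right ?_
    -- `⌈r'(ν-j)/q'⌉ ≥ (ν - j) + 1` since `r' > q'`
    have hk : (ν - j) + 1 ≤ (r' * (ν - j) + q' - 1) / q' :=
      succ_le_cdiv_of_mul_lt hq' (Nat.mul_lt_mul_of_pos_right hlt' (by omega))
    omega
  obtain ⟨a, ha, f', hf'I, haf⟩ := Submodule.mem_sup.mp hsplit
  obtain ⟨c, rfl⟩ := Ideal.mem_span_singleton'.mp ha
  -- `c` is a unit
  have hc : IsUnit c := by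
    by_contra hcu
    have hcm : c ∈ maximalIdeal S := (IsLocalRing.mem_maximalIdeal _).mpr hcu
    apply hford
    rw [← haf]
    refine Ideal.add_mem _ ?_ (hI'le hf'I)
    rw [pow_succ']
    exact Ideal.mul_mem_mul hcm (Ideal.pow_mem_pow hy' ν)
  -- in `D`: `f̄ ∈ 𝔪_D^{νt+1}` (only the `x`-axis of the `y`-filtration survives, at height `⌈rν/q⌉ > νt`)
  have hνt : ν * t + 1 ≤ (r * ν + q - 1) / q :=
    succ_le_cdiv_of_mul_lt hq (by nlinarith)
  have hfD : mk f ∈ maximalIdeal (S ⧸ Ideal.span {y}) ^ (ν * t + 1) := by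
    refine Ideal.pow_le_pow_right hνt ?_
    rw [← Ideal.mem_comap, hcomap]
    exact le_span_sup_pow_cdiv hx y hq r (r * ν) hf
  -- in `D`: `f̄' ∈ 𝔪_D^{νt+1}` (`ȳ'^j ∈ 𝔪_D^{tj}` and `⌈r'(ν-j)/q'⌉ ≥ t(ν-j) + 1`)
  have hI'D : I'.map mk ≤ maximalIdeal (S ⧸ Ideal.span {y}) ^ (ν * t + 1) := by
    rw [hI', Ideal.map_iSup]
    refine iSup_le fun j => ?_
    rw [Ideal.map_iSup]
    refine iSup_le fun hj => ?_
    rw [Ideal.map_mul, Ideal.map_pow, hmkmax, Ideal.map_span, Set.image_singleton, map_pow]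
    have h1 : Ideal.span {mk y' ^ j} ≤ maximalIdeal (S ⧸ Ideal.span {y}) ^ (t * j) := by
      rw [Ideal.span_singleton_le_iff_mem, pow_mul]
      exact Ideal.pow_mem_pow htmem j
    refine le_trans (Ideal.mul_mono_left h1) ?_
    rw [← pow_add]
    refine Ideal.pow_le_pow_right ?_
    have hk : t * (ν - j) + 1 ≤ (r' * (ν - j) + q' - 1) / q' := by
      refine succ_le_cdiv_of_mul_lt hq' ?_
      have : 0 < ν - j := by omega
      nlinarith
    have e : t * j + t * (ν - j) = t * ν := by rw [← Nat.mul_add, Nat.add_sub_cancel' hj.le]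
    have e' : ν * t = t * ν := Nat.mul_comm _ _
    omega
  -- hence `c̄ ȳ'^ν ∈ 𝔪_D^{νt+1}`, i.e. `ȳ'^ν ∈ 𝔪_D^{νt+1}`: contradiction
  have hcg : mk (c * y' ^ ν) ∈ maximalIdeal (S ⧸ Ideal.span {y}) ^ (ν * t + 1) := by
    have : mk (c * y' ^ ν) = mk f - mk f' := by rw [← haf, map_add, add_sub_cancel_right]
    rw [this]
    exact Ideal.sub_mem _ hfD (hI'D (Ideal.mem_map_of_mem mk hf'I))
  have hgν : mk y' ^ ν ∈ maximalIdeal (S ⧸ Ideal.span {y}) ^ (ν * t + 1) := by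
    rw [map_mul, map_pow] at hcg
    obtain ⟨u, hu⟩ := hc.map mk
    have := Ideal.mul_mem_left _ (↑u⁻¹ : S ⧸ Ideal.span {y}) hcg
    rwa [← mul_assoc, ← hu, Units.inv_mul, one_mul] at this
  exact ContactFiltration.pow_not_mem_pow_of_not_mem_pow htnot ν hgν

/-- From `y' ∈ (y) + 𝔪^t` with `t ≥ 2` and `y'` a regular parameter (`(x', y') = 𝔪`): `y' = a·y + h` with `a` a unit and
`h ∈ 𝔪^t`. [folklore] -/
private theorem exists_eq_unit_mul_add (hdim : ringKrullDim S = (2 : ℕ)) {y x' y' : S}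
    (hxy' : Ideal.span {x', y'} = maximalIdeal S) (hy : y ∈ maximalIdeal S) {t : ℕ} (ht : 2 ≤ t)
    (hmem : y' ∈ Ideal.span {y} ⊔ maximalIdeal S ^ t) :
    ∃ a h : S, IsUnit a ∧ h ∈ maximalIdeal S ^ t ∧ y' = a * y + h := by
  obtain ⟨s, hs, h, hh, rfl⟩ := Submodule.mem_sup.mp hmem
  obtain ⟨a, rfl⟩ := Ideal.mem_span_singleton'.mp hs
  refine ⟨a, h, ?_, hh, rfl⟩
  by_contra ha
  have hy'2 : a * y + h ∉ maximalIdeal S ^ 2 := (LocalGameEFTSteepening.not_mem_sq_of_span_pair_eq hdim hxy').2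
  apply hy'2
  refine Ideal.add_mem _ ?_ (Ideal.pow_le_pow_right ht hh)
  rw [pow_two]
  exact Ideal.mul_mem_mul ((IsLocalRing.mem_maximalIdeal _).mpr ha) hy

/-- **AQS Thm 3.5, UNIQUENESS of the Rees filtration.**  If two regular systems `(x, y)`, `(x', y')` of the two-dimensional
regular local ring `S` both carry `f ∉ 𝔪^{ν+1}` (`ν ≥ 1`) at the same slope `r/q > 1` — `f ∈ 𝒥_{rν}((x,y);(q,r))` and
`f ∈ 𝒥_{rν}((x',y');(q,r))` — then `𝒥ₙ((x',y');(q,r)) = 𝒥ₙ((x,y);(q,r))` for every `n`.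
[cite: AbramovichQuekSchober2025, Thm 3.5 proof (c)] -/
theorem filtration_eq_of_mem_of_mem (hdim : ringKrullDim S = (2 : ℕ)) {x y x' y' f : S}
    (hxy : Ideal.span {x, y} = maximalIdeal S) (hxy' : Ideal.span {x', y'} = maximalIdeal S)
    {ν : ℕ} (hν : 1 ≤ ν) (hford : f ∉ maximalIdeal S ^ (ν + 1))
    {q r : ℕ} (hq : 0 < q) (hqr : q < r)
    (hf : f ∈ weightedMonomialIdeal ![x, y] ![q, r] (r * ν))
    (hf' : f ∈ weightedMonomialIdeal ![x', y'] ![q, r] (r * ν)) (n : ℕ) :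
    weightedMonomialIdeal ![x', y'] ![q, r] n = weightedMonomialIdeal ![x, y] ![q, r] n := by
  have hy : y ∈ maximalIdeal S := hxy ▸ Ideal.subset_span (by simp)
  obtain ⟨t, hrt, hmem⟩ := exists_order_ge hdim hxy hxy' hν hford hq hq hqr le_rfl hf hf'
  have ht2 : 2 ≤ t := by
    by_contra h
    push Not at h
    interval_cases t <;> omega
  obtain ⟨a, h, ha, hh, rfl⟩ := exists_eq_unit_mul_add hdim hxy' hy ht2 hmem
  have hxay : Ideal.span {x, a * y + h} = maximalIdeal S :=
    span_pair_eq_of_unit_mul_add hxy ha (Ideal.pow_le_pow_right ht2 hh)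
  rw [eq_of_fst hxay hxy' hqr.le n, eq_of_snd_eq_unit_mul_add hxy ha ht2 hh hqr.le hrt n]

/-- **AQS Thm 3.5, MAXIMALITY at a non-integer slope.**  If `(x, y)` carries `f ∉ 𝔪^{ν+1}` at the slope `r/q` with `q ∤ r`
(`q ≥ 1`, `r > q`) and another regular system `(x', y')` carries it at a STRICTLY larger slope `r'/q'` (`q' ≥ 1`), then
`(x, y)` ITSELF carries `f` at a slope `r''/q'' ∈ (r/q, r'/q']`.  (So a slope that is maximal among the slopes of `y` and not an
integer is maximal over all regular systems.) [cite: AbramovichQuekSchober2025, Thm 3.5 proof (a)–(b)] -/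
theorem exists_steeper_of_not_dvd (hdim : ringKrullDim S = (2 : ℕ)) {x y x' y' f : S}
    (hxy : Ideal.span {x, y} = maximalIdeal S) (hxy' : Ideal.span {x', y'} = maximalIdeal S)
    {ν : ℕ} (hν : 1 ≤ ν) (hford : f ∉ maximalIdeal S ^ (ν + 1))
    {q r q' r' : ℕ} (hq : 0 < q) (hqr : q < r) (hndvd : ¬ q ∣ r) (hq' : 0 < q') (hlt : r * q' < r' * q)
    (hf : f ∈ weightedMonomialIdeal ![x, y] ![q, r] (r * ν))
    (hf' : f ∈ weightedMonomialIdeal ![x', y'] ![q', r'] (r' * ν)) :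
    ∃ q'' r'' : ℕ, 0 < q'' ∧ r * q'' < r'' * q ∧ r'' * q' ≤ r' * q'' ∧
      f ∈ weightedMonomialIdeal ![x, y] ![q'', r''] (r'' * ν) := by
  have hy : y ∈ maximalIdeal S := hxy ▸ Ideal.subset_span (by simp)
  have hlt' : q' < r' := by
    -- `r'/q' > r/q > 1`
    by_contra h
    push Not at h
    have : r' * q ≤ q' * q := Nat.mul_le_mul_right _ h
    nlinarith
  obtain ⟨t, hrt, hmem⟩ := exists_order_ge hdim hxy hxy' hν hford hq hq' hlt' hlt.le hf hf'
  -- `q t > r` since `q ∤ r`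
  have hrt' : r < q * t := by
    rcases hrt.lt_or_eq with h | h
    · exact h
    · exact absurd ⟨t, h⟩ hndvd
  have ht2 : 2 ≤ t := by
    by_contra h
    push Not at h
    interval_cases t <;> omega
  obtain ⟨a, h, ha, hh, rfl⟩ := exists_eq_unit_mul_add hdim hxy' hy ht2 hmem
  have hxay : Ideal.span {x, a * y + h} = maximalIdeal S :=
    span_pair_eq_of_unit_mul_add hxy ha (Ideal.pow_le_pow_right ht2 hh)
  -- read `hf'` with the transversal parameter `x`
  have hf'' : f ∈ weightedMonomialIdeal ![x, a * y + h] ![q', r'] (r' * ν) := by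
    rw [← eq_of_fst hxay hxy' hlt'.le]; exact hf'
  by_cases hcase : r' ≤ q' * t
  · -- the slope `r'/q'` itself transfers to `y`
    refine ⟨q', r', hq', hlt, le_rfl, ?_⟩
    rwa [eq_of_snd_eq_unit_mul_add hxy ha ht2 hh hlt'.le hcase] at hf''
  · -- the integer slope `t < r'/q'` transfers to `y`
    push Not at hcase
    refine ⟨1, t, one_pos, by rw [Nat.mul_one, Nat.mul_comm]; exact hrt', by simpa [Nat.mul_comm] using hcase.le, ?_⟩
    have h1 : f ∈ weightedMonomialIdeal ![x, a * y + h] ![1, t] (t * ν) :=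
      slope_antitone x (a * y + h) hq' (by simpa [Nat.mul_comm] using hcase.le) ν hf''
    rwa [eq_of_snd_eq_unit_mul_add hxy ha ht2 hh (by omega) (by simp) ] at h1

/-- **Integer slope: the steepening form.**  If `y' ∈ (y) + 𝔪^t` with `t ≥ b ≥ 2`, `(x, y) = 𝔪` and `y'` is a regular
parameter, then `y' = a·(y - λ x^b)` for a unit `a` and some `λ ∈ S` (in coordinates `(x, y)`: `𝔪^b = (x^b) + y 𝔪^{b-1}`).
[cite: AbramovichQuekSchober2025, Thm 3.5 proof (b)] -/
theorem exists_steepen_form_of_le (hdim : ringKrullDim S = (2 : ℕ)) {x y x' y' : S}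
    (hxy : Ideal.span {x, y} = maximalIdeal S) (hxy' : Ideal.span {x', y'} = maximalIdeal S)
    {b t : ℕ} (hb : 2 ≤ b) (hbt : b ≤ t) (hmem : y' ∈ Ideal.span {y} ⊔ maximalIdeal S ^ t) :
    ∃ a lam : S, IsUnit a ∧ y' = a * (y - lam * x ^ b) := by
  have hy : y ∈ maximalIdeal S := hxy ▸ Ideal.subset_span (by simp)
  have ht2 : 2 ≤ t := hb.trans hbt
  obtain ⟨a, h, ha, hh, rfl⟩ := exists_eq_unit_mul_add hdim hxy' hy ht2 hmem
  -- `h ∈ 𝔪^b = (x, y)^b ⊆ (y^?) …`: write `h ∈ (y) 𝔪 + (x^b)` using `𝔪^b ⊆ J_b(b)((x,y);(1,b)) ⊆ (y, x^b)`… we use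
  -- `𝔪^b ⊆ (y^1, x^b)` in the form of `weightedMonomialIdeal_le_span_pair` with `ν = 1`
  have hb1 : 1 ≤ b := by omega
  have hhb : h ∈ maximalIdeal S ^ b := Ideal.pow_le_pow_right hbt hh
  have hJ : h ∈ weightedMonomialIdeal ![x, y] ![1, b] (b * 1) := by
    rw [mul_one]; exact LocalGameEFTSteepening.span_pair_pow_le x y hb1 b (hxy ▸ hhb)
  have hpair := LocalGameEFTSteepening.weightedMonomialIdeal_le_span_pair x y b 1 hJ
  rw [pow_one] at hpair
  obtain ⟨s, c, hsc⟩ := Ideal.mem_span_pair.mp hpair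
  -- `a y + h = (a + s) y + c x^b`, and `a + s` is a unit?  `s` need not lie in `𝔪`; but `h ∈ 𝔪² ` and `x^b ∈ 𝔪^b` force
  -- `s y ∈ 𝔪²`, whence `s ∈ 𝔪` (as `y ∉ 𝔪²`): we argue via units directly on `a + s`.
  have hy2 : y ∉ maximalIdeal S ^ 2 := (LocalGameEFTSteepening.not_mem_sq_of_span_pair_eq hdim hxy).2
  have hx : x ∈ maximalIdeal S := hxy ▸ Ideal.subset_span (by simp)
  have hs : s ∈ maximalIdeal S := by
    by_contra hsu
    have hsunit : IsUnit s := by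
      by_contra h'
      exact hsu ((IsLocalRing.mem_maximalIdeal _).mpr h')
    have hsy : s * y = h - c * x ^ b := by rw [← hsc]; ring
    have hmem2 : s * y ∈ maximalIdeal S ^ 2 := by
      rw [hsy]
      refine Ideal.sub_mem _ (Ideal.pow_le_pow_right ht2 hh) (Ideal.mul_mem_left _ _ ?_)
      exact Ideal.pow_le_pow_right hb (Ideal.pow_mem_pow hx b)
    obtain ⟨u, rfl⟩ := hsunit
    apply hy2
    have := Ideal.mul_mem_left _ (↑u⁻¹ : S) hmem2
    rwa [← mul_assoc, Units.inv_mul, one_mul] at this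
  have hunit : IsUnit (a + s) := by
    by_contra hnu
    have hmem : a + s ∈ maximalIdeal S := (IsLocalRing.mem_maximalIdeal _).mpr hnu
    have : a ∈ maximalIdeal S := by simpa using Ideal.sub_mem _ hmem hs
    exact (IsLocalRing.mem_maximalIdeal _).mp this ha
  obtain ⟨w, hw⟩ := hunit
  refine ⟨w, -(↑w⁻¹ * c), w.isUnit, ?_⟩
  have e : a * y + h = (a + s) * y + c * x ^ b := by rw [← hsc]; ring
  rw [e, ← hw]
  have : (w : S) * (y - -(↑w⁻¹ * c) * x ^ b) = (w : S) * y + ((w : S) * ↑w⁻¹) * (c * x ^ b) := by ring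
  rw [this, Units.mul_inv, one_mul]

end Core

end AQSHeightTwo

end Literature.AlgebraicGeometry.Resolution.WeightedInvariant

end Part7

/-!
## Part 8 — port of `Summits/ResolutionOfSingularities/ResolutionOfSingularities/Theorems/WeightedInvariantAQSBaseChangeLexMaxPrelim.lean`

# Preliminaries for the separable base change of the lex-maximal centre: level, contraction, steeper pieces

Route `ResolutionOfSingularities/WeightedInvariant`, door crux `HypersurfaceCentreConstruction`
(stmt-ResolutionOfSingularities-19897) — OURS, helper; e-ladder `e = 1`, piece **(o25-δ)** (res-D-pv-025 AS stub-10), brick (δ1c),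
part 1 of 2 (split for the 400-line rule; part 2 = `…AQSBaseChangeLexMax`):

* `span_pow_sup_le_steeper` — `(z^ν) + 𝒥((x,z);(1,b); bν+1) ⊆ 𝒥((x,z);(ν, bν+1); (bν+1)ν)`: the steeper ADMISSIBLE datum produced by a
  descended steepening;
* `level_eq` — for a lex-maximal germ `(x; w; ℓ)` of `(f)`: `ℓ = w 0 · ν` with `f ∈ 𝔪^ν ∖ 𝔪^{ν+1}`;
* `mem_weightedMonomialIdeal_of_map` — contraction of weighted monomial ideals along a faithfully flat `φ`
  (`Ideal.comap_map_eq_self_of_faithfullyFlat`).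

Def-free; nothing here is a claim about Hironaka's problem.  AI-written; weaker than expert review.
[cite: AbramovichQuekSchober2025, Def. 3.2–3.3, Thm 3.5]
-/

section Part8


namespace Literature.AlgebraicGeometry.Resolution.WeightedInvariant.AQSBaseChange

open _root_.IsLocalRing _root_.Literature.AlgebraicGeometry.Resolution
open _root_.Literature.AlgebraicGeometry.Resolution.WeightedInvariant.AQSHeightTwo

universe u v

/-! ## Small tools -/

section Tools

variable {S : Type u} [CommRing S]

/-- `(x, z; 1, b)`-pieces from level `bν + 1` on, and `z^ν`, lie in the STEEPER piece `𝒥((x,z);(ν, bν+1); (bν+1)ν)`.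
[folklore] -/
private theorem span_pow_sup_le_steeper (x z : S) {b ν : ℕ} (hν : 1 ≤ ν) :
    Ideal.span {z ^ ν} ⊔ weightedMonomialIdeal ![x, z] ![1, b] (b * ν + 1) ≤
      weightedMonomialIdeal ![x, z] ![ν, b * ν + 1] ((b * ν + 1) * ν) := by
  refine sup_le ?_ ?_
  · rw [Ideal.span_singleton_le_iff_mem]
    have := monomial_mem x z ν (b * ν + 1) (i := 0) (j := ν) (n := (b * ν + 1) * ν) (by ring_nf; omega)
    rwa [pow_zero, one_mul] at this
  · refine weightedMonomialIdeal_two_le fun i j hij => monomial_mem x z ν (b * ν + 1) ?_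
    rw [one_mul] at hij
    rcases Nat.lt_or_ge j ν with hj | hj
    · have h1 := Nat.mul_le_mul_left ν hij
      nlinarith
    · nlinarith

/-- A unit factor on the second generator: `(x, u y) = (x, y)`. [folklore] -/
private theorem span_pair_unit_mul_right (x y : S) {u : S} (hu : IsUnit u) : Ideal.span {x, u * y} = Ideal.span {x, y} := by
  rw [Ideal.span_insert, Ideal.span_singleton_mul_left_unit hu, ← Ideal.span_insert]

end Tools

/-! ## The level of a lex-maximal germ is `ν · w₀` with `ν` the order -/

section Level

variable {S : Type} [CommRing S] [IsLocalRing S]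

/-- The `(q,r)`-piece of level `rν` lies in `𝔪^ν` (`q ≤ r`). [folklore] -/
private theorem weightedMonomialIdeal_le_pow {x y : S} (hx : x ∈ maximalIdeal S) (hy : y ∈ maximalIdeal S)
    {q r : ℕ} (hq : 0 < q) (hqr : q ≤ r) (ν : ℕ) :
    weightedMonomialIdeal ![x, y] ![q, r] (r * ν) ≤ maximalIdeal S ^ ν := by
  refine weightedMonomialIdeal_two_le fun i j hij => ?_
  have hij' : ν ≤ i + j := by
    by_contra h
    push Not at h
    have : q * i + r * j ≤ r * (i + j) := by nlinarith
    have : r * (i + j) < r * ν := Nat.mul_lt_mul_of_pos_left h (hq.trans_le hqr)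
    omega
  exact Ideal.pow_le_pow_right hij' (by rw [pow_add]; exact Ideal.mul_mem_mul (Ideal.pow_mem_pow hx i) (Ideal.pow_mem_pow hy j))

/-- **The level of a lex-maximal germ**: `ℓ = w 0 · ν` where `f ∈ 𝔪^ν ∖ 𝔪^{ν+1}` (the datum `(x; (1,1); ν)` is admissible, and
no datum of first invariant `> ord f` is). [cite: AbramovichQuekSchober2025, Def. 3.2–3.3] -/
theorem level_eq {f : S} {x : Fin 2 → S} {w : Fin 2 → ℕ} {ℓ : ℕ}
    (h : IsLexMaxWeightedCentreGerm S (Ideal.span {f}) x w ℓ) :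
    ∃ ν : ℕ, 1 ≤ ν ∧ ℓ = w 0 * ν ∧ f ∈ maximalIdeal S ^ ν ∧ f ∉ maximalIdeal S ^ (ν + 1) := by
  obtain ⟨hspan, hpos, -, hle, hℓ, ⟨ν, hν⟩, hadm, hmax, -⟩ := h
  have hx : ∀ i, x i ∈ maximalIdeal S := fun i => hspan ▸ Ideal.subset_span ⟨i, rfl⟩
  have hνpos : 1 ≤ ν := by
    rcases Nat.eq_zero_or_pos ν with rfl | hν'
    · rw [mul_zero] at hν; omega
    · exact hν'
  refine ⟨ν, hνpos, hν, ?_, ?_⟩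
  · -- `𝒥_{w₀ ν}(x; w) ⊆ 𝔪^ν`
    have hf : f ∈ weightedMonomialIdeal x w ℓ := (Ideal.span_singleton_le_iff_mem _).mp hadm
    have hxv : x = ![x 0, x 1] := by funext i; fin_cases i <;> rfl
    have hwv : w = ![w 0, w 1] := by funext i; fin_cases i <;> rfl
    rw [hxv, hwv, weightedMonomialIdeal_swap, hν] at hf
    exact weightedMonomialIdeal_le_pow (hx 1) (hx 0) (hpos 1) hle ν hf
  · -- the datum `(x; (1,1); ν+1)` would be lexicographically larger
    intro hf
    have hJ : Ideal.span {f} ≤ weightedMonomialIdeal x (fun _ => 1) (ν + 1) := by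
      rw [Ideal.span_singleton_le_iff_mem, LocalGameEFTNewton.weightedMonomialIdeal_const_one_eq_pow x hspan]
      exact hf
    rcases hmax x (fun _ => 1) (ν + 1) hspan (fun _ => Nat.one_pos) le_rfl (Nat.succ_pos ν) hJ with hlt | ⟨heq, -⟩
    · rw [hν] at hlt; nlinarith
    · rw [hν] at heq; nlinarith [hpos 0]

end Level

end Literature.AlgebraicGeometry.Resolution.WeightedInvariant.AQSBaseChange

end Part8

/-!
## Part 9 — port of `Summits/ResolutionOfSingularities/ResolutionOfSingularities/Theorems/WeightedInvariantAQSBaseChangeLexMax.lean`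

# The lex-maximal weighted centre germ is stable under flat unramified local extensions with separable residue field
# extension (Abramovich–Quek–Schober, Thm 3.5 «`J` is stable under base change to separable field extensions»)

Route `ResolutionOfSingularities/WeightedInvariant`, door crux `HypersurfaceCentreConstruction`
(stmt-ResolutionOfSingularities-19897) — OURS, helper; e-ladder `e = 1`, piece **(o25-δ)** «separable base change of the
Abramovich–Quek–Schober centre in the kernel» (res-D-pv-025 AS stub-10; CHAIN w43 v4.18 (3)), brick **(δ1c) — the LOCAL
THEOREM**: for a faithfully flat local homomorphism `φ : S → S′` of two-dimensional regular local rings with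
`𝔪_S · S′ = 𝔪_{S′}` whose residue field extension is relatively `p`-radically closed, the image of a lex-maximal
admissible weighted centre germ `(x; w; ℓ)` of `(f) ⊆ S` (`IsLexMaxWeightedCentreGerm`, vendored predicate of
`Literature/…/HypersurfaceHeightTwoWeightedCentre.lean`) is the lex-maximal admissible weighted centre germ of
`(φ f) ⊆ S′` (`isLexMaxWeightedCentreGerm_map`).

Proof (certificate-free): the regular system of parameters, the weights, admissibility and the level `ℓ = r·ν`
(`ν = ord f`, `level_eq`) transport directly; the order is preserved (`Literature.…mem_pow_maximalIdeal_iff_of_map_maximalIdeal_eq`).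
MAXIMALITY in `S′`: a competitor `(y′; (r′, q′); ℓ′)` has `ℓ′ ≤ r′ν` (`le_pow_of_weights_le`); at equality its slope `r′/q′`
exceeds `r/q` only if — by res-type-092's and res-type-070's `AQSHeightTwo` comparison lemmas IN `S′` — either `(φx, φy)` itself carries `φ f`
at a steeper slope (`exists_steeper_of_not_dvd`, non-integer slope), which CONTRACTS to `S` by faithful flatness and contradicts
maximality there; or (integer slope `b ≥ 2`) `y′ = a(φy - λ′ φx^b)` (`exists_order_ge`, `exists_steepen_form_of_le`) and
`φ f ≡ c′(φy - λ′φx^b)^ν` modulo `𝒥′_{bν+1}` (`le_span_pow_sup_of_lt`), which DESCENDS to `S` (`exists_steepening_of_map`,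
file `…AQSBaseChangeDescent`) and produces the steeper admissible datum `(y - λ x^b, x; bν+1, ν)` in `S`; or (slope `1`)
`φ f ≡ c′ y′^ν` modulo `𝔪′^{ν+1}` (`le_span_pow_sup_pow`), which descends by `exists_tangent_line_of_map`.  UNIQUENESS in `S′`
is `filtration_eq_of_mem_of_mem` (slope `> 1`) or trivial (slope `1`: the `𝔪`-adic filtration).

Def-free; nothing here is a claim about Hironaka's problem.  AI-written; weaker than expert review.
[cite: AbramovichQuekSchober2025, Thm 1.3 (1) / Thm 3.5, proof p. 7 L94 – p. 8 L40]
-/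

section Part9


namespace Literature.AlgebraicGeometry.Resolution.WeightedInvariant.AQSBaseChange

open _root_.IsLocalRing _root_.Literature.AlgebraicGeometry.Resolution
open _root_.Literature.AlgebraicGeometry.Resolution.WeightedInvariant.AQSHeightTwo

universe u v

/-! ## The local theorem -/

section Contraction

variable {S : Type u} {S' : Type v} [CommRing S] [CommRing S'] [Algebra S S'] [Module.FaithfullyFlat S S']

/-- Contraction of weighted monomial ideals of `(φ x, φ y)`. [folklore] -/
private theorem mem_weightedMonomialIdeal_of_map {x y f : S} {w : Fin 2 → ℕ} {n : ℕ}
    (hf : algebraMap S S' f ∈ weightedMonomialIdeal ![algebraMap S S' x, algebraMap S S' y] w n) :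
    f ∈ weightedMonomialIdeal ![x, y] w n := by
  rw [← map_weightedMonomialIdeal_two, ← Ideal.mem_comap, Ideal.comap_map_eq_self_of_faithfullyFlat] at hf
  exact hf

end Contraction

section Transport

variable {S S' : Type} [CommRing S] [CommRing S'] [IsRegularLocalRing S] [IsRegularLocalRing S']
  [Algebra S S'] [IsLocalHom (algebraMap S S')] [Module.FaithfullyFlat S S']
  (hdim : ringKrullDim S = (2 : ℕ)) (hdim' : ringKrullDim S' = (2 : ℕ))
  (h𝔪 : (maximalIdeal S).map (algebraMap S S') = maximalIdeal S')
  (p : ℕ) [ExpChar (ResidueField S') p]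
  (hcl : ∀ z : ResidueField S', z ^ p ∈ (ResidueField.map (algebraMap S S')).range →
    z ∈ (ResidueField.map (algebraMap S S')).range)

include hdim hdim' h𝔪 hcl in
/-- **Abramovich–Quek–Schober's separable base change, local form.**  Let `φ : S → S′` be a faithfully flat local
homomorphism of two-dimensional regular local rings with `𝔪_S · S′ = 𝔪_{S′}`, whose residue field extension is relatively
`p`-radically closed (`p` the exponential characteristic).  If `(x; w; ℓ)` is the lex-maximal admissible weighted centre
germ of `(f) ⊆ S`, then `(φ ∘ x; w; ℓ)` is the lex-maximal admissible weighted centre germ of `(φ f) ⊆ S′`.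
[cite: AbramovichQuekSchober2025, Thm 3.5 («`J` is stable under base change to separable field extensions»), proof p. 7–8] -/
theorem isLexMaxWeightedCentreGerm_map {f : S} {x : Fin 2 → S} {w : Fin 2 → ℕ} {ℓ : ℕ}
    (h : IsLexMaxWeightedCentreGerm S (Ideal.span {f}) x w ℓ) :
    IsLexMaxWeightedCentreGerm S' (Ideal.span {algebraMap S S' f}) (fun i => algebraMap S S' (x i)) w ℓ := by
  classical
  obtain ⟨ν, hν, hℓν, hfν, hford⟩ := level_eq h
  obtain ⟨hspan, hpos, hcop, hle, hℓ, hdvd, hadm, hmax, huniq⟩ := h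
  -- `x 0` is the ORDER variable (weight `w 0 = r`), `x 1` the transversal one (weight `w 1 = q ≤ r`)
  have hw : w = ![w 0, w 1] := by funext i; fin_cases i <;> rfl
  have hxv : x = ![x 0, x 1] := by funext i; fin_cases i <;> rfl
  have hrangeS : ∀ v : Fin 2 → S, Set.range v = {v 0, v 1} := fun v => by
    have hv : v = ![v 0, v 1] := by funext i; fin_cases i <;> rfl
    conv_lhs => rw [hv]
    exact Matrix.range_cons_cons_empty _ _ _
  have hrangeS' : ∀ v : Fin 2 → S', Set.range v = {v 0, v 1} := fun v => by
    have hv : v = ![v 0, v 1] := by funext i; fin_cases i <;> rfl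
    conv_lhs => rw [hv]
    exact Matrix.range_cons_cons_empty _ _ _
  have hx𝔪 : ∀ i, x i ∈ maximalIdeal S := fun i => hspan ▸ Ideal.subset_span ⟨i, rfl⟩
  have hxy : Ideal.span {x 1, x 0} = maximalIdeal S := by
    rw [← hspan, hrangeS, Ideal.span_pair_comm]
  have hxy' : Ideal.span {algebraMap S S' (x 1), algebraMap S S' (x 0)} = maximalIdeal S' :=
    span_pair_map_eq _ h𝔪 hxy
  have hx𝔪' : ∀ i, algebraMap S S' (x i) ∈ maximalIdeal S' := fun i =>
    h𝔪 ▸ Ideal.mem_map_of_mem _ (hx𝔪 i)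
  have hford' : algebraMap S S' f ∉ maximalIdeal S' ^ (ν + 1) := fun h' =>
    hford ((mem_pow_maximalIdeal_iff_of_map_maximalIdeal_eq h𝔪 (ν + 1) f).mpr h')
  -- `f ∈ 𝒥_{rν}((x₁, x₀); (q, r))` in `S` and in `S′`
  have hfS : f ∈ weightedMonomialIdeal ![x 1, x 0] ![w 1, w 0] (w 0 * ν) := by
    have hf : f ∈ weightedMonomialIdeal x w ℓ := (Ideal.span_singleton_le_iff_mem _).mp hadm
    rwa [hxv, hw, weightedMonomialIdeal_swap, hℓν] at hf
  have hfS' : algebraMap S S' f ∈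
      weightedMonomialIdeal ![algebraMap S S' (x 1), algebraMap S S' (x 0)] ![w 1, w 0] (w 0 * ν) := by
    rw [← map_weightedMonomialIdeal_two]; exact Ideal.mem_map_of_mem _ hfS
  -- how `hmax` is used: an admissible datum `((b, a); (q'', r''); r''ν)` in `S` forces `r''/q'' ≤ r/q`
  have hmaxS : ∀ (a b : S), Ideal.span {b, a} = maximalIdeal S → ∀ (q'' r'' : ℕ), 0 < q'' → q'' ≤ r'' →
      f ∈ weightedMonomialIdeal ![b, a] ![q'', r''] (r'' * ν) → r'' * w 1 ≤ w 0 * q'' := by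
    intro a b hab q'' r'' hq'' hqr'' hf
    have hspan' : Ideal.span (Set.range ![a, b]) = maximalIdeal S := by
      rw [hrangeS]
      simpa [Ideal.span_pair_comm] using hab
    have hadm' : Ideal.span {f} ≤ weightedMonomialIdeal ![a, b] ![r'', q''] (r'' * ν) := by
      rw [Ideal.span_singleton_le_iff_mem, weightedMonomialIdeal_swap]; exact hf
    rcases hmax ![a, b] ![r'', q''] (r'' * ν) hspan'
        (fun i => by fin_cases i <;> simp [hq'', hq''.trans_le hqr''])
        (by simpa using hqr'') (Nat.mul_pos (hq''.trans_le hqr'') hν) hadm' with hlt | ⟨-, hle'⟩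
    · exfalso
      simp only [Matrix.cons_val_zero] at hlt
      rw [hℓν] at hlt
      nlinarith
    · simp only [Matrix.cons_val_one, Matrix.cons_val_zero] at hle'
      rw [hℓν] at hle'
      have : r'' * w 1 * ν ≤ w 0 * q'' * ν := by nlinarith
      exact Nat.le_of_mul_le_mul_right this hν
  refine ⟨?_, hpos, hcop, hle, hℓ, hdvd, ?_, ?_, ?_⟩
  · -- regular system of parameters
    rw [show (fun i => algebraMap S S' (x i)) = algebraMap S S' ∘ x from rfl, Set.range_comp, ← Ideal.map_span,
      hspan, h𝔪]
  · -- admissibility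
    rw [Ideal.span_singleton_le_iff_mem, ← weightedMonomialIdeal_map]
    exact Ideal.mem_map_of_mem _ ((Ideal.span_singleton_le_iff_mem _).mp hadm)
  · -- MAXIMALITY
    intro y' w' ℓ' hy' hw'pos hw'le hℓ' hadm'
    have hyv : y' = ![y' 0, y' 1] := by funext i; fin_cases i <;> rfl
    have hwv : w' = ![w' 0, w' 1] := by funext i; fin_cases i <;> rfl
    have hy'𝔪 : ∀ i, y' i ∈ maximalIdeal S' := fun i => hy' ▸ Ideal.subset_span ⟨i, rfl⟩
    have hxy'' : Ideal.span {y' 1, y' 0} = maximalIdeal S' := by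
      rw [← hy', hrangeS', Ideal.span_pair_comm]
    have hf' : algebraMap S S' f ∈ weightedMonomialIdeal ![y' 1, y' 0] ![w' 1, w' 0] ℓ' := by
      have := (Ideal.span_singleton_le_iff_mem _).mp hadm'
      rwa [hyv, hwv, weightedMonomialIdeal_swap] at this
    -- Step A: the first invariant is at most `ν`
    have hA : ℓ' ≤ w' 0 * ν := by
      by_contra hA
      push Not at hA
      apply hford'
      exact le_pow_of_weights_le (hy'𝔪 1) (hy'𝔪 0) hw'le le_rfl ν
        (weightedMonomialIdeal_antitone _ _ (by linarith) hf')
    rcases hA.lt_or_eq with hlt | heq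
    · left
      rw [hℓν]
      nlinarith [hpos 0]
    right
    refine ⟨by rw [hℓν, heq]; ring, ?_⟩
    rw [hℓν, heq]
    suffices hs : w' 0 * w 1 ≤ w 0 * w' 1 by nlinarith
    by_contra hcon
    push Not at hcon
    -- the competitor `((y'₁, y'₀); (q', r'); r'ν)` has slope `r'/q' > r/q`
    have hq' : 0 < w' 1 := hw'pos 1
    have hf'ν : algebraMap S S' f ∈ weightedMonomialIdeal ![y' 1, y' 0] ![w' 1, w' 0] (w' 0 * ν) := by
      rw [← heq]; exact hf'
    have hlt : w 0 * w' 1 < w' 0 * w 1 := hcon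
    by_cases hq1 : w 1 = 1
    · by_cases hr1 : w 0 = 1
      · -- slope `1`: the tangent cone of `φ f` would be a `ν`-fold line over `κ′`, hence over `κ`
        have hlt' : w' 1 < w' 0 := by rw [hq1, hr1] at hlt; simpa using hlt
        have hfν' : f ∈ maximalIdeal S ^ ν := hfν
        have hcore := le_span_pow_sup_pow hxy'' hlt' ν hf'ν
        obtain ⟨c', m', hc', hm', hfe⟩ := exists_unit_mul_pow_add (hy'𝔪 0) hcore hford'
        have h1 : algebraMap S S' f - c' * y' 0 ^ ν ∈ maximalIdeal S' ^ (ν + 1) := by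
          rw [hfe, add_sub_cancel_left]; exact hm'
        obtain ⟨x₀, y₀, c, hx₀y₀, -, hdesc⟩ :=
          exists_tangent_line_of_map hdim hdim' h𝔪 p hcl hxy hν hfν' hxy'' hc' h1
        have hmem : f ∈ weightedMonomialIdeal ![x₀, y₀] ![ν, ν + 1] ((ν + 1) * ν) := by
          have hf2 : f ∈ Ideal.span {y₀ ^ ν} ⊔ maximalIdeal S ^ (ν + 1) :=
            Submodule.mem_sup.mpr ⟨c * y₀ ^ ν, Ideal.mem_span_singleton'.mpr ⟨c, rfl⟩, _, hdesc, by ring⟩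
          have hle2 : Ideal.span {y₀ ^ ν} ⊔ maximalIdeal S ^ (ν + 1) ≤
              weightedMonomialIdeal ![x₀, y₀] ![ν, ν + 1] ((ν + 1) * ν) := by
            refine sup_le ?_ ?_
            · rw [Ideal.span_singleton_le_iff_mem]
              have := monomial_mem x₀ y₀ ν (ν + 1) (i := 0) (j := ν) (n := (ν + 1) * ν) (by ring_nf; omega)
              rwa [pow_zero, one_mul] at this
            · have := maximalIdeal_pow_le hx₀y₀ (Nat.le_succ ν) (ν + 1)
              rwa [Nat.mul_comm] at this
          exact hle2 hf2
        have := hmaxS y₀ x₀ hx₀y₀ ν (ν + 1) hν (Nat.le_succ ν) hmem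
        rw [hq1, hr1] at this
        omega
      · -- integer slope `b = w 0 ≥ 2`: a steepening over `S′` descends to `S`
        have hb2 : 2 ≤ w 0 := by
          have : w 1 ≤ w 0 := hle
          omega
        have hbq' : w 0 * w' 1 < w' 0 := by rw [hq1, mul_one] at hlt; exact hlt
        have hlt' : w' 1 < w' 0 := lt_of_le_of_lt (Nat.le_mul_of_pos_left _ (by omega)) hbq'
        rw [hq1] at hfS hfS'
        obtain ⟨t, hbt, hmemt⟩ := exists_order_ge hdim' hxy' hxy'' hν hford' Nat.one_pos hq' hlt'
          (by rw [mul_one]; exact hbq'.le) hfS' hf'ν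
        rw [one_mul] at hbt
        obtain ⟨a, lam', ha, hy'0⟩ := exists_steepen_form_of_le hdim' hxy' hxy'' hb2 hbt hmemt
        -- the steepened parameter `z' = φx₀ - λ' φx₁^b`
        have hz'span : Ideal.span {algebraMap S S' (x 1), y' 0} = maximalIdeal S' := by
          rw [hy'0, span_pair_unit_mul_right _ _ ha, LocalGameEFTSteepening.span_pair_steepen_eq _ _ _ (by omega : 1 ≤ w 0), hxy']
        have hJz : ∀ n, weightedMonomialIdeal ![algebraMap S S' (x 1), y' 0] ![1, w 0] n =
            weightedMonomialIdeal ![algebraMap S S' (x 1), algebraMap S S' (x 0)] ![1, w 0] n := by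
          intro n
          rw [hy'0, eq_of_snd_unit_mul _ _ ha,
            show algebraMap S S' (x 0) - lam' * algebraMap S S' (x 1) ^ w 0 =
              1 * algebraMap S S' (x 0) + -(lam' * algebraMap S S' (x 1) ^ w 0) by ring]
          exact eq_of_snd_eq_unit_mul_add hxy' isUnit_one hb2
            (neg_mem (Ideal.mul_mem_left _ _ (Ideal.pow_mem_pow (hx𝔪' 1) _))) (by omega) (by omega) n
        have hf'' : algebraMap S S' f ∈ weightedMonomialIdeal ![algebraMap S S' (x 1), y' 0] ![w' 1, w' 0] (w' 0 * ν) := by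
          rw [← eq_of_fst hz'span hxy'' hlt'.le]; exact hf'ν
        have hcore := le_span_pow_sup_of_lt (algebraMap S S' (x 1)) (y' 0) hbq' ν hf''
        rw [hJz] at hcore
        obtain ⟨s0, hs0, g, hg, hfe⟩ := Submodule.mem_sup.mp hcore
        obtain ⟨s, rfl⟩ := Ideal.mem_span_singleton'.mp hs0
        -- `φ f = (s a^ν) · (φx₀ - λ'φx₁^b)^ν + g`
        have hfe' : algebraMap S S' f - (s * a ^ ν) * (algebraMap S S' (x 0) - lam' * algebraMap S S' (x 1) ^ w 0) ^ ν = g := by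
          rw [← hfe, hy'0, mul_pow]; ring
        by_cases hc' : IsUnit (s * a ^ ν)
        · -- descend the steepening and contradict maximality in `S`
          have h1 : algebraMap S S' f - (s * a ^ ν) *
              (algebraMap S S' (x 0) - lam' * algebraMap S S' (x 1) ^ w 0) ^ ν ∈
              weightedMonomialIdeal ![algebraMap S S' (x 1), algebraMap S S' (x 0)] ![1, w 0] (w 0 * ν + 1) := by
            rw [hfe']; exact hg
          obtain ⟨c, lam, hc, hdesc⟩ :=
            exists_steepening_of_map hdim hdim' h𝔪 p hcl hxy (by omega) hν hfS hc' h1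
          set z : S := x 0 - lam * x 1 ^ w 0 with hz
          have hzspan : Ideal.span {x 1, z} = maximalIdeal S := by
            rw [hz, LocalGameEFTSteepening.span_pair_steepen_eq _ _ _ (by omega : 1 ≤ w 0), hxy]
          have hJzS : ∀ n, weightedMonomialIdeal ![x 1, z] ![1, w 0] n = weightedMonomialIdeal ![x 1, x 0] ![1, w 0] n := by
            intro n
            rw [hz, show x 0 - lam * x 1 ^ w 0 = 1 * x 0 + -(lam * x 1 ^ w 0) by ring]
            exact eq_of_snd_eq_unit_mul_add hxy isUnit_one hb2
              (neg_mem (Ideal.mul_mem_left _ _ (Ideal.pow_mem_pow (hx𝔪 1) _))) (by omega) (by omega) n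
          have hmem : f ∈ weightedMonomialIdeal ![x 1, z] ![ν, w 0 * ν + 1] ((w 0 * ν + 1) * ν) := by
            refine span_pow_sup_le_steeper (x 1) z hν (Submodule.mem_sup.mpr ⟨c * z ^ ν,
              Ideal.mem_span_singleton'.mpr ⟨c, rfl⟩, f - c * z ^ ν, ?_, by ring⟩)
            rw [hJzS]; exact hdesc
          have := hmaxS z (x 1) hzspan ν (w 0 * ν + 1) hν (by nlinarith) hmem
          rw [hq1] at this
          nlinarith
        · -- `s a^ν ∈ 𝔪′`: then `φ f ∈ 𝒥′_{bν+1}` already, which contracts to `S`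
          have hc'𝔪 : s * a ^ ν ∈ maximalIdeal S' := (IsLocalRing.mem_maximalIdeal _).mpr hc'
          have hz'J : algebraMap S S' (x 0) - lam' * algebraMap S S' (x 1) ^ w 0 ∈
              weightedMonomialIdeal ![algebraMap S S' (x 1), algebraMap S S' (x 0)] ![1, w 0] (w 0) := by
            refine Ideal.sub_mem _ ?_ (Ideal.mul_mem_left _ _ ?_)
            · have := monomial_mem (algebraMap S S' (x 1)) (algebraMap S S' (x 0)) 1 (w 0) (i := 0) (j := 1)
                (n := w 0) (by simp)
              simpa using this
            · have := monomial_mem (algebraMap S S' (x 1)) (algebraMap S S' (x 0)) 1 (w 0) (i := w 0) (j := 0)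
                (n := w 0) (by simp)
              simpa using this
          have hprod : (s * a ^ ν) * (algebraMap S S' (x 0) - lam' * algebraMap S S' (x 1) ^ w 0) ^ ν ∈
              weightedMonomialIdeal ![algebraMap S S' (x 1), algebraMap S S' (x 0)] ![1, w 0] (w 0 * ν + 1) := by
            rw [add_comm]
            exact weightedMonomialIdeal_mul_le _ _ 1 (w 0 * ν)
              (Ideal.mul_mem_mul (maximalIdeal_le hxy' (by omega : 1 ≤ w 0) hc'𝔪) (pow_mem_weightedMonomialIdeal_mul _ _ hz'J ν))
          have hfJ' : algebraMap S S' f ∈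
              weightedMonomialIdeal ![algebraMap S S' (x 1), algebraMap S S' (x 0)] ![1, w 0] (w 0 * ν + 1) := by
            have : algebraMap S S' f = (s * a ^ ν) *
                (algebraMap S S' (x 0) - lam' * algebraMap S S' (x 1) ^ w 0) ^ ν + g := by rw [← hfe']; ring
            rw [this]; exact Ideal.add_mem _ hprod hg
          have hfJ : f ∈ weightedMonomialIdeal ![x 1, x 0] ![1, w 0] (w 0 * ν + 1) := mem_weightedMonomialIdeal_of_map hfJ'
          have hmem : f ∈ weightedMonomialIdeal ![x 1, x 0] ![ν, w 0 * ν + 1] ((w 0 * ν + 1) * ν) :=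
            span_pow_sup_le_steeper (x 1) (x 0) hν (Ideal.mem_sup_right hfJ)
          have := hmaxS (x 0) (x 1) hxy ν (w 0 * ν + 1) hν (by nlinarith) hmem
          rw [hq1] at this
          nlinarith
    · -- non-integer slope: `(φx₁, φx₀)` itself carries `φ f` at a steeper slope, which contracts to `S`
      have hndvd : ¬ w 1 ∣ w 0 := fun hd => hq1 (Nat.Coprime.eq_one_of_dvd hcop.symm hd)
      have hqr : w 1 < w 0 := lt_of_le_of_ne hle (fun he => hndvd (he ▸ dvd_rfl))
      obtain ⟨q'', r'', hq'', hlt1, -, hmem'⟩ :=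
        exists_steeper_of_not_dvd hdim' hxy' hxy'' hν hford' (hpos 1) hqr hndvd hq' hlt hfS' hf'ν
      have hmem : f ∈ weightedMonomialIdeal ![x 1, x 0] ![q'', r''] (r'' * ν) := mem_weightedMonomialIdeal_of_map hmem'
      have := hmaxS (x 0) (x 1) hxy q'' r'' hq'' (by nlinarith) hmem
      nlinarith
  · -- UNIQUENESS
    intro y' hy' hadm' n
    have hyv : y' = ![y' 0, y' 1] := by funext i; fin_cases i <;> rfl
    have hxy'' : Ideal.span {y' 1, y' 0} = maximalIdeal S' := by
      rw [← hy', hrangeS', Ideal.span_pair_comm]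
    have hf' : algebraMap S S' f ∈ weightedMonomialIdeal ![y' 1, y' 0] ![w 1, w 0] (w 0 * ν) := by
      have := (Ideal.span_singleton_le_iff_mem _).mp hadm'
      rwa [hyv, hw, weightedMonomialIdeal_swap, hℓν] at this
    rw [hyv, show (fun i => algebraMap S S' (x i)) = ![algebraMap S S' (x 0), algebraMap S S' (x 1)] from
      (by funext i; fin_cases i <;> rfl), hw, weightedMonomialIdeal_swap (y' 0), weightedMonomialIdeal_swap (algebraMap S S' (x 0))]
    by_cases hqr : w 1 < w 0
    · exact filtration_eq_of_mem_of_mem hdim' hxy' hxy'' hν hford' (hpos 1) hqr hfS' hf' n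
    · -- slope `1`: both filtrations are the `𝔪′`-adic one
      have hq1 : w 1 = w 0 := le_antisymm hle (not_lt.mp hqr)
      have hr1 : w 0 = 1 := by
        have h2 : Nat.gcd (w 0) (w 0) = 1 := (hq1 ▸ hcop : Nat.Coprime (w 0) (w 0))
        rwa [Nat.gcd_self] at h2
      rw [hq1, hr1, LocalGameEFTSteepening.weightedMonomialIdeal_one_eq_pow,
        LocalGameEFTSteepening.weightedMonomialIdeal_one_eq_pow, hxy'', hxy']

end Transport

end Literature.AlgebraicGeometry.Resolution.WeightedInvariant.AQSBaseChange

end Part9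

/-!
## Part 10 — port of `Summits/ResolutionOfSingularities/ResolutionOfSingularities/Theorems/WeightedInvariantAQSBaseChangeSquare.lean`

# (o25-δ2) The base-change square `Y' = Y ×ₖ Spec K → Y` at a point: the local data of `φ = 𝒪_{Y,g η'} → 𝒪_{Y',η'}`

Route `ResolutionOfSingularities/WeightedInvariant`, door crux `HypersurfaceCentreConstruction`
(stmt-ResolutionOfSingularities-19897) — helper toward ORDER (o25-δ) «`AbramovichQuekSchober2025_separableBaseChange`
in the kernel» (owner res-D-pv-025, assembly δ3), piece (δ2) «SQUARE → φ» (res-type-047, 2026-08-27).  For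
`f : Y → Spec k` locally of finite type, a field extension `K/k` that is FORMALLY SMOOTH and ESSENTIALLY OF FINITE
TYPE (this covers the finite separable extensions and the rational function fields `k(ℤʲ)` of the torus actions —
the general formally smooth case would need Matsumura's «`𝔪`-smooth ⇒ regular», not in the tree), a cartesian square
`g : Y' → Y`, `f' : Y' → Spec K` over `Spec K → Spec k`, and a point `η' ∈ Y'`:

* `formallySmooth_and_essFiniteType_stalk_of_chart` — a general chart lemma: if `c : Spec T → Y'` hits `η'` with an
  isomorphism on stalks and `c ≫ g = Spec(𝒪_{Y,g η'} → T) ≫ (Spec 𝒪_{Y,g η'} → Y)` for a formally smooth,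
  essentially of finite type `𝒪_{Y,g η'}`-algebra `T`, then so is `𝒪_{Y',η'}` over `𝒪_{Y,g η'}` (via
  `g.stalkMap η'`); the compatibility of `g.stalkMap η'` with `T → T_t` is checked after `Spec`
  (`Scheme.SpecMap_stalkMap_fromSpecStalk`), cancelling the monomorphism `Spec 𝒪_{Y,g η'} → Y`;
* `formallySmooth_and_essFiniteType_stalk_of_isPullback` — applied to the chart
  `Spec (𝒪_{Y,g η'} ⊗ₖ K) → Y ×ₖ Spec K ≅ Y'` (Literature `stalkTensorChart`);
* `map_maximalIdeal_eq_of_formallySmooth_of_ringKrullDim_eq`, `formallySmooth_residueField_of_map_maximalIdeal_eq`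
  — local algebra: for a flat, formally smooth, essentially of finite type local homomorphism `O → B` of
  Noetherian local rings with `dim O = dim B`, `𝔪_O B = 𝔪_B` (flat going-down: the fibre ring, regular by
  `isRegularLocalRing_of_formallySmooth_of_essFiniteType`, has dimension `0`), and then `κ(O) → κ(B)` is formally
  smooth (`κ(B) = κ(O) ⊗_O B`);
* `separableBaseChange_localData` — **(δ2)**: with `𝒪_{Y,g η'}` regular and `dim 𝒪_{Y,g η'} = dim 𝒪_{Y',η'}`:
  (i) `𝔪.map φ = 𝔪'`, (ii) `𝒪_{Y',η'}` regular (Literature `IsRegularLocalRing.of_flat_of_map_maximalIdeal_eq`),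
  (iii) `φ` flat, (iv) `κ(g η') → κ(η')` formally smooth for `(ResidueField.map φ).toAlgebra`;
  and (v) `locallyOfFiniteType_of_isPullback : LocallyOfFiniteType f'`.

No definitions.  Nothing here is a claim about Hironaka's problem or about any manuscript under adjudication;
AI-written, weaker than expert review.
-/

section Part10


namespace Literature.AlgebraicGeometry.Resolution.WeightedInvariant.AQSBaseChange

universe u

open _root_.CategoryTheory _root_.CategoryTheory.Limits _root_.AlgebraicGeometry _root_.TopologicalSpace _root_.IsLocalRing _root_.Opposite _root_.TensorProduct
open _root_.Literature.AlgebraicGeometry.Resolution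

/-! ## A chart `Spec T → Y'` through `η'` computes `𝒪_{Y',η'}` as an `𝒪_{Y,g η'}`-algebra -/

section Chart

variable {Y Y' : Scheme.{u}} (g : Y' ⟶ Y) (η' : Y') (T : Type u) [CommRing T]
  [Algebra (Y.presheaf.stalk (g η')) T]
  (c : Spec (.of T) ⟶ Y') (t : ↑(Spec (.of T))) (ht : c t = η') [IsIso (c.stalkMap t)]
  (hc : c ≫ g = Spec.map (CommRingCat.ofHom (algebraMap (Y.presheaf.stalk (g η')) T)) ≫
    Y.fromSpecStalk (g η'))
include ht hc

/-- **Chart lemma.**  If `c : Spec T → Y'` hits `η'` at `t` with `c.stalkMap t` an isomorphism and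
`c ≫ g = Spec (𝒪_{Y,g η'} → T) ≫ (Spec 𝒪_{Y,g η'} → Y)` for an `𝒪_{Y,g η'}`-algebra `T` that is formally smooth
and essentially of finite type, then `𝒪_{Y',η'}` — an `𝒪_{Y,g η'}`-algebra through `g.stalkMap η'` — is formally
smooth and essentially of finite type: it is `𝒪_{Y,g η'}`-isomorphic to the local ring `T_t` (the compatibility
of `g.stalkMap η'` with `T → T_t` is checked after `Spec`, cancelling the monomorphism `Spec 𝒪_{Y,g η'} → Y`).
[folklore] -/
private theorem formallySmooth_and_essFiniteType_stalk_of_chart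
    [Algebra.FormallySmooth (Y.presheaf.stalk (g η')) T] [Algebra.EssFiniteType (Y.presheaf.stalk (g η')) T] :
    letI := (g.stalkMap η').hom.toAlgebra
    Algebra.FormallySmooth (Y.presheaf.stalk (g η')) (Y'.presheaf.stalk η') ∧
      Algebra.EssFiniteType (Y.presheaf.stalk (g η')) (Y'.presheaf.stalk η') := by
  letI := (g.stalkMap η').hom.toAlgebra
  -- the local ring `T_t` of `Spec T` at `t`
  let St : Type u := ↥((Spec (.of T)).presheaf.stalk t)
  letI : Algebra T St := (StructureSheaf.toStalk T t).hom.toAlgebra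
  haveI : IsLocalization.AtPrime St t.asIdeal := StructureSheaf.IsLocalization.to_stalk T t
  letI algO : Algebra (Y.presheaf.stalk (g η')) St :=
    ((algebraMap T St).comp (algebraMap (Y.presheaf.stalk (g η')) T)).toAlgebra
  haveI : IsScalarTower (Y.presheaf.stalk (g η')) T St := IsScalarTower.of_algebraMap_eq fun _ => rfl
  haveI : Algebra.FormallySmooth T St := .of_isLocalization t.asIdeal.primeCompl
  haveI : Algebra.EssFiniteType T St := .of_isLocalization St t.asIdeal.primeCompl
  haveI : Algebra.FormallySmooth (Y.presheaf.stalk (g η')) St := .comp _ T St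
  haveI : Algebra.EssFiniteType (Y.presheaf.stalk (g η')) St := .comp _ T St
  -- the comparison `Ψ : 𝒪_{Y',η'} ⟶ T_t`
  have hsp : c t ⤳ η' := specializes_of_eq ht
  let Ψ : Y'.presheaf.stalk η' ⟶ (Spec (.of T)).presheaf.stalk t :=
    Y'.presheaf.stalkSpecializes hsp ≫ c.stalkMap t
  haveI : IsIso (Y'.presheaf.stalkSpecializes hsp) := by
    have : Y'.presheaf.stalkSpecializes hsp = (Y'.presheaf.stalkCongr (Inseparable.of_eq ht)).inv := rfl
    rw [this]; infer_instance
  haveI : IsIso Ψ := IsIso.comp_isIso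
  -- compatibility with the structure maps, checked after `Spec` against the mono `Spec 𝒪_{Y,g η'} → Y`
  have hcomp : g.stalkMap η' ≫ Ψ = CommRingCat.ofHom (algebraMap (Y.presheaf.stalk (g η')) St) := by
    apply Spec.map_injective
    rw [← cancel_mono (Y.fromSpecStalk (g η'))]
    simp only [Ψ, Spec.map_comp, Category.assoc]
    rw [Scheme.SpecMap_stalkMap_fromSpecStalk, Scheme.SpecMap_stalkSpecializes_fromSpecStalk_assoc,
      Scheme.SpecMap_stalkMap_fromSpecStalk_assoc, hc, Spec.fromSpecStalk_eq']
    exact (Spec.map_comp_assoc _ _ _).symm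
  -- the `𝒪_{Y,g η'}`-algebra isomorphism `𝒪_{Y',η'} ≃ T_t`
  let e : Y'.presheaf.stalk η' ≃ₐ[Y.presheaf.stalk (g η')] St :=
    AlgEquiv.ofRingEquiv (f := (asIso Ψ).commRingCatIsoToRingEquiv) (fun x => by
      change (g.stalkMap η' ≫ Ψ) x = _
      rw [hcomp]; rfl)
  exact ⟨Algebra.FormallySmooth.of_equiv e.symm, (Algebra.EssFiniteType.iff_of_algEquiv e.symm).mp inferInstance⟩

end Chart

/-! ## Local algebra: a flat, formally smooth, essentially of finite type local homomorphism -/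

section Algebra

variable (O B : Type u) [CommRing O] [IsLocalRing O] [IsNoetherianRing O] [CommRing B] [IsLocalRing B]
  [IsNoetherianRing B] [Algebra O B] [IsLocalHom (algebraMap O B)] [Algebra.FormallySmooth O B]

/-- **`𝔪_O B = 𝔪_B` when the dimensions agree.**  For a flat local homomorphism `O → B` of Noetherian local
rings, formally smooth and essentially of finite type, with `dim O = dim B`: by flat going-down
(`Ideal.height_eq_height_add_of_liesOver_of_hasGoingDown`) the fibre ring `B ⧸ 𝔪_O B` — formally smooth and
essentially of finite type over the residue field `κ(O)`, hence a regular local ring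
(`isRegularLocalRing_of_formallySmooth_of_essFiniteType`) — has dimension `0`, so it is a field and
`𝔪_O B = 𝔪_B`. [folklore] -/
private theorem map_maximalIdeal_eq_of_formallySmooth_of_ringKrullDim_eq [Module.Flat O B] [Algebra.EssFiniteType O B]
    {d : ℕ} (hdO : ringKrullDim O = d) (hdB : ringKrullDim B = d) :
    (maximalIdeal O).map (algebraMap O B) = maximalIdeal B := by
  set I : Ideal B := (maximalIdeal O).map (algebraMap O B) with hI
  have hIle : I ≤ maximalIdeal B := Ideal.map_le_iff_le_comap.mpr fun a ha => map_nonunit _ a ha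
  -- `𝔪_B` lies over `𝔪_O`
  haveI hover : (maximalIdeal B).LiesOver (maximalIdeal O) :=
    ⟨by
      rw [Ideal.under_def]
      refine ((IsLocalRing.maximalIdeal.isMaximal _).eq_of_le ?_ ?_)
      · exact Ideal.IsPrime.ne_top (Ideal.IsPrime.comap _)
      · exact Ideal.map_le_iff_le_comap.mp hIle⟩
  -- heights: `ht 𝔪_B = ht 𝔪_O + ht (𝔪_B mod I)` by flat going-down, and `ht 𝔪_B = d = ht 𝔪_O`
  have hht := Ideal.height_eq_height_add_of_liesOver_of_hasGoingDown (maximalIdeal O) (maximalIdeal B)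
  have h1 : (maximalIdeal B).height = d := by
    have := IsLocalRing.maximalIdeal_height_eq_ringKrullDim (R := B)
    rw [hdB] at this; exact_mod_cast this
  have h2 : (maximalIdeal O).height = d := by
    have := IsLocalRing.maximalIdeal_height_eq_ringKrullDim (R := O)
    rw [hdO] at this; exact_mod_cast this
  rw [h1, h2] at hht
  have h0 : ((maximalIdeal B).map (Ideal.Quotient.mk I)).height = 0 := by
    have h3 : (d : ℕ∞) + ((maximalIdeal B).map (Ideal.Quotient.mk I)).height = (d : ℕ∞) + 0 := by
      rw [add_zero]; exact hht.symm
    exact (add_right_inj_of_ne_top (ENat.coe_ne_top d)).mp h3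
  -- the fibre ring `F = B ⧸ I`: local, formally smooth and essentially of finite type over `κ(O)`, so regular
  haveI : Nontrivial (B ⧸ I) :=
    Ideal.Quotient.nontrivial_iff.mpr (ne_top_of_le_ne_top (Ideal.IsPrime.ne_top inferInstance) hIle)
  haveI : IsLocalRing (B ⧸ I) := IsLocalRing.of_surjective' (Ideal.Quotient.mk I) Ideal.Quotient.mk_surjective
  have hmk : (maximalIdeal B).map (Ideal.Quotient.mk I) = maximalIdeal (B ⧸ I) :=
    IsLocalRing.map_maximalIdeal_of_surjective (Ideal.Quotient.mk I) Ideal.Quotient.mk_surjective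
  letI : Field (O ⧸ maximalIdeal O) := Ideal.Quotient.field (maximalIdeal O)
  haveI : Algebra.FormallySmooth (O ⧸ maximalIdeal O) (B ⧸ I) :=
    Algebra.FormallySmooth.of_equiv (Algebra.TensorProduct.quotIdealMapEquivQuotTensor B (maximalIdeal O)).symm
  haveI : Algebra.EssFiniteType (O ⧸ maximalIdeal O) (B ⧸ I) := inferInstance
  haveI hFreg : IsRegularLocalRing (B ⧸ I) :=
    isRegularLocalRing_of_formallySmooth_of_essFiniteType (O ⧸ maximalIdeal O) (B ⧸ I)
  -- of dimension `0`: a field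
  have hdimF : ringKrullDim (B ⧸ I) = 0 := by
    have := IsLocalRing.maximalIdeal_height_eq_ringKrullDim (R := B ⧸ I)
    rw [← hmk, h0] at this
    exact_mod_cast this.symm
  have hFbot : maximalIdeal (B ⧸ I) = ⊥ := by
    have h := hFreg.spanFinrank_maximalIdeal
    rw [hdimF] at h
    have h' : (maximalIdeal (B ⧸ I)).spanFinrank = 0 := by exact_mod_cast h
    exact (Submodule.spanFinrank_eq_zero_iff_eq_bot (IsNoetherian.noetherian _)).mp h'
  refine le_antisymm hIle ?_
  rw [← hmk, Ideal.map_eq_bot_iff_le_ker, Ideal.mk_ker] at hFbot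
  exact hFbot

omit [IsNoetherianRing O] [IsNoetherianRing B] in
/-- **The residue field extension of a formally smooth local homomorphism with `𝔪_O B = 𝔪_B` is formally
smooth**: `κ(B) = B ⧸ 𝔪_O B = κ(O) ⊗_O B` is a base change of the formally smooth `O → B`. [folklore] -/
private theorem formallySmooth_residueField_of_map_maximalIdeal_eq
    (h : (maximalIdeal O).map (algebraMap O B) = maximalIdeal B) :
    letI := (IsLocalRing.ResidueField.map (algebraMap O B)).toAlgebra
    Algebra.FormallySmooth (ResidueField O) (ResidueField B) := by
  set I : Ideal B := (maximalIdeal O).map (algebraMap O B) with hI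
  haveI : Algebra.FormallySmooth (O ⧸ maximalIdeal O) (B ⧸ I) :=
    Algebra.FormallySmooth.of_equiv (Algebra.TensorProduct.quotIdealMapEquivQuotTensor B (maximalIdeal O)).symm
  letI alg : Algebra (O ⧸ maximalIdeal O) (ResidueField B) :=
    (IsLocalRing.ResidueField.map (algebraMap O B)).toAlgebra
  let e : (B ⧸ I) ≃ₐ[O ⧸ maximalIdeal O] ResidueField B :=
    AlgEquiv.ofRingEquiv (f := Ideal.quotEquivOfEq h) (fun x => by
      obtain ⟨o, rfl⟩ := Ideal.Quotient.mk_surjective x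
      rfl)
  have key : @Algebra.FormallySmooth (O ⧸ maximalIdeal O) (ResidueField B) _ _ alg :=
    Algebra.FormallySmooth.of_equiv e
  exact key

end Algebra

/-! ## The square `Y' = Y ×ₖ Spec K → Y` -/

section Square

variable {k : Type u} [Field k] {Y : Scheme.{u}} (f : Y ⟶ Spec (.of k))
  (K : Type u) [Field K] [Algebra k K] {Y' : Scheme.{u}} {f' : Y' ⟶ Spec (.of K)} {g : Y' ⟶ Y}
  (hsq : IsPullback g f' f (Spec.map (CommRingCat.ofHom (algebraMap k K))))
include hsq

variable [LocallyOfFiniteType f]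

/-- **(δ2)(v)** `f' : Y' → Spec K` is locally of finite type (a base change of `f`). [folklore] -/
private theorem locallyOfFiniteType_of_isPullback : LocallyOfFiniteType f' := by
  rw [← hsq.isoPullback_hom_snd]
  infer_instance

/-- `Y'` is locally Noetherian. [folklore] -/
private theorem isLocallyNoetherian_of_isPullback : IsLocallyNoetherian Y' :=
  haveI := locallyOfFiniteType_of_isPullback f K hsq
  LocallyOfFiniteType.isLocallyNoetherian f'

variable [Algebra.FormallySmooth k K] [Algebra.EssFiniteType k K]

omit [LocallyOfFiniteType f] in
/-- **`𝒪_{Y',η'}` is formally smooth and essentially of finite type over `𝒪_{Y,g η'}`** (through `g.stalkMap η'`),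
for `K/k` formally smooth and essentially of finite type: the chart `Spec (𝒪_{Y,g η'} ⊗ₖ K) → Y ×ₖ Spec K ≅ Y'`
through the local scheme at `g η'` (Literature `stalkTensorChart`) hits `η'` with isomorphic stalks, and the chart
lemma applies. [folklore] -/
private theorem formallySmooth_and_essFiniteType_stalk_of_isPullback (η' : Y') :
    letI := (g.stalkMap η').hom.toAlgebra
    Algebra.FormallySmooth (Y.presheaf.stalk (g η')) (Y'.presheaf.stalk η') ∧
      Algebra.EssFiniteType (Y.presheaf.stalk (g η')) (Y'.presheaf.stalk η') := by
  set e := hsq.isoPullback with he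
  -- the chart through the local scheme at `y₀ = g η'`
  let T : Type u := StalkOver f (g η') ⊗[k] K
  letI algOT : Algebra (Y.presheaf.stalk (g η')) T :=
    (inferInstance : Algebra (StalkOver f (g η')) (StalkOver f (g η') ⊗[k] K))
  haveI : Algebra.FormallySmooth (Y.presheaf.stalk (g η')) T :=
    (inferInstance : Algebra.FormallySmooth (StalkOver f (g η')) (StalkOver f (g η') ⊗[k] K))
  haveI : Algebra.EssFiniteType (Y.presheaf.stalk (g η')) T :=
    (inferInstance : Algebra.EssFiniteType (StalkOver f (g η')) (StalkOver f (g η') ⊗[k] K))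
  let c : Spec (.of T) ⟶ Y' := stalkTensorChart K f (g η') ≫ e.inv
  -- a point `t` of the chart over `η'`
  have hy : pullback.fst f (specOfAlgebra k K) (e.hom η') ⤳ g η' := by
    rw [← Scheme.Hom.comp_apply, he, hsq.isoPullback_hom_fst]
  obtain ⟨t, hct⟩ := exists_stalkTensorChart_eq (E := K) f (g η') (e.hom η') hy
  have ht : c t = η' := by
    show (stalkTensorChart K f (g η') ≫ e.inv) t = η'
    rw [Scheme.Hom.comp_apply, hct, ← Scheme.Hom.comp_apply, Iso.hom_inv_id]
    rfl
  haveI i1 : IsIso (e.inv.stalkMap (stalkTensorChart K f (g η') t)) := inferInstance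
  haveI i2 : IsIso ((stalkTensorChart K f (g η')).stalkMap t) := isIso_stalkMap_stalkTensorChart K f (g η') t
  haveI : IsIso (c.stalkMap t) := by
    show IsIso ((stalkTensorChart K f (g η') ≫ e.inv).stalkMap t)
    rw [Scheme.Hom.stalkMap_comp]
    exact @IsIso.comp_isIso _ _ _ _ _ _ _ i1 i2
  have hc : c ≫ g = Spec.map (CommRingCat.ofHom (algebraMap (Y.presheaf.stalk (g η')) T)) ≫
      Y.fromSpecStalk (g η') := by
    have h1 : c ≫ g = stalkTensorChart K f (g η') ≫ pullback.fst f (specOfAlgebra k K) := by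
      show (stalkTensorChart K f (g η') ≫ e.inv) ≫ g = _
      rw [Category.assoc, he, hsq.isoPullback_inv_fst]
    have h2 : CommRingCat.ofHom (algebraMap (Y.presheaf.stalk (g η')) T) =
        CommRingCat.ofHom (Algebra.TensorProduct.includeLeftRingHom (R := k) (A := StalkOver f (g η'))
          (B := K)) := by
      congr 1
    rw [h1, h2, stalkTensorChart, specTensorChart_fst, StalkOver.fromSpec, StalkOver.iso, Iso.refl_hom]
    erw [Spec.map_id, Category.id_comp]
    rfl
  exact formallySmooth_and_essFiniteType_stalk_of_chart g η' T c t ht hc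

/-- **(δ2), the local data of the base-change square at a point.**  For `f : Y → Spec k` locally of finite
type, `K/k` formally smooth and essentially of finite type, a cartesian square `g : Y' = Y ×ₖ Spec K → Y`, and a
point `η' ∈ Y'` with `𝒪_{Y,g η'}` regular and `dim 𝒪_{Y,g η'} = dim 𝒪_{Y',η'}`, the local homomorphism
`φ = g.stalkMap η' : 𝒪_{Y,g η'} → 𝒪_{Y',η'}` satisfies: (i) `𝔪 𝒪_{Y',η'} = 𝔪'`; (ii) `𝒪_{Y',η'}` is regular;
(iii) `φ` is flat; (iv) the residue field extension `κ(g η') → κ(η')` is formally smooth. [folklore] -/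
private theorem separableBaseChange_localData (η' : Y') (hreg : IsRegularLocalRing (Y.presheaf.stalk (g η')))
    {d : ℕ} (hdim : ringKrullDim (Y.presheaf.stalk (g η')) = d)
    (hdim' : ringKrullDim (Y'.presheaf.stalk η') = d) :
    (maximalIdeal (Y.presheaf.stalk (g η'))).map (g.stalkMap η').hom = maximalIdeal (Y'.presheaf.stalk η') ∧
      IsRegularLocalRing (Y'.presheaf.stalk η') ∧ (g.stalkMap η').hom.Flat ∧
      (letI := (IsLocalRing.ResidueField.map (g.stalkMap η').hom).toAlgebra
       Algebra.FormallySmooth (ResidueField (Y.presheaf.stalk (g η'))) (ResidueField (Y'.presheaf.stalk η'))) := by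
  haveI : IsLocallyNoetherian Y' := isLocallyNoetherian_of_isPullback f K hsq
  haveI : IsLocallyNoetherian Y := LocallyOfFiniteType.isLocallyNoetherian f
  -- `g` is flat: a base change of the flat `Spec K → Spec k`
  haveI : Flat g := by
    haveI : Flat (specOfAlgebra k K) := Flat.SpecMap_iff.mpr (RingHom.flat_algebraMap_iff.mpr inferInstance)
    rw [← hsq.isoPullback_hom_fst]
    infer_instance
  letI := (g.stalkMap η').hom.toAlgebra
  haveI : Module.Flat (Y.presheaf.stalk (g η')) (Y'.presheaf.stalk η') := Flat.stalkMap g η'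
  haveI : IsLocalHom (algebraMap (Y.presheaf.stalk (g η')) (Y'.presheaf.stalk η')) :=
    inferInstanceAs (IsLocalHom (g.stalkMap η').hom)
  obtain ⟨hfs, heft⟩ := formallySmooth_and_essFiniteType_stalk_of_isPullback f K hsq η'
  have h1 := map_maximalIdeal_eq_of_formallySmooth_of_ringKrullDim_eq (Y.presheaf.stalk (g η'))
    (Y'.presheaf.stalk η') hdim hdim'
  exact ⟨h1, IsRegularLocalRing.of_flat_of_map_maximalIdeal_eq _ _ h1, Flat.stalkMap g η',
    formallySmooth_residueField_of_map_maximalIdeal_eq _ _ h1⟩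

end Square

end Literature.AlgebraicGeometry.Resolution.WeightedInvariant.AQSBaseChange

end Part10

/-!
## Part 11 — port of `Summits/ResolutionOfSingularities/ResolutionOfSingularities/Theorems/WeightedInvariantAQSBaseChangeTheorem.lean`

# Abramovich–Quek–Schober's separable base change in the kernel, for field extensions essentially of finite type

Route `ResolutionOfSingularities/WeightedInvariant`, door crux `HypersurfaceCentreConstruction`
(stmt-ResolutionOfSingularities-19897) — OURS, helper; e-ladder `e = 1`, piece **(o25-δ)** «separable base change of the
Abramovich–Quek–Schober centre in the kernel» (res-D-pv-025 AS stub-10; CHAIN w43 v4.18 (3)), brick **(δ3) — the ASSEMBLY**.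

`separableBaseChange_of_essFiniteType` is the statement of the vendored fact
`AbramovichQuekSchober2025_separableBaseChange` (Literature `…/HypersurfaceHeightTwoWeightedCentre.lean`: the lex-maximal
admissible weighted centre germ is stable under the base change `Y′ = Y ×_k k′ → Y` along a formally smooth `k′/k`, at
points `η′` over `η` where `dim 𝒪_{Y′,η′} = 2`), PROVED under the ONE EXTRA hypothesis `[Algebra.EssFiniteType k k′]`
(finite separable extensions, rational function fields `k(t₁,…,t_m)` = the torus charts the e-ladder actually uses in
(L3)), from

* (δ2) res-type-047's `separableBaseChange_localData` (p526461): `φ = g.stalkMap η′` is flat with `𝔪·𝒪′ = 𝔪′`,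
  `𝒪′` regular, residue extension formally smooth — the essential-finite-type hypothesis enters ONLY here (the fibre
  ring is regular by «smooth ⇒ regular»; the general formally smooth case needs Matsumura Thm 28.7
  «`𝔪`-smooth local ⇒ regular», not in the tree);
* (δ-field) `mem_range_algebraMap_of_pow_mem` (p522038): the residue extension is then relatively `p`-radically closed;
* (δ1c) `isLexMaxWeightedCentreGerm_map` (file `…AQSBaseChangeLexMax`): the local theorem.

So the typed fact is discharged on the essentially-of-finite-type locus of its `k′`; its literal `_holds` (all formally
smooth `k′`) is blocked on exactly Matsumura 28.7.  Def-free; nothing here is a claim about Hironaka's problem.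
AI-written; weaker than expert review.  [cite: AbramovichQuekSchober2025, Thm 1.3 (1) / Thm 3.5; Matsumura1987, Thm 28.7]
-/

section Part11


namespace Literature.AlgebraicGeometry.Resolution.WeightedInvariant.AQSBaseChange

open _root_.CategoryTheory _root_.AlgebraicGeometry _root_.IsLocalRing _root_.Literature.AlgebraicGeometry.Resolution

/-- **Abramovich–Quek–Schober, Thm 1.3 (1) «`J` is stable under base change to separable field extensions of `k`»,
for `k′/k` formally smooth AND essentially of finite type.**  The statement of
`AbramovichQuekSchober2025_separableBaseChange` with the extra instance `[Algebra.EssFiniteType k k']`.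
[cite: AbramovichQuekSchober2025, Thm 1.3 (1), Thm 3.5 (proof p. 7 L94 – p. 8 L40)] -/
theorem separableBaseChange_of_essFiniteType (k : Type) [Field k] (Y : Scheme.{0}) (f : Y ⟶ Spec (.of k))
    [LocallyOfFiniteType f] (X : Y.IdealSheafData)
    (k' : Type) [Field k'] [Algebra k k'] [Algebra.FormallySmooth k k'] [Algebra.EssFiniteType k k']
    (Y' : Scheme.{0}) (f' : Y' ⟶ Spec (.of k')) (g : Y' ⟶ Y)
    (hsq : IsPullback g f' f (Spec.map (CommRingCat.ofHom (algebraMap k k'))))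
    (η' : Y') (hdim' : ringKrullDim (Y'.presheaf.stalk η') = ((2 : ℕ) : WithBot ℕ∞))
    (hreg : IsRegularLocalRing (Y.presheaf.stalk (g.base η')))
    (hdim : ringKrullDim (Y.presheaf.stalk (g.base η')) = ((2 : ℕ) : WithBot ℕ∞))
    (hprinc : (stalkIdeal X (g.base η')).IsPrincipal)
    (x : Fin 2 → Y.presheaf.stalk (g.base η')) (w : Fin 2 → ℕ) (ℓ : ℕ)
    (hx : IsLexMaxWeightedCentreGerm (Y.presheaf.stalk (g.base η')) (stalkIdeal X (g.base η')) x w ℓ) :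
    IsLexMaxWeightedCentreGerm (Y'.presheaf.stalk η') (stalkIdeal (X.comap g) η')
      (fun i => (g.stalkMap η').hom (x i)) w ℓ := by
  obtain ⟨h𝔪, hreg', hflat, hfs⟩ := separableBaseChange_localData f k' hsq η' hreg hdim hdim'
  letI := (g.stalkMap η').hom.toAlgebra
  haveI : IsLocalHom (algebraMap (Y.presheaf.stalk (g.base η')) (Y'.presheaf.stalk η')) :=
    inferInstanceAs (IsLocalHom (g.stalkMap η').hom)
  haveI : Module.Flat (Y.presheaf.stalk (g.base η')) (Y'.presheaf.stalk η') := hflat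
  haveI : Module.FaithfullyFlat (Y.presheaf.stalk (g.base η')) (Y'.presheaf.stalk η') :=
    Module.FaithfullyFlat.of_flat_of_isLocalHom
  haveI := hreg
  haveI := hreg'
  -- the residue field extension is relatively `p`-radically closed
  letI algκ := (IsLocalRing.ResidueField.map (g.stalkMap η').hom).toAlgebra
  haveI : Algebra.FormallySmooth (ResidueField (Y.presheaf.stalk (g.base η'))) (ResidueField (Y'.presheaf.stalk η')) := hfs
  obtain ⟨p, hp⟩ := ExpChar.exists (ResidueField (Y.presheaf.stalk (g.base η')))
  haveI : ExpChar (ResidueField (Y'.presheaf.stalk η')) p :=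
    expChar_of_injective_algebraMap
      (algebraMap (ResidueField (Y.presheaf.stalk (g.base η'))) (ResidueField (Y'.presheaf.stalk η'))).injective p
  have hcl : ∀ z : ResidueField (Y'.presheaf.stalk η'),
      z ^ p ∈ (ResidueField.map (algebraMap (Y.presheaf.stalk (g.base η')) (Y'.presheaf.stalk η'))).range →
        z ∈ (ResidueField.map (algebraMap (Y.presheaf.stalk (g.base η')) (Y'.presheaf.stalk η'))).range :=
    fun z hz => mem_range_algebraMap_of_pow_mem p hz
  -- the principal ideal and the local theorem
  haveI := hprinc
  have hgen := Ideal.span_singleton_generator (stalkIdeal X (g.base η'))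
  rw [← hgen] at hx
  have key := isLexMaxWeightedCentreGerm_map hdim hdim' h𝔪 p hcl hx
  rw [stalkIdeal_comap_eq_map_stalkMap, ← hgen, Ideal.map_span, Set.image_singleton]
  exact key

end Literature.AlgebraicGeometry.Resolution.WeightedInvariant.AQSBaseChange

end Part11

/-!
## Part 12 — port of `Summits/ResolutionOfSingularities/ResolutionOfSingularities/Theorems/WeightedInvariantAQSBaseChangeHolds.lean`

# Abramovich–Quek–Schober's separable base change: the named fact `AbramovichQuekSchober2025_separableBaseChange` HOLDS

Route `ResolutionOfSingularities/WeightedInvariant`, door crux `HypersurfaceCentreConstruction`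
(stmt-ResolutionOfSingularities-19897) — OURS, helper (counted 0); e-ladder `e = 1`, the RESIDUAL of piece
**(o25-δ)** «separable base change of the Abramovich–Quek–Schober centre in the kernel» recorded by its owner
res-D-pv-025 (DONE 2026-08-27T12:42:39Z: «literal `AbramovichQuekSchober2025_separableBaseChange_holds` for ALL
formally smooth `k′` ⇐ Matsumura Thm 28.7 (dim-0 fibre case), not in the tree») and by res-type-047 (SCOPE NOTE
10:27:19Z: «the general `_holds` then waits only on a Literature «28.7/MacLane» brick»).

`AbramovichQuekSchober2025_separableBaseChange_holds : AbramovichQuekSchober2025_separableBaseChange` — the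
DISCHARGE of the Literature named fact (`Literature/AlgebraicGeometry/Resolution/HypersurfaceHeightTwoWeightedCentre.lean`,
Abramovich–Quek–Schober, arXiv:2507.01232, Thm 1.3 (1) / Thm 3.5, last clause: "Moreover, `J` is stable under base
change to separable field extensions of `k`"), for EVERY formally smooth `k′/k` as typed (no finiteness hypothesis
on `k′/k`).  The proof is res-D-pv-025's `AQSBaseChange.separableBaseChange_of_essFiniteType` (p529007) verbatim,
with res-type-047's (δ2) `separableBaseChange_localData` (p526461, `[Algebra.EssFiniteType k k']`) replaced by the
Literature lemma `Literature.AlgebraicGeometry.Resolution.formallySmoothBaseChange_localData`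
(`FormallySmoothFieldBaseChangeStalks.lean`), whose fibre-is-a-field step is Matsumura, *Commutative Ring Theory*,
§28 Lemma 1 / Thm 28.7 in dimension `0` — an Artinian local ring formally smooth over a field is a field — now a
PROVED Literature theorem (`Literature.RingTheory.Smooth.isField_of_isArtinianRing_of_formallySmooth`,
`ArtinianFormallySmoothField.lean`, p534099).  Inputs consumed by name: (δ-field)
`AQSBaseChange.mem_range_algebraMap_of_pow_mem` (p522038) and the LOCAL THEOREM (δ1c)
`AQSBaseChange.isLexMaxWeightedCentreGerm_map` (p528382), both res-D-pv-025.

Def-free; 0 named facts; net debt −1 (F-55 (b) of the cell's FACT-LIST).  A kernel theorem about weighted-centre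
germs of hypersurfaces at height-two points under base change along formally smooth field extensions; nothing here
is a claim about H. Hironaka's manuscript or about resolution in positive characteristic.  AI-written; weaker than
expert review.  [cite: AbramovichQuekSchober2025, Thm 1.3 (1) / Thm 3.5 (arXiv:2507.01232v1 p. 2 L52–L53, p. 7 L18–L19,
proof p. 7 L94 – p. 8 L40; v3 p. 3 L16–L20, p. 7 L67–L74, p. 8 L75 – p. 9 L7); Matsumura1987, §28 Lemma 1 (p. 216), Thm. 28.7 (p. 219)]
-/

section Part12


namespace Literature.AlgebraicGeometry.Resolution.WeightedInvariant.AQSBaseChange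

open _root_.CategoryTheory _root_.AlgebraicGeometry _root_.IsLocalRing _root_.Literature.AlgebraicGeometry.Resolution

/-- **Abramovich–Quek–Schober, Thm 1.3 (1) «`J` is stable under base change to separable field extensions of
`k`», for every formally smooth `k′/k`.**  The statement of `AbramovichQuekSchober2025_separableBaseChange` with all
its binders explicit (res-D-pv-025's `separableBaseChange_of_essFiniteType` without `[Algebra.EssFiniteType k k']`).
[cite: AbramovichQuekSchober2025, Thm 1.3 (1), Thm 3.5 (proof p. 7 L94 – p. 8 L40); Matsumura1987, §28 Lemma 1] -/
theorem separableBaseChange (k : Type) [Field k] (Y : Scheme.{0}) (f : Y ⟶ Spec (.of k))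
    [LocallyOfFiniteType f] (X : Y.IdealSheafData)
    (k' : Type) [Field k'] [Algebra k k'] [Algebra.FormallySmooth k k']
    (Y' : Scheme.{0}) (f' : Y' ⟶ Spec (.of k')) (g : Y' ⟶ Y)
    (hsq : IsPullback g f' f (Spec.map (CommRingCat.ofHom (algebraMap k k'))))
    (η' : Y') (hdim' : ringKrullDim (Y'.presheaf.stalk η') = ((2 : ℕ) : WithBot ℕ∞))
    (hreg : IsRegularLocalRing (Y.presheaf.stalk (g.base η')))
    (hdim : ringKrullDim (Y.presheaf.stalk (g.base η')) = ((2 : ℕ) : WithBot ℕ∞))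
    (hprinc : (stalkIdeal X (g.base η')).IsPrincipal)
    (x : Fin 2 → Y.presheaf.stalk (g.base η')) (w : Fin 2 → ℕ) (ℓ : ℕ)
    (hx : IsLexMaxWeightedCentreGerm (Y.presheaf.stalk (g.base η')) (stalkIdeal X (g.base η')) x w ℓ) :
    IsLexMaxWeightedCentreGerm (Y'.presheaf.stalk η') (stalkIdeal (X.comap g) η')
      (fun i => (g.stalkMap η').hom (x i)) w ℓ := by
  obtain ⟨h𝔪, hreg', hflat, hfs, -⟩ := formallySmoothBaseChange_localData f k' hsq η' hreg hdim hdim'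
  letI := (g.stalkMap η').hom.toAlgebra
  haveI : IsLocalHom (algebraMap (Y.presheaf.stalk (g.base η')) (Y'.presheaf.stalk η')) :=
    inferInstanceAs (IsLocalHom (g.stalkMap η').hom)
  haveI : Module.Flat (Y.presheaf.stalk (g.base η')) (Y'.presheaf.stalk η') := hflat
  haveI : Module.FaithfullyFlat (Y.presheaf.stalk (g.base η')) (Y'.presheaf.stalk η') :=
    Module.FaithfullyFlat.of_flat_of_isLocalHom
  haveI := hreg
  haveI := hreg'
  -- the residue field extension is relatively `p`-radically closed
  letI algκ := (IsLocalRing.ResidueField.map (g.stalkMap η').hom).toAlgebra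
  haveI : Algebra.FormallySmooth (ResidueField (Y.presheaf.stalk (g.base η')))
      (ResidueField (Y'.presheaf.stalk η')) := hfs
  obtain ⟨p, hp⟩ := ExpChar.exists (ResidueField (Y.presheaf.stalk (g.base η')))
  haveI : ExpChar (ResidueField (Y'.presheaf.stalk η')) p :=
    expChar_of_injective_algebraMap
      (algebraMap (ResidueField (Y.presheaf.stalk (g.base η'))) (ResidueField (Y'.presheaf.stalk η'))).injective p
  have hcl : ∀ z : ResidueField (Y'.presheaf.stalk η'),
      z ^ p ∈ (ResidueField.map (algebraMap (Y.presheaf.stalk (g.base η')) (Y'.presheaf.stalk η'))).range →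
        z ∈ (ResidueField.map (algebraMap (Y.presheaf.stalk (g.base η')) (Y'.presheaf.stalk η'))).range :=
    fun z hz => mem_range_algebraMap_of_pow_mem p hz
  -- the principal ideal and the local theorem
  haveI := hprinc
  have hgen := Ideal.span_singleton_generator (stalkIdeal X (g.base η'))
  rw [← hgen] at hx
  have key := isLexMaxWeightedCentreGerm_map hdim hdim' h𝔪 p hcl hx
  rw [stalkIdeal_comap_eq_map_stalkMap, ← hgen, Ideal.map_span, Set.image_singleton]
  exact key

/-- **DISCHARGE of the named fact `AbramovichQuekSchober2025_separableBaseChange`** (Abramovich–Quek–Schober 2025,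
Thm 1.3 (1) / Thm 3.5, last clause: "Moreover, `J` is stable under base change to separable field extensions of
`k`", as typed in `Literature/AlgebraicGeometry/Resolution/HypersurfaceHeightTwoWeightedCentre.lean`): the statement
holds literally, for every formally smooth `k′/k`.  Users of `(h : AbramovichQuekSchober2025_separableBaseChange)` are fed
this theorem. [cite: AbramovichQuekSchober2025, Thm 1.3 (1) / Thm 3.5; Matsumura1987, §28 Lemma 1 (p. 216)] -/
theorem separableBaseChange_allFormallySmooth : AbramovichQuekSchober2025_separableBaseChange := by
  intro k _ Y f _ X k' _ _ _ Y' f' g hsq η' hdim' hreg hdim hprinc _ _ x w ℓ hx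
  exact separableBaseChange k Y f X k' Y' f' g hsq η' hdim' hreg hdim hprinc x w ℓ hx

end Literature.AlgebraicGeometry.Resolution.WeightedInvariant.AQSBaseChange

end Part12

/-! ## Part 13 — the EXACT discharge(s) -/

/-- **Abramovich–Quek–Schober 2025, Thm 1.3 (1) / Thm 3.5 (last clause) HOLDS** — the named fact
`Literature.AlgebraicGeometry.Resolution.AbramovichQuekSchober2025_separableBaseChange` under its discharge name of record: for a
formally smooth field extension `k'/k`, the base change `Y' = Y ×_k k' → Y` of a `k`-scheme locally of finite type, a marked ideal
`X` and a point `η'` over a regular 2-dimensional point `η` at which `𝒪_{Y',η'}` is still 2-dimensional (hypersurface, height-two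
hypotheses as typed), the image of a lex-maximal admissible weighted centre germ `(x; w; ℓ)` of `X_η` is the lex-maximal admissible
weighted centre germ of `(X𝒪_{Y'})_{η'}` — Part 12's `AQSBaseChange.separableBaseChange_allFormallySmooth` (the cell's
essentially-finite-type theorem + `formallySmoothBaseChange_localData`, Matsumura Thm 28.7 in dimension 0).  Summits-side twin:
`Summit.ResolutionOfSingularities.ResolutionOfSingularities.Theorems.AQSBaseChange.AbramovichQuekSchober2025_separableBaseChange_holds`.
[cite: AbramovichQuekSchober2025, Thm 1.3 (1) / Thm 3.5 (arXiv:2507.01232v1 p. 2 L52–L53, p. 7 L18–L19, proof p. 7 L94 – p. 8 L40)] [cite: Matsumura1987, §28 Lemma 1, Thm. 28.7] -/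
theorem Literature.AlgebraicGeometry.Resolution.AbramovichQuekSchober2025_separableBaseChange_holds :
    Literature.AlgebraicGeometry.Resolution.AbramovichQuekSchober2025_separableBaseChange :=
  Literature.AlgebraicGeometry.Resolution.WeightedInvariant.AQSBaseChange.separableBaseChange_allFormallySmooth

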